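import Literature.Probability.LatticeModels.SquareTilingModulusProofs
import Literature.Analysis.Complex.AnnulusCrossing
import Literature.Probability.RandomPlanarGeometry.MarkedDomainCorners
import Mathlib.Analysis.Calculus.FDeriv.Measurable
import HarnessLib

/-!
# Square tilings of lattice domains, II: `lim sup_n R^eff_n ≤ d_Ω(T, B)` ([GP19] Cor 4.15, upper half)

Topic: Probability / LatticeModels. Continuation of `SquareTilingModulusProofs.lean` (§1–§7: the
discretisation `Ω_n` of [GP19] §3, Lemma 4.4, the potentials `h_n`, interior estimates,
subsequential limits, the no-circuit bridge and boundary values). Here, following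
A. Georgakopoulos and C. Panagiotis, *Convergence of square tilings to the Riemann map*,
arXiv:1910.06886 (**[GP19]**), §4.1 and §4.5, restricted to the potential (no conjugate function):

* §8 second differences and the `C¹` limit: the discrete second-difference estimate inside `Ω`
  (`SquareTiling.exists_forall_abs_second_diff_le`, from §5 applied to first differences),
  existence of the locally uniform limits of the difference quotients along a convergent
  subsequence and identification with the partial derivatives of the limit `v`
  (`SquareTiling.exists_partialDeriv_limit`, `SquareTiling.hasFDerivAt_of_quotient_bounds`);
* §9 the Fatou step: `∫_Ω |∇v|² ≤ lim 𝓔(h_n)` when the difference quotients converge locally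
  uniformly and every compact subset of `Ω` is eventually covered by lattice edges of `Ω_n`
  (`SquareTiling.lintegral_norm_fderiv_sq_le`, Riemann sums on compact exhaustions);
* §10 the continuum extremal-length step: a function `v`, differentiable on `Ω`, with
  `∫_Ω |∇v|² ≤ I`, `v → 1` at the interior points of `T` and `v → 0` at those of `B`, gives
  `d_Ω(T, B)⁻¹ ≤ I` (`SquareTiling.inv_extremalDistance_le`: the metric `|∇v|` plus logarithmic
  bumps of arbitrarily small area at the four corners, tested against the tree's
  `extremalDistance`; curves are handled through `AnnulusCrossing`/`MarkedDomainCorners`);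
* §11 assembly: eventual interior vertices and edges (`SquareTiling.eventually_adj_nearestSite`,
  `SquareTiling.eventually_axisEdges_mem`), the local `C¹` structure of subsequential limits
  (`SquareTiling.exists_local_hasFDerivAt`), the subsequential bound `d_Ω(T,B)⁻¹ ≤ lim 𝒞_n`
  (`SquareTiling.inv_extremalDistance_le_of_subseq`) and
  **`lim sup_n R^eff(T_n ↔ B_n; Ω_n) ≤ d_Ω(T, B)`**
  (`SquareTiling.limsup_effectiveResistance_le_extremalDistance`).

Everything here is proved; no named fact is introduced. The lower half
`lim inf_n R^eff_n ≥ d_Ω(T, B)` of [GP19] Cor 4.15 (discrete conjugate / square-tiling map,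
[GP19] §4.2–4.4) is not in this file.

## References

* [GeorgakopoulosPanagiotis2019] A. Georgakopoulos, C. Panagiotis, *Convergence of square tilings
  to the Riemann map*, arXiv:1910.06886 (2019), Thm 4.1, Lemma 4.2, Thm 4.3, Thm 4.6, §4.5,
  Cor 4.15 (p. 16).
* [Ahlfors1973] L. V. Ahlfors, *Conformal Invariants*, McGraw-Hill 1973, Ch. 4 §4-1–4-3
  (extremal length and extremal distance; the tree's `ExtremalLength.lean`).
* [LawlerLimic2010] G. F. Lawler, V. Limic, *Random Walk: A Modern Introduction*, CUP 2010,
  Thm 6.3.8 (difference estimates; the tree's `BoxDirichlet.lean`).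
-/

noncomputable section

namespace Literature.Probability.LatticeModels

open _root_.Filter _root_.Set _root_.Metric
open scoped ENNReal NNReal _root_.Topology

namespace SquareTiling

/-! ### §8. Second differences and the `C¹` limit ([GP19], Lemma 4.2, derivative part) -/

section SecondDifferences

variable {Ω : Set ℂ} {δ : ℝ}

/-- The lattice Laplacian commutes with translations. [folklore] -/
theorem latticeLaplacian_shift (h : Site 2 → ℝ) (e v : Site 2) :
    latticeLaplacian (fun y => h (y + e)) v = latticeLaplacian h (v + e) := by
  simp only [latticeLaplacian, add_right_comm]

/-- A discrete partial derivative `y ↦ h (y + eⱼ) - h y` of a function harmonic on the open box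
of side `N + 2` at `a - (1,1)` is harmonic on the open box of side `N` at `a`. [folklore] -/
theorem isLatticeHarmonicOn_diff {h : Site 2 → ℝ} {a : Site 2} {N : ℕ}
    (hh : IsLatticeHarmonicOn h (boxInterior (a - ![1, 1]) (N + 2))) (j : Fin 4) :
    IsLatticeHarmonicOn (fun y => h (y + cornerUnit j) - h y) (boxInterior a N) := by
  intro v hv
  obtain ⟨h0, h0', h1, h1'⟩ := hv
  have e : (fun y => h (y + cornerUnit j) - h y) = (fun y => h (y + cornerUnit j)) - h := rfl
  rw [e, latticeLaplacian_sub, latticeLaplacian_shift]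
  have hv1 : v ∈ boxInterior (a - ![1, 1]) (N + 2) := by
    refine ⟨?_, ?_, ?_, ?_⟩ <;> simp <;> omega
  have hv2 : v + cornerUnit j ∈ boxInterior (a - ![1, 1]) (N + 2) := by
    fin_cases j <;> refine ⟨?_, ?_, ?_, ?_⟩ <;> simp [cornerUnit] <;> omega
  rw [hh _ hv2, hh _ hv1, sub_zero]

open Classical in
/-- **Second-difference estimate for the potential** ([GP19], §4.1: "It is easy to prove
inductively using Theorem 4.3 that all partial derivatives of order `k` of `h_n` … are locally
bounded", here `k = 2`): if `B̄(z, r) ⊆ Ω`, then for all meshes `δ < δ₀` every potential `h` of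
`Ω_n` satisfies `|h(x + eₖ + eⱼ) - h(x + eₖ) - h(x + eⱼ) + h(x)| ≤ 4096 K² δ² / r²` at every lattice
point `x` with mesh point in `B(z, r/16)` (the interior gradient estimate applied to the discrete
partial derivative, itself lattice harmonic and bounded by `32 K δ / r` nearby).
[cite: GeorgakopoulosPanagiotis2019, §4.1] -/
theorem exists_forall_abs_second_diff_le (hΩo : IsOpen Ω) (hΩc : IsConnected Ω) (hne : Ωᶜ.Nonempty)
    (h0 : (0 : ℂ) ∈ Ω) {T B : Set ℂ} {z : ℂ} {r : ℝ} (hr : 0 < r) (hzr : closedBall z r ⊆ Ω) :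
    ∃ δ₀ > 0, ∀ δ, 0 < δ → δ < δ₀ → ∀ h : Site 2 → ℝ, (∀ x, h x ∈ Icc (0 : ℝ) 1) →
      (∀ x, x ∉ arcVertices Ω δ T → x ∉ arcVertices Ω δ B →
        ∑ y ∈ ((zdGraph 2).neighborFinset x).filter (fun y => (domainGraph Ω δ).Adj x y),
          (h y - h x) = 0) →
      ∀ x : Site 2, meshPoint δ x ∈ ball z (r / 16) → ∀ j k : Fin 4,
        |(h (x + cornerUnit k + cornerUnit j) - h (x + cornerUnit k)) - (h (x + cornerUnit j) - h x)| ≤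
          4096 * topGradConst ^ 2 * δ ^ 2 / r ^ 2 := by
  obtain ⟨δ₁, hδ₁, hstep⟩ := exists_forall_abs_sub_le hΩo hΩc hne h0 (T := T) (B := B) hr hzr
  obtain ⟨δ₂, hδ₂, hdom⟩ := exists_forall_mem_domain hΩo hΩc hne h0 (isCompact_closedBall z r) hzr
  refine ⟨min (min δ₁ δ₂) (r / 288), by positivity, fun δ hδ hδlt h h01 hharm x hx j k => ?_⟩
  have hδ₁' : δ < δ₁ := hδlt.trans_le ((min_le_left _ _).trans (min_le_left _ _))
  have hδ₂' : δ < δ₂ := hδlt.trans_le ((min_le_left _ _).trans (min_le_right _ _))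
  have hδr : δ < r / 288 := hδlt.trans_le (min_le_right _ _)
  have hK := topGradConst_pos
  -- the box: side `2M`, `M = ⌊r / (32 δ)⌋ ≥ 8`, corner `a = x - (M, M)`
  set M : ℕ := ⌊r / (32 * δ)⌋₊ with hM
  have hMle : (M : ℝ) ≤ r / (32 * δ) := Nat.floor_le (by positivity)
  have hMge : r / (32 * δ) - 1 ≤ M := (Nat.sub_one_lt_floor _).le
  have h9 : (9 : ℝ) ≤ r / (32 * δ) := by rw [le_div_iff₀ (by positivity)]; linarith
  have hM8 : 8 ≤ M := by
    have : (8 : ℝ) ≤ M := by linarith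
    exact_mod_cast this
  set a : Site 2 := ![x 0 - M, x 1 - M] with ha
  have hxmid : x ∈ boxMiddle a (2 * M) := by
    refine ⟨?_, ?_, ?_, ?_⟩ <;> simp only [ha, Matrix.cons_val_zero, Matrix.cons_val_one] <;> push_cast <;> omega
  have h2M : 2 * δ * M ≤ r / 16 := by
    have := mul_le_mul_of_nonneg_left hMle (by positivity : (0 : ℝ) ≤ 2 * δ)
    rwa [show 2 * δ * (r / (32 * δ)) = r / 16 by field_simp; ring] at this
  -- points of the closed square (and one step beyond) are within `r / 4` of `z`
  have hnear : ∀ y : Site 2, |((y 0 : ℝ)) - x 0| ≤ M + 1 → |((y 1 : ℝ)) - x 1| ≤ M + 1 →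
      meshPoint δ y ∈ ball z (r / 4) := by
    intro y hy0 hy1
    rw [mem_ball]
    have hxz : dist (meshPoint δ x) z < r / 16 := mem_ball.1 hx
    have hyx : dist (meshPoint δ y) (meshPoint δ x) ≤ 2 * δ * (M + 1) := by
      rw [Complex.dist_eq]
      refine (Complex.norm_le_abs_re_add_abs_im _).trans ?_
      simp only [Complex.sub_re, Complex.sub_im, meshPoint_re, meshPoint_im, ← mul_sub, abs_mul,
        abs_of_pos hδ]
      nlinarith
    calc dist (meshPoint δ y) z ≤ dist (meshPoint δ y) (meshPoint δ x) + dist (meshPoint δ x) z :=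
          dist_triangle _ _ _
      _ < 2 * δ * (M + 1) + r / 16 := by linarith
      _ ≤ r / 4 := by nlinarith
  -- the bigger square (corner `a - (1,1)`, side `2M + 2`) lies in `Ω`; `h` is harmonic on its interior
  have hbig : Complex.Rectangle (meshPoint δ (a - ![1, 1]))
      (meshPoint δ (a - ![1, 1] + ![((2 * M + 2 : ℕ) : ℤ), ((2 * M + 2 : ℕ) : ℤ)])) ⊆ Ω := by
    intro pnt hp
    refine hzr (ball_subset_closedBall ((ball_subset_ball (by linarith : r / 4 ≤ r)) ?_))
    -- `pnt` is in the square of half-size `M + 1` about `x`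
    have hp' : pnt ∈ Complex.Rectangle (meshPoint δ ![x 0 - ((M + 1 : ℕ) : ℤ), x 1 - ((M + 1 : ℕ) : ℤ)])
        (meshPoint δ (![x 0 - ((M + 1 : ℕ) : ℤ), x 1 - ((M + 1 : ℕ) : ℤ)] +
          ![((2 * (M + 1) : ℕ) : ℤ), ((2 * (M + 1) : ℕ) : ℤ)])) := by
      convert hp using 3
      · ext i; fin_cases i <;> simp [ha] <;> ring
      · ext i; fin_cases i <;> simp [ha] <;> ring
    have hd := dist_le_of_mem_square hδ.le hp'
    rw [mem_ball]
    calc dist pnt z ≤ dist pnt (meshPoint δ x) + dist (meshPoint δ x) z := dist_triangle _ _ _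
      _ < 2 * δ * ((M + 1 : ℕ) : ℝ) + r / 16 := by linarith [mem_ball.1 hx]
      _ ≤ r / 4 := by push_cast; nlinarith
  have haD' : a - ![1, 1] ∈ domain Ω δ := by
    refine hdom δ hδ hδ₂' _ (ball_subset_closedBall ((ball_subset_ball (by linarith : r / 4 ≤ r))
      (hnear _ ?_ ?_)))
    · simp [ha]
      rw [show ((x 0 : ℝ) - M - 1 - x 0) = -(M + 1 : ℝ) by ring, abs_neg, abs_of_nonneg (by positivity)]
    · simp [ha]
      rw [show ((x 1 : ℝ) - M - 1 - x 1) = -(M + 1 : ℝ) by ring, abs_neg, abs_of_nonneg (by positivity)]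
  have hharm_big := isLatticeHarmonicOn_boxInterior (T := T) (B := B) hδ hΩo hharm haD' hbig
  have hharmD := isLatticeHarmonicOn_diff (N := 2 * M) hharm_big j
  -- the discrete derivative is bounded by `32 K δ / r` on the sides of the box (indeed nearby)
  set Bd : ℝ := 32 * topGradConst * δ / r with hBd
  have hBd0 : 0 ≤ Bd := by positivity
  have hside : ∀ i : ℕ, 0 < i → i < 2 * M →
      |(fun y => h (y + cornerUnit j) - h y) ![a 0 + i, a 1 + (2 * M : ℕ)]| ≤ Bd ∧
      |(fun y => h (y + cornerUnit j) - h y) ![a 0 + i, a 1]| ≤ Bd ∧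
      |(fun y => h (y + cornerUnit j) - h y) ![a 0, a 1 + i]| ≤ Bd ∧
      |(fun y => h (y + cornerUnit j) - h y) ![a 0 + (2 * M : ℕ), a 1 + i]| ≤ Bd := by
    intro i hi hi'
    have hiM : (i : ℝ) < 2 * M := by exact_mod_cast hi'
    refine ⟨hstep δ hδ hδ₁' h h01 hharm _ (hnear _ ?_ ?_) j, hstep δ hδ hδ₁' h h01 hharm _ (hnear _ ?_ ?_) j,
      hstep δ hδ hδ₁' h h01 hharm _ (hnear _ ?_ ?_) j, hstep δ hδ hδ₁' h h01 hharm _ (hnear _ ?_ ?_) j⟩ <;>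
      simp [ha] <;> rw [abs_le] <;> constructor <;> linarith
  have hgrad := harmonic_box_gradient_le a (2 * M) (by omega) hharmD hBd0 hside hxmid k
  -- rewrite and bound the constant
  have hN' : r / (32 * δ) ≤ ((2 * M : ℕ) : ℝ) := by push_cast; linarith
  have hNpos : (0 : ℝ) < ((2 * M : ℕ) : ℝ) := by positivity
  have hfinal : 4 * topGradConst * Bd / ((2 * M : ℕ) : ℝ) ≤ 4096 * topGradConst ^ 2 * δ ^ 2 / r ^ 2 := by
    rw [div_le_div_iff₀ hNpos (by positivity), hBd]
    calc 4 * topGradConst * (32 * topGradConst * δ / r) * r ^ 2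
        = 4096 * topGradConst ^ 2 * δ ^ 2 * (r / (32 * δ)) := by field_simp; ring
      _ ≤ 4096 * topGradConst ^ 2 * δ ^ 2 * ((2 * M : ℕ) : ℝ) := by gcongr
  have e : x + cornerUnit k + cornerUnit j = x + cornerUnit k + cornerUnit j := rfl
  calc |(h (x + cornerUnit k + cornerUnit j) - h (x + cornerUnit k)) - (h (x + cornerUnit j) - h x)|
      = |(fun y => h (y + cornerUnit j) - h y) (x + cornerUnit k) - (fun y => h (y + cornerUnit j) - h y) x| := rfl
    _ ≤ 4 * topGradConst * Bd / ((2 * M : ℕ) : ℝ) := hgrad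
    _ ≤ _ := hfinal

end SecondDifferences

section DerivativeLimit

variable {Ω : Set ℂ} {δ : ℝ}

/-- **Telescoping with controlled second differences.** If consecutive increments of `H` along
`e` differ by at most `B₂`, then `H (x + m e) - H x` differs from `m (H (x + e) - H x)` by at most
`B₂ m²`. [folklore] -/
theorem abs_sub_sub_mul_le (H : Site 2 → ℝ) (x e : Site 2) {B₂ : ℝ} (hB : 0 ≤ B₂) (m : ℕ)
    (h2 : ∀ i : ℕ, i < m → |(H (x + (i + 1) • e + e) - H (x + (i + 1) • e)) -
      (H (x + i • e + e) - H (x + i • e))| ≤ B₂) :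
    |H (x + m • e) - H x - m * (H (x + e) - H x)| ≤ B₂ * m ^ 2 := by
  set d : ℕ → ℝ := fun i => H (x + i • e + e) - H (x + i • e) with hd
  -- increments stay close to the first one
  have hclose : ∀ i : ℕ, i ≤ m → |d i - d 0| ≤ B₂ * i := by
    intro i
    induction i with
    | zero => intro _; simp
    | succ i ih =>
      intro hi
      have h := h2 i (by omega)
      have := ih (by omega)
      calc |d (i + 1) - d 0| = |(d (i + 1) - d i) + (d i - d 0)| := by ring_nf
        _ ≤ |d (i + 1) - d i| + |d i - d 0| := abs_add_le _ _
        _ ≤ B₂ + B₂ * i := add_le_add h this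
        _ = B₂ * (i + 1 : ℕ) := by push_cast; ring
  -- telescoping
  have htel : H (x + m • e) - H x = ∑ i ∈ Finset.range m, d i := by
    have key : ∀ n : ℕ, H (x + n • e) - H x = ∑ i ∈ Finset.range n, d i := by
      intro n
      induction n with
      | zero => simp
      | succ n ih =>
        rw [Finset.sum_range_succ, ← ih]
        simp only [hd, add_smul, one_smul, ← add_assoc]
        ring
    exact key m
  have hd0 : d 0 = H (x + e) - H x := by simp [hd]
  rw [htel, ← hd0, show (m : ℝ) * d 0 = ∑ i ∈ Finset.range m, d 0 by simp, ← Finset.sum_sub_distrib]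
  calc |∑ i ∈ Finset.range m, (d i - d 0)| ≤ ∑ i ∈ Finset.range m, |d i - d 0| := Finset.abs_sum_le_sum_abs _ _
    _ ≤ ∑ i ∈ Finset.range m, B₂ * m := Finset.sum_le_sum fun i hi => by
        have hi' := Finset.mem_range.1 hi
        exact (hclose i hi'.le).trans (mul_le_mul_of_nonneg_left (by exact_mod_cast hi'.le) hB)
    _ = B₂ * m ^ 2 := by rw [Finset.sum_const, Finset.card_range, nsmul_eq_mul]; ring

/-- Mesh points translate: `δ · (x + m eᵢ) = δ · x + δ m · uᵢ` with `u₀ = 1`, `u₁ = i`. [folklore] -/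
theorem meshPoint_add_nsmul_single (δ : ℝ) (x : Site 2) (m : ℕ) (i : Fin 2) :
    meshPoint δ (x + m • (Pi.single i 1 : Site 2)) =
      meshPoint δ x + (δ * m : ℝ) * (if i = 0 then (1 : ℂ) else Complex.I) := by
  apply Complex.ext
  · fin_cases i
    · simp [meshPoint_re]; ring
    · simp [meshPoint_re]
  · fin_cases i
    · simp [meshPoint_im]
    · simp [meshPoint_im]; ring

/-- The direction vectors `u₀ = 1`, `u₁ = i` have norm `1`. [folklore] -/
theorem norm_dirVec (i : Fin 2) : ‖(if i = 0 then (1 : ℂ) else Complex.I)‖ = 1 := by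
  fin_cases i <;> simp

/-- `Pi.single i 1` is the `cornerUnit` of index `i` (`i = 0, 1`). [folklore] -/
theorem single_eq_cornerUnit_cast (i : Fin 2) :
    (Pi.single i 1 : Site 2) = cornerUnit (Fin.castLE (by norm_num) i) := by
  fin_cases i <;> rfl

/-- **Discrete partial derivatives versus difference quotients of the interpolant, one mesh.**
Let `H : ℤ² → ℝ` have first differences `≤ L₁ δ` and second differences `≤ L₂ δ²` at the lattice
points with mesh point in `B(z, r)`, read at mesh `δ`. For `w ∈ B(z, r/4)`, `0 < s < r/16` and
`δ ≤ s / 2`, the discrete partial derivative at `[w/δ]` in direction `uᵢ` differs from the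
difference quotient `(H([(w + s uᵢ)/δ]) - H([w/δ])) / s` of the piecewise-constant interpolant
by at most `L₂ s + 7 L₁ δ / s`. [folklore] -/
theorem abs_partial_sub_quotient_le (hδ : 0 < δ) {z : ℂ} {r L₁ L₂ : ℝ} (hL₁ : 0 ≤ L₁) (hL₂ : 0 ≤ L₂)
    {H : Site 2 → ℝ}
    (h1 : ∀ x : Site 2, meshPoint δ x ∈ ball z r → ∀ k : Fin 4, |H (x + cornerUnit k) - H x| ≤ L₁ * δ)
    (h2 : ∀ x : Site 2, meshPoint δ x ∈ ball z r → ∀ j k : Fin 4,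
      |(H (x + cornerUnit k + cornerUnit j) - H (x + cornerUnit k)) - (H (x + cornerUnit j) - H x)| ≤ L₂ * δ ^ 2)
    (i : Fin 2) {w : ℂ} (hw : w ∈ ball z (r / 4)) {s : ℝ} (hs : 0 < s) (hsr : s < r / 16) (hδs : δ ≤ s / 2) :
    |(H (nearestSite δ w + Pi.single i 1) - H (nearestSite δ w)) / δ -
      (H (nearestSite δ (w + s * (if i = 0 then (1 : ℂ) else Complex.I))) - H (nearestSite δ w)) / s| ≤
      L₂ * s + 7 * L₁ * δ / s := by
  set u : ℂ := if i = 0 then (1 : ℂ) else Complex.I with hu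
  have hu1 : ‖u‖ = 1 := norm_dirVec i
  set x := nearestSite δ w with hx
  set e : Site 2 := Pi.single i 1 with he
  set m : ℕ := ⌊s / δ⌋₊ with hm
  have hmle : (m : ℝ) ≤ s / δ := Nat.floor_le (by positivity)
  have hmge : s / δ - 1 < m := Nat.sub_one_lt_floor _
  have hmδ : (m : ℝ) * δ ≤ s := by rwa [le_div_iff₀ hδ] at hmle
  have hmδ' : s - δ < m * δ := by
    have := (sub_lt_iff_lt_add.1 hmge); rw [div_lt_iff₀ hδ] at this; linarith
  have h2s : 2 ≤ s / δ := by rw [le_div_iff₀ hδ]; linarith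
  have hm1 : 1 ≤ m := by
    have : (1 : ℝ) ≤ m := by linarith
    exact_mod_cast this
  have hmpos : (0 : ℝ) < m * δ := by positivity
  have hxw : dist (meshPoint δ x) w ≤ δ := dist_meshPoint_nearestSite_le hδ w
  -- lattice points on the segment are in `ball z r`
  have hin : ∀ t : ℕ, t ≤ m + 1 → ∀ k : Fin 4, meshPoint δ (x + t • e) ∈ ball z r ∧
      meshPoint δ (x + t • e + cornerUnit k) ∈ ball z r := by
    intro t ht k
    have hte : meshPoint δ (x + t • e) = meshPoint δ x + (δ * t : ℝ) * u := by
      rw [he, meshPoint_add_nsmul_single]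
    have hstepnorm : dist (meshPoint δ (x + t • e)) (meshPoint δ x) ≤ δ * t := by
      rw [hte, dist_eq_norm, add_sub_cancel_left, norm_mul, hu1, mul_one, Complex.norm_real,
        Real.norm_eq_abs, abs_of_nonneg (by positivity)]
    have hd1 : dist (meshPoint δ (x + t • e)) w ≤ δ + δ * t := by
      linarith [dist_triangle (meshPoint δ (x + t • e)) (meshPoint δ x) w]
    have htm : δ * t ≤ s + δ := by
      have : (t : ℝ) ≤ m + 1 := by exact_mod_cast ht
      nlinarith
    have hwz : dist w z < r / 4 := mem_ball.1 hw
    constructor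
    · rw [mem_ball]
      calc dist (meshPoint δ (x + t • e)) z ≤ dist (meshPoint δ (x + t • e)) w + dist w z := dist_triangle _ _ _
        _ < (δ + δ * t) + r / 4 := by linarith
        _ ≤ r := by linarith
    · rw [mem_ball]
      have hk1 : dist (meshPoint δ (x + t • e + cornerUnit k)) (meshPoint δ (x + t • e)) = |δ| := by
        rw [_root_.dist_comm, Percolation.dist_meshPoint_of_adj (cSrc_mem_edgeSet (x + t • e, k))]
      rw [abs_of_pos hδ] at hk1
      linarith [dist_triangle4 (meshPoint δ (x + t • e + cornerUnit k)) (meshPoint δ (x + t • e)) w z]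
  -- second differences along `e`
  have hcast : e = cornerUnit (Fin.castLE (by norm_num) i) := single_eq_cornerUnit_cast i
  have hsec : ∀ t : ℕ, t < m → |(H (x + (t + 1) • e + e) - H (x + (t + 1) • e)) -
      (H (x + t • e + e) - H (x + t • e))| ≤ L₂ * δ ^ 2 := by
    intro t ht
    have := h2 (x + t • e) (hin t (by omega) 0).1 (Fin.castLE (by norm_num) i) (Fin.castLE (by norm_num) i)
    rw [← hcast] at this
    have e1 : x + (t + 1) • e = x + t • e + e := by rw [add_smul, one_smul, add_assoc]
    rw [e1]
    exact this
  have htel := abs_sub_sub_mul_le H x e (by positivity) m hsec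
  -- (A) `(H(x + m e) - H x)/(m δ)` vs the discrete derivative
  set Dd : ℝ := (H (x + e) - H x) / δ with hDd
  have hA : |(H (x + m • e) - H x) / (m * δ) - Dd| ≤ L₂ * s := by
    have : (H (x + m • e) - H x) / (m * δ) - Dd = (H (x + m • e) - H x - m * (H (x + e) - H x)) / (m * δ) := by
      rw [hDd]; field_simp
    rw [this, abs_div, abs_of_pos hmpos, div_le_iff₀ hmpos]
    calc |H (x + m • e) - H x - m * (H (x + e) - H x)| ≤ L₂ * δ ^ 2 * m ^ 2 := htel
      _ = L₂ * (m * δ) * (m * δ) := by ring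
      _ ≤ L₂ * s * (m * δ) := by gcongr
  -- (B) `H` at `[(w + s u)/δ]` vs at `x + m e`: nearby lattice points
  set y := nearestSite δ (w + s * u) with hy
  have hyd : dist (meshPoint δ y) (meshPoint δ (x + m • e)) ≤ 3 * δ := by
    have h1' : dist (meshPoint δ y) (w + s * u) ≤ δ := dist_meshPoint_nearestSite_le hδ _
    have h2' : dist (meshPoint δ (x + m • e)) (w + s * u) ≤ 2 * δ := by
      have hte : meshPoint δ (x + m • e) = meshPoint δ x + (δ * m : ℝ) * u := by
        rw [he, meshPoint_add_nsmul_single]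
      have hsplit : meshPoint δ x + (δ * m : ℝ) * u - (w + s * u) =
          (meshPoint δ x - w) + ((δ * m - s : ℝ) : ℂ) * u := by
        push_cast; ring
      have hms : |δ * m - s| ≤ δ := by rw [abs_le]; constructor <;> nlinarith
      have hn1 : ‖meshPoint δ x - w‖ ≤ δ := by rw [← dist_eq_norm]; exact hxw
      have hn2 : ‖((δ * m - s : ℝ) : ℂ) * u‖ ≤ δ := by
        rw [norm_mul, hu1, mul_one, Complex.norm_real, Real.norm_eq_abs]; exact hms
      rw [dist_eq_norm, hte, hsplit]
      linarith [norm_add_le (meshPoint δ x - w) (((δ * m - s : ℝ) : ℂ) * u)]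
    linarith [dist_triangle (meshPoint δ y) (w + s * u) (meshPoint δ (x + m • e)),
      dist_comm (w + s * u) (meshPoint δ (x + m • e))]
  have hB : |H y - H (x + m • e)| ≤ 6 * L₁ * δ := by
    -- staircase inside `ball z r`
    have hball : Complex.Rectangle (meshPoint δ y) (meshPoint δ (x + m • e)) ⊆ ball z r := by
      have hte : meshPoint δ (x + m • e) = meshPoint δ x + (δ * m : ℝ) * u := by
        rw [he, meshPoint_add_nsmul_single]
      have hstep' : dist (meshPoint δ (x + m • e)) (meshPoint δ x) ≤ δ * m := by
        rw [hte, dist_eq_norm, add_sub_cancel_left, norm_mul, hu1, mul_one, Complex.norm_real,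
          Real.norm_eq_abs, abs_of_nonneg (by positivity)]
      have hcme : dist (meshPoint δ (x + m • e)) z < 3 * r / 8 := by
        linarith [dist_triangle4 (meshPoint δ (x + m • e)) (meshPoint δ x) w z, mem_ball.1 hw]
      have hyc : dist (meshPoint δ y) z < r / 2 := by
        linarith [dist_triangle (meshPoint δ y) (meshPoint δ (x + m • e)) z]
      have hc : dist (meshPoint δ (x + m • e)) z < r / 2 := by linarith
      have h2 : (2 : ℝ) * (r / 2) = r := by ring
      rw [← h2]
      exact rectangle_subset_ball hyc hc
    have key := abs_sub_le_mul_of_steps hδ h1 _ y (x + m • e) rfl hball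
    have hℓ := natAbs_add_natAbs_le hδ y (x + m • e)
    have hsteps : ((((x + m • e) 0 - y 0).natAbs + ((x + m • e) 1 - y 1).natAbs : ℕ) : ℝ) ≤ 6 := by
      have : ((((x + m • e) 0 - y 0).natAbs + ((x + m • e) 1 - y 1).natAbs : ℕ) : ℝ) * δ ≤ 6 * δ := by
        linarith
      exact le_of_mul_le_mul_right this hδ
    calc |H y - H (x + m • e)| ≤ L₁ * δ * ((((x + m • e) 0 - y 0).natAbs + ((x + m • e) 1 - y 1).natAbs : ℕ) : ℝ) := key
      _ ≤ L₁ * δ * 6 := by gcongr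
      _ = 6 * L₁ * δ := by ring
  -- (C) first differences: `|H(x + m e) - H x| ≤ m L₁ δ`
  have hC : |H (x + m • e) - H x| ≤ m * (L₁ * δ) := by
    have : ∀ t : ℕ, t ≤ m → |H (x + t • e) - H x| ≤ t * (L₁ * δ) := by
      intro t
      induction t with
      | zero => intro _; simp
      | succ t ih =>
        intro ht
        have hprev := ih (by omega)
        have hstep : |H (x + (t + 1) • e) - H (x + t • e)| ≤ L₁ * δ := by
          have := h1 (x + t • e) (hin t (by omega) 0).1 (Fin.castLE (by norm_num) i)
          rw [← hcast] at this
          rwa [add_smul, one_smul, ← add_assoc] 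
        calc |H (x + (t + 1) • e) - H x| = |(H (x + (t + 1) • e) - H (x + t • e)) + (H (x + t • e) - H x)| := by ring_nf
          _ ≤ |H (x + (t + 1) • e) - H (x + t • e)| + |H (x + t • e) - H x| := abs_add_le _ _
          _ ≤ L₁ * δ + t * (L₁ * δ) := add_le_add hstep hprev
          _ = (t + 1 : ℕ) * (L₁ * δ) := by push_cast; ring
    exact this m le_rfl
  -- assemble
  have hq : (H y - H x) / s - (H (x + m • e) - H x) / (m * δ) =
      (H y - H (x + m • e)) / s + (H (x + m • e) - H x) * (m * δ - s) / (s * (m * δ)) := by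
    field_simp; ring
  have hfinal : |(H y - H x) / s - (H (x + m • e) - H x) / (m * δ)| ≤ 7 * L₁ * δ / s := by
    rw [hq]
    refine (abs_add_le _ _).trans ?_
    have t1 : |(H y - H (x + m • e)) / s| ≤ 6 * L₁ * δ / s := by
      rw [abs_div, abs_of_pos hs]; gcongr
    have t2 : |(H (x + m • e) - H x) * (m * δ - s) / (s * (m * δ))| ≤ L₁ * δ / s := by
      rw [abs_div, abs_mul, abs_of_pos (by positivity : 0 < s * (m * δ)), div_le_div_iff₀ (by positivity) hs]
      have hms : |m * δ - s| ≤ δ := by rw [abs_le]; constructor <;> nlinarith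
      calc |H (x + m • e) - H x| * |↑m * δ - s| * s ≤ (m * (L₁ * δ)) * δ * s := by gcongr
        _ = L₁ * δ * (s * (m * δ)) := by ring
    calc |(H y - H (x + m • e)) / s| + |(H (x + m • e) - H x) * (↑m * δ - s) / (s * (↑m * δ))|
        ≤ 6 * L₁ * δ / s + L₁ * δ / s := add_le_add t1 t2
      _ = 7 * L₁ * δ / s := by ring
  calc |Dd - (H y - H x) / s| = |(Dd - (H (x + m • e) - H x) / (m * δ)) + ((H (x + m • e) - H x) / (m * δ) - (H y - H x) / s)| := by ring_nf
    _ ≤ |Dd - (H (x + m • e) - H x) / (m * δ)| + |(H (x + m • e) - H x) / (m * δ) - (H y - H x) / s| := abs_add_le _ _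
    _ ≤ L₂ * s + 7 * L₁ * δ / s := add_le_add (by rw [abs_sub_comm]; exact hA) (by rw [abs_sub_comm]; exact hfinal)

/-- **The partial derivatives of the limit** ([GP19], Lemma 4.2 with Lemma 4.5: the discrete
partial derivatives converge locally uniformly and the limit function is differentiable with
these derivatives — here WITHOUT a further extraction, from the second-difference bound). Let the
piecewise-constant interpolants of `H n` (mesh `δs n → 0`) converge uniformly on `B(z, r)` to
`v`, continuous there, with first differences `≤ L₁ δs n` and second differences `≤ L₂ (δs n)²`
on `B(z, r)` eventually. Then for each lattice direction `uᵢ` (`u₀ = 1`, `u₁ = i`) there is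
`g` continuous on `B(z, r/4)` such that the discrete partial derivatives
`(H n ([w/δ] + eᵢ) - H n [w/δ]) / δs n` converge to `g` uniformly on `B(z, r/4)` and the
difference quotients of `v` satisfy `|(v (w + s uᵢ) - v w)/s - g w| ≤ L₂ s` for `0 < s < r/16`.
[cite: GeorgakopoulosPanagiotis2019, Lemma 4.2] -/
theorem exists_partialDeriv_limit {z : ℂ} {r L₁ L₂ : ℝ} (hr : 0 < r) (hL₁ : 0 ≤ L₁) (hL₂ : 0 ≤ L₂)
    {δs : ℕ → ℝ} (hδ : ∀ n, 0 < δs n) (hδ0 : Tendsto δs atTop (𝓝 0))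
    {H : ℕ → Site 2 → ℝ} {v : ℂ → ℝ}
    (hconv : TendstoUniformlyOn (fun n w => H n (nearestSite (δs n) w)) v atTop (ball z r))
    (hvc : ContinuousOn v (ball z r))
    (h1 : ∀ᶠ n in atTop, ∀ x : Site 2, meshPoint (δs n) x ∈ ball z r → ∀ k : Fin 4,
      |H n (x + cornerUnit k) - H n x| ≤ L₁ * δs n)
    (h2 : ∀ᶠ n in atTop, ∀ x : Site 2, meshPoint (δs n) x ∈ ball z r → ∀ j k : Fin 4,
      |(H n (x + cornerUnit k + cornerUnit j) - H n (x + cornerUnit k)) - (H n (x + cornerUnit j) - H n x)| ≤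
        L₂ * δs n ^ 2)
    (i : Fin 2) :
    ∃ g : ℂ → ℝ, ContinuousOn g (ball z (r / 4)) ∧
      TendstoUniformlyOn
        (fun n w => (H n (nearestSite (δs n) w + Pi.single i 1) - H n (nearestSite (δs n) w)) / δs n)
        g atTop (ball z (r / 4)) ∧
      ∀ w ∈ ball z (r / 4), ∀ s : ℝ, 0 < s → s < r / 16 →
        |(v (w + s * (if i = 0 then (1 : ℂ) else Complex.I)) - v w) / s - g w| ≤ L₂ * s := by
  set u : ℂ := if i = 0 then (1 : ℂ) else Complex.I with hu
  have hu1 : ‖u‖ = 1 := norm_dirVec i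
  set B : Set ℂ := ball z (r / 4) with hB
  set q : ℝ → ℂ → ℝ := fun s w => (v (w + s * u) - v w) / s with hq
  set Dn : ℕ → ℂ → ℝ := fun n w =>
    (H n (nearestSite (δs n) w + Pi.single i 1) - H n (nearestSite (δs n) w)) / δs n with hDn
  -- shifted points stay in the big ball
  have hshift : ∀ w ∈ B, ∀ s : ℝ, 0 < s → s < r / 16 → w + s * u ∈ ball z r := by
    intro w hw s hs hsr
    rw [mem_ball] at hw ⊢
    have : dist (w + s * u) w = s := by
      rw [dist_eq_norm, add_sub_cancel_left, norm_mul, hu1, mul_one, Complex.norm_real,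
        Real.norm_eq_abs, abs_of_pos hs]
    linarith [dist_triangle (w + s * u) w z]
  have hBsub : B ⊆ ball z r := ball_subset_ball (by linarith)
  -- Step C: for fixed `s`, the discrete derivative is eventually close to `q s`, uniformly on `B`
  have hC : ∀ s : ℝ, 0 < s → s < r / 16 → ∀ η : ℝ, 0 < η → ∀ᶠ n in atTop, ∀ w ∈ B,
      |Dn n w - q s w| ≤ L₂ * s + η := by
    intro s hs hsr η hη
    have hδs : ∀ᶠ n in atTop, δs n ≤ s / 2 ∧ 7 * L₁ * δs n / s ≤ η / 2 := by
      have ht1 := (tendsto_order.1 hδ0).2 _ (half_pos hs)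
      have ht2 : Tendsto (fun n => 7 * L₁ * δs n / s) atTop (𝓝 (7 * L₁ * 0 / s)) :=
        (hδ0.const_mul (7 * L₁)).div_const s
      rw [mul_zero, zero_div] at ht2
      have ht2' := (tendsto_order.1 ht2).2 _ (half_pos hη)
      filter_upwards [ht1, ht2'] with n hn hn'
      exact ⟨hn.le, hn'.le⟩
    have hunif := (Metric.tendstoUniformlyOn_iff.1 hconv) (η * s / 4) (by positivity)
    filter_upwards [h1, h2, hδs, hunif] with n hn1 hn2 hn3 hn4 w hw
    -- (A) discrete derivative vs interpolant quotient
    have hA := abs_partial_sub_quotient_le (hδ n) hL₁ hL₂ hn1 hn2 i hw hs hsr hn3.1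
    -- (B) interpolant quotient vs `q s`
    have hw' : w ∈ ball z r := hBsub hw
    have hws : w + s * u ∈ ball z r := hshift w hw s hs hsr
    have e1 := hn4 w hw'
    have e2 := hn4 (w + s * u) hws
    rw [Real.dist_eq] at e1 e2
    have hBq : |(H n (nearestSite (δs n) (w + s * u)) - H n (nearestSite (δs n) w)) / s - q s w| ≤ η / 2 := by
      have : (H n (nearestSite (δs n) (w + s * u)) - H n (nearestSite (δs n) w)) / s - q s w =
          ((H n (nearestSite (δs n) (w + s * u)) - v (w + s * u)) - (H n (nearestSite (δs n) w) - v w)) / s := by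
        simp only [hq]; field_simp; ring
      rw [this, abs_div, abs_of_pos hs, div_le_iff₀ hs]
      calc |H n (nearestSite (δs n) (w + s * u)) - v (w + s * u) - (H n (nearestSite (δs n) w) - v w)|
          ≤ |H n (nearestSite (δs n) (w + s * u)) - v (w + s * u)| + |H n (nearestSite (δs n) w) - v w| :=
            abs_sub _ _
        _ ≤ η * s / 4 + η * s / 4 := by
            gcongr
            · rw [abs_sub_comm]; exact e2.le
            · rw [abs_sub_comm]; exact e1.le
        _ = η / 2 * s := by ring
    calc |Dn n w - q s w| ≤ |Dn n w - (H n (nearestSite (δs n) (w + s * u)) - H n (nearestSite (δs n) w)) / s| +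
          |(H n (nearestSite (δs n) (w + s * u)) - H n (nearestSite (δs n) w)) / s - q s w| := abs_sub_le _ _ _
      _ ≤ (L₂ * s + 7 * L₁ * δs n / s) + η / 2 := add_le_add hA hBq
      _ ≤ L₂ * s + η := by linarith [hn3.2]
  -- Step D: the difference quotients are Cauchy in `s`, uniformly on `B`
  have hD : ∀ s s' : ℝ, 0 < s → s < r / 16 → 0 < s' → s' < r / 16 → ∀ w ∈ B,
      |q s w - q s' w| ≤ L₂ * (s + s') := by
    intro s s' hs hsr hs' hsr' w hw
    refine le_of_forall_pos_le_add fun η hη => ?_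
    obtain ⟨n, hn, hn'⟩ := ((hC s hs hsr (η / 2) (half_pos hη)).and (hC s' hs' hsr' (η / 2) (half_pos hη))).exists
    have e1 := hn w hw
    have e2 := hn' w hw
    calc |q s w - q s' w| ≤ |q s w - Dn n w| + |Dn n w - q s' w| := abs_sub_le _ _ _
      _ ≤ (L₂ * s + η / 2) + (L₂ * s' + η / 2) := add_le_add (by rw [abs_sub_comm]; exact e1) e2
      _ = L₂ * (s + s') + η := by ring
  -- Step E: the limit `g` along `s_k = (r/32)/2^k`
  set sq : ℕ → ℝ := fun k => r / 32 / 2 ^ k with hsq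
  have hsq_pos : ∀ k, 0 < sq k := fun k => by positivity
  have hsq_lt : ∀ k, sq k < r / 16 := fun k => by
    have : (1 : ℝ) ≤ 2 ^ k := one_le_pow₀ (by norm_num)
    rw [hsq, div_lt_iff₀ (by positivity)]
    nlinarith
  have hsq0 : Tendsto sq atTop (𝓝 0) := by
    have := (tendsto_pow_atTop_nhds_zero_of_lt_one (r := (2 : ℝ)⁻¹) (by norm_num) (by norm_num)).const_mul (r / 32)
    rw [mul_zero] at this
    refine this.congr' (Eventually.of_forall fun k => ?_)
    simp [hsq, div_eq_mul_inv, inv_pow]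
  have hcauchy : ∀ w ∈ B, CauchySeq fun k => q (sq k) w := by
    intro w hw
    rw [Metric.cauchySeq_iff]
    intro ε hε
    obtain ⟨N, hN⟩ := eventually_atTop.1 ((tendsto_order.1 hsq0).2 _ (show 0 < ε / (4 * (L₂ + 1)) by positivity))
    refine ⟨N, fun k hk l hl => ?_⟩
    rw [Real.dist_eq]
    calc |q (sq k) w - q (sq l) w| ≤ L₂ * (sq k + sq l) := hD _ _ (hsq_pos k) (hsq_lt k) (hsq_pos l) (hsq_lt l) w hw
      _ ≤ (L₂ + 1) * (ε / (4 * (L₂ + 1)) + ε / (4 * (L₂ + 1))) := by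
          refine mul_le_mul (by linarith) (add_le_add (hN k hk).le (hN l hl).le) ?_ (by linarith)
          linarith [hsq_pos k, hsq_pos l]
      _ = ε / 2 := by field_simp; ring
      _ < ε := by linarith
  set g : ℂ → ℝ := fun w => limUnder atTop fun k => q (sq k) w with hg
  have hglim : ∀ w ∈ B, Tendsto (fun k => q (sq k) w) atTop (𝓝 (g w)) := fun w hw =>
    tendsto_nhds_limUnder (cauchySeq_tendsto_of_complete (hcauchy w hw))
  -- `|q s - g| ≤ L₂ s`
  have hqg : ∀ w ∈ B, ∀ s : ℝ, 0 < s → s < r / 16 → |q s w - g w| ≤ L₂ * s := by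
    intro w hw s hs hsr
    have hlim : Tendsto (fun k => |q s w - q (sq k) w|) atTop (𝓝 |q s w - g w|) :=
      (tendsto_const_nhds.sub (hglim w hw)).abs
    have hbound : Tendsto (fun k => L₂ * (s + sq k)) atTop (𝓝 (L₂ * (s + 0))) :=
      (tendsto_const_nhds.add hsq0).const_mul L₂
    rw [add_zero] at hbound
    exact le_of_tendsto_of_tendsto' hlim hbound fun k => hD _ _ hs hsr (hsq_pos k) (hsq_lt k) w hw
  refine ⟨g, ?_, ?_, hqg⟩
  · -- Step G: continuity of `g` on `B` (uniform limit of continuous difference quotients)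
    have hqcont : ∀ k, ContinuousOn (q (sq k)) B := by
      intro k
      have h1' : ContinuousOn (fun w => v (w + sq k * u)) B :=
        hvc.comp (continuousOn_id.add continuousOn_const) fun w hw => hshift w hw _ (hsq_pos k) (hsq_lt k)
      exact (h1'.sub (hvc.mono hBsub)).div_const _
    have hunif : TendstoUniformlyOn (fun k => q (sq k)) g atTop B := by
      rw [Metric.tendstoUniformlyOn_iff]
      intro ε hε
      obtain ⟨N, hN⟩ := eventually_atTop.1 ((tendsto_order.1 hsq0).2 _ (show 0 < ε / (2 * (L₂ + 1)) by positivity))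
      refine eventually_atTop.2 ⟨N, fun k hk w hw => ?_⟩
      rw [Real.dist_eq, abs_sub_comm]
      calc |q (sq k) w - g w| ≤ L₂ * sq k := hqg w hw _ (hsq_pos k) (hsq_lt k)
        _ ≤ (L₂ + 1) * (ε / (2 * (L₂ + 1))) :=
            mul_le_mul (by linarith) (hN k hk).le (hsq_pos k).le (by linarith)
        _ = ε / 2 := by field_simp
        _ < ε := by linarith
    exact hunif.continuousOn (Eventually.of_forall hqcont).frequently
  · -- Step F: uniform convergence of the discrete derivatives to `g`
    rw [Metric.tendstoUniformlyOn_iff]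
    intro ε hε
    set s : ℝ := min (r / 32) (ε / (4 * (L₂ + 1))) with hs
    have hs0 : 0 < s := by positivity
    have hsr : s < r / 16 := by
      have : s ≤ r / 32 := min_le_left _ _
      linarith
    have hL₂s : L₂ * s ≤ ε / 4 := by
      calc L₂ * s ≤ (L₂ + 1) * (ε / (4 * (L₂ + 1))) :=
            mul_le_mul (by linarith) (min_le_right _ _) hs0.le (by linarith)
        _ = ε / 4 := by field_simp
    filter_upwards [hC s hs0 hsr (ε / 4) (by positivity)] with n hn w hw
    rw [Real.dist_eq, abs_sub_comm]
    calc |Dn n w - g w| ≤ |Dn n w - q s w| + |q s w - g w| := abs_sub_le _ _ _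
      _ ≤ (L₂ * s + ε / 4) + L₂ * s := add_le_add (hn w hw) (hqg w hw s hs0 hsr)
      _ < ε := by linarith

/-- One-dimensional increments from the quotient bounds: for `|a| < r/16`,
`|v (w₀ + a u) - v w₀ - a g w₀| ≤ |a| (L₂ |a| + |g (w₀ + a u) - g w₀|)` (split according to the
sign of `a`; for `a < 0` the quotient bound is used at the base point `w₀ + a u`). [folklore] -/
theorem abs_incr_sub_mul_le {z : ℂ} {r L₂ : ℝ} {v g : ℂ → ℝ} {u : ℂ}
    (hq : ∀ w ∈ ball z (r / 4), ∀ s : ℝ, 0 < s → s < r / 16 → |(v (w + s * u) - v w) / s - g w| ≤ L₂ * s)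
    {w₀ : ℂ} {a : ℝ} (hw₀ : w₀ ∈ ball z (r / 4)) (hw₁ : w₀ + a * u ∈ ball z (r / 4)) (ha : |a| < r / 16) :
    |v (w₀ + a * u) - v w₀ - a * g w₀| ≤ |a| * (L₂ * |a| + |g (w₀ + a * u) - g w₀|) := by
  rcases lt_trichotomy a 0 with hneg | rfl | hpos
  · set s : ℝ := -a with hs
    have hs0 : 0 < s := by rw [hs]; linarith
    have hsr : s < r / 16 := by rw [hs]; rwa [abs_of_neg hneg] at ha
    have hbase : w₀ + a * u + s * u = w₀ := by rw [hs]; push_cast; ring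
    have h := hq (w₀ + a * u) hw₁ s hs0 hsr
    rw [hbase] at h
    have h' : |v w₀ - v (w₀ + a * u) - s * g (w₀ + a * u)| ≤ L₂ * s * s := by
      have : (v w₀ - v (w₀ + a * u)) / s - g (w₀ + a * u) = (v w₀ - v (w₀ + a * u) - s * g (w₀ + a * u)) / s := by
        field_simp
      rw [this, abs_div, abs_of_pos hs0, div_le_iff₀ hs0] at h
      exact h
    have hid : v (w₀ + a * u) - v w₀ - a * g w₀ =
        -(v w₀ - v (w₀ + a * u) - s * g (w₀ + a * u)) + a * (g (w₀ + a * u) - g w₀) := by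
      rw [hs]; ring
    rw [hid]
    have habs : |a| = s := by rw [hs, abs_of_neg hneg]
    calc |-(v w₀ - v (w₀ + a * u) - s * g (w₀ + a * u)) + a * (g (w₀ + a * u) - g w₀)|
        ≤ |-(v w₀ - v (w₀ + a * u) - s * g (w₀ + a * u))| + |a * (g (w₀ + a * u) - g w₀)| := abs_add_le _ _
      _ ≤ L₂ * s * s + |a| * |g (w₀ + a * u) - g w₀| := by rw [abs_neg, abs_mul]; gcongr
      _ = |a| * (L₂ * |a| + |g (w₀ + a * u) - g w₀|) := by rw [habs]; ring
  · simp
  · have hsr : a < r / 16 := by rwa [abs_of_pos hpos] at ha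
    have h := hq w₀ hw₀ a hpos hsr
    have h' : |v (w₀ + a * u) - v w₀ - a * g w₀| ≤ L₂ * a * a := by
      have : (v (w₀ + a * u) - v w₀) / a - g w₀ = (v (w₀ + a * u) - v w₀ - a * g w₀) / a := by field_simp
      rw [this, abs_div, abs_of_pos hpos, div_le_iff₀ hpos] at h
      exact h
    calc |v (w₀ + a * u) - v w₀ - a * g w₀| ≤ L₂ * a * a := h'
      _ = |a| * (L₂ * |a| + 0) := by rw [abs_of_pos hpos]; ring
      _ ≤ |a| * (L₂ * |a| + |g (w₀ + a * u) - g w₀|) := by gcongr; exact abs_nonneg _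

/-- **Differentiability of the limit** ([GP19], Lemma 4.5 in our setting): if the horizontal and
vertical difference quotients of `v` are within `L₂ s` of continuous functions `g₀`, `g₁` on
`B(z, r/4)`, then `v` has the Fréchet derivative `ζ ↦ g₀(w) Re ζ + g₁(w) Im ζ` at every point of
`B(z, r/8)` (two-step path: horizontal then vertical increment, continuity of `g₀, g₁`).
[cite: GeorgakopoulosPanagiotis2019, Lemma 4.5] -/
theorem hasFDerivAt_of_quotient_bounds {z : ℂ} {r L₂ : ℝ} (hr : 0 < r) (hL₂ : 0 ≤ L₂) {v g₀ g₁ : ℂ → ℝ}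
    (hg₀c : ContinuousOn g₀ (ball z (r / 4))) (hg₁c : ContinuousOn g₁ (ball z (r / 4)))
    (hq₀ : ∀ w ∈ ball z (r / 4), ∀ s : ℝ, 0 < s → s < r / 16 →
      |(v (w + s * (1 : ℂ)) - v w) / s - g₀ w| ≤ L₂ * s)
    (hq₁ : ∀ w ∈ ball z (r / 4), ∀ s : ℝ, 0 < s → s < r / 16 →
      |(v (w + s * Complex.I) - v w) / s - g₁ w| ≤ L₂ * s)
    {w : ℂ} (hw : w ∈ ball z (r / 8)) :
    HasFDerivAt v (g₀ w • Complex.reCLM + g₁ w • Complex.imCLM) w := by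
  rw [hasFDerivAt_iff_isLittleO_nhds_zero, Asymptotics.isLittleO_iff]
  intro c hc
  have hw4 : w ∈ ball z (r / 4) := ball_subset_ball (by linarith) hw
  -- continuity of `g₀`, `g₁` at `w`, with tolerance `c / 8`
  have hcont : ∀ g : ℂ → ℝ, ContinuousOn g (ball z (r / 4)) →
      ∀ᶠ ζ in 𝓝 (0 : ℂ), ∀ w' : ℂ, dist w' w ≤ ‖ζ‖ → |g w' - g w| ≤ c / 8 := by
    intro g hg
    have hga : ContinuousAt g w := (hg w hw4).continuousAt (isOpen_ball.mem_nhds hw4)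
    obtain ⟨ρ, hρ, hρg⟩ := Metric.continuousAt_iff.1 hga (c / 8) (by positivity)
    filter_upwards [Metric.ball_mem_nhds (0 : ℂ) hρ] with ζ hζ w' hw'
    rw [mem_ball, dist_zero_right] at hζ
    have := hρg (lt_of_le_of_lt hw' hζ)
    rw [Real.dist_eq] at this
    exact this.le
  have hsmall : ∀ᶠ ζ in 𝓝 (0 : ℂ), ‖ζ‖ < min (r / 16) (c / (4 * (L₂ + 1))) :=
    Metric.eventually_nhds_iff.2 ⟨min (r / 16) (c / (4 * (L₂ + 1))), by positivity, fun ζ hζ => by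
      simpa [dist_zero_right] using hζ⟩
  filter_upwards [hcont g₀ hg₀c, hcont g₁ hg₁c, hsmall] with ζ hζ₀ hζ₁ hζ
  have hζr : ‖ζ‖ < r / 16 := hζ.trans_le (min_le_left _ _)
  have hζc : ‖ζ‖ < c / (4 * (L₂ + 1)) := hζ.trans_le (min_le_right _ _)
  set a : ℝ := ζ.re with ha
  set b : ℝ := ζ.im with hb
  have ha' : |a| ≤ ‖ζ‖ := Complex.abs_re_le_norm ζ
  have hb' : |b| ≤ ‖ζ‖ := Complex.abs_im_le_norm ζ
  set w₁ : ℂ := w + a * (1 : ℂ) with hw₁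
  have hζeq : w + ζ = w₁ + b * Complex.I := by
    rw [hw₁, ha, hb, mul_one, add_assoc, Complex.re_add_im]
  have hdw₁ : dist w₁ w = |a| := by
    rw [hw₁, dist_eq_norm, mul_one, add_sub_cancel_left, Complex.norm_real, Real.norm_eq_abs]
  have hdw₂ : dist (w₁ + b * Complex.I) w = ‖ζ‖ := by
    rw [← hζeq, dist_eq_norm, add_sub_cancel_left]
  -- the intermediate points are in `ball z (r/4)`
  have hwz : dist w z < r / 8 := mem_ball.1 hw
  have hw₁in : w₁ ∈ ball z (r / 4) := by
    rw [mem_ball]; linarith [dist_triangle w₁ w z]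
  have hw₂in : w₁ + b * Complex.I ∈ ball z (r / 4) := by
    rw [mem_ball]; linarith [dist_triangle (w₁ + b * Complex.I) w z]
  -- the two one-dimensional increments
  have hP₁ := abs_incr_sub_mul_le (u := (1 : ℂ)) hq₀ hw4 hw₁in (ha'.trans_lt hζr)
  have hP₂ := abs_incr_sub_mul_le (u := Complex.I) hq₁ hw₁in hw₂in (hb'.trans_lt hζr)
  -- continuity bounds at the intermediate points
  have hg₀w : |g₀ w₁ - g₀ w| ≤ c / 8 := hζ₀ w₁ (by rw [hdw₁]; exact ha')
  have hg₁w : |g₁ w₁ - g₁ w| ≤ c / 8 := hζ₁ w₁ (by rw [hdw₁]; exact ha')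
  have hg₁w₂ : |g₁ (w₁ + b * Complex.I) - g₁ w| ≤ c / 8 := hζ₁ _ (by rw [hdw₂])
  have hg₁w₁ : |g₁ (w₁ + b * Complex.I) - g₁ w₁| ≤ c / 4 := by
    calc |g₁ (w₁ + b * Complex.I) - g₁ w₁| ≤ |g₁ (w₁ + b * Complex.I) - g₁ w| + |g₁ w - g₁ w₁| :=
          abs_sub_le _ _ _
      _ ≤ c / 8 + c / 8 := add_le_add hg₁w₂ (by rw [abs_sub_comm]; exact hg₁w)
      _ = c / 4 := by ring
  -- assemble
  have hE : v (w + ζ) - v w - (g₀ w • Complex.reCLM + g₁ w • Complex.imCLM) ζ =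
      (v w₁ - v w - a * g₀ w) + (v (w₁ + b * Complex.I) - v w₁ - b * g₁ w₁) + b * (g₁ w₁ - g₁ w) := by
    rw [hζeq]
    simp only [add_apply, smul_apply, Complex.reCLM_apply, Complex.imCLM_apply, smul_eq_mul, ← ha,
      ← hb]
    ring
  rw [hE, Real.norm_eq_abs]
  have hL₂ζ : 2 * L₂ * ‖ζ‖ ≤ c / 2 := by
    have : L₂ * ‖ζ‖ ≤ (L₂ + 1) * (c / (4 * (L₂ + 1))) :=
      mul_le_mul (by linarith) hζc.le (norm_nonneg _) (by linarith)
    rw [show (L₂ + 1) * (c / (4 * (L₂ + 1))) = c / 4 by field_simp] at this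
    linarith
  calc |(v w₁ - v w - a * g₀ w) + (v (w₁ + b * Complex.I) - v w₁ - b * g₁ w₁) + b * (g₁ w₁ - g₁ w)|
      ≤ |v w₁ - v w - a * g₀ w| + |v (w₁ + b * Complex.I) - v w₁ - b * g₁ w₁| + |b * (g₁ w₁ - g₁ w)| :=
        abs_add_three _ _ _
    _ ≤ |a| * (L₂ * |a| + |g₀ w₁ - g₀ w|) + |b| * (L₂ * |b| + |g₁ (w₁ + b * Complex.I) - g₁ w₁|) +
          |b| * |g₁ w₁ - g₁ w| := by
        rw [abs_mul]
        exact add_le_add (add_le_add (by simpa [hw₁] using hP₁) hP₂) le_rfl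
    _ ≤ ‖ζ‖ * (L₂ * ‖ζ‖ + c / 8) + ‖ζ‖ * (L₂ * ‖ζ‖ + c / 4) + ‖ζ‖ * (c / 8) := by
        gcongr
    _ = (2 * L₂ * ‖ζ‖ + c / 2) * ‖ζ‖ := by ring
    _ ≤ (c / 2 + c / 2) * ‖ζ‖ := by gcongr
    _ = c * ‖ζ‖ := by ring

end DerivativeLimit

/-! ### §9. Lower semicontinuity of the energy: `∫∫_Ω ‖∇v‖² ≤ lim 𝓔(h_n)` ([GP19], §4.5) -/

section Fatou

open _root_.MeasureTheory

variable {Ω : Set ℂ} {δ : ℝ}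

/-- The half-open lattice cell `[δa, δ(a+1)) × [δb, δ(b+1))` has area `δ²`. [folklore] -/
theorem volume_cell (hδ : 0 ≤ δ) (a b : ℤ) :
    volume (Ico (δ * a) (δ * (a + 1)) ×ℂ Ico (δ * b) (δ * (b + 1))) = ENNReal.ofReal (δ ^ 2) := by
  rw [Literature.Analysis.Complex.ExtremalLength.volume_reProdIm, Real.volume_Ico, Real.volume_Ico,
    ← ENNReal.ofReal_mul (by nlinarith)]
  congr 1; ring

/-- Every point of the half-open square `[δA₀, δ(A₀+P)) × [δA₁, δ(A₁+P))` lies in the half-open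
cell of a lattice point of the `P × P` grid. [folklore] -/
theorem exists_mem_cell {A : Site 2} {P : ℕ} (hδ : 0 < δ) {w : ℂ}
    (hw : w ∈ Ico (δ * A 0) (δ * (A 0 + P)) ×ℂ Ico (δ * A 1) (δ * (A 1 + P))) :
    ∃ p : ℤ × ℤ, p ∈ Finset.Ico (A 0) (A 0 + P) ×ˢ Finset.Ico (A 1) (A 1 + P) ∧
      w ∈ Ico (δ * p.1) (δ * (p.1 + 1)) ×ℂ Ico (δ * p.2) (δ * (p.2 + 1)) := by
  obtain ⟨⟨h0, h0'⟩, ⟨h1, h1'⟩⟩ := hw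
  have k0 := Int.floor_le (w.re / δ)
  have k0' := Int.lt_floor_add_one (w.re / δ)
  have k1 := Int.floor_le (w.im / δ)
  have k1' := Int.lt_floor_add_one (w.im / δ)
  rw [le_div_iff₀ hδ] at k0 k1
  rw [div_lt_iff₀ hδ] at k0' k1'
  refine ⟨(⌊w.re / δ⌋, ⌊w.im / δ⌋), Finset.mem_product.2 ⟨?_, ?_⟩, ⟨?_, ?_⟩, ⟨?_, ?_⟩⟩
  · rw [Finset.mem_Ico]
    constructor
    · rw [Int.le_floor, le_div_iff₀ hδ]; linarith
    · rw [Int.floor_lt, div_lt_iff₀ hδ]; push_cast; linarith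
  · rw [Finset.mem_Ico]
    constructor
    · rw [Int.le_floor, le_div_iff₀ hδ]; linarith
    · rw [Int.floor_lt, div_lt_iff₀ hδ]; push_cast; linarith
  · show δ * _ ≤ w.re
    linarith
  · show w.re < δ * _
    linarith
  · show δ * _ ≤ w.im
    linarith
  · show w.im < δ * _
    linarith

/-- **Integral over a half-open square versus its cells.** If `F ≤ c p` on the cell of every grid
point `p`, then `∫⁻` of `F` over the half-open square is at most `Σ_p c p · δ²`. [folklore] -/
theorem lintegral_square_le_sum (hδ : 0 < δ) (A : Site 2) (P : ℕ) {F : ℂ → ℝ≥0∞} {c : ℤ × ℤ → ℝ≥0∞}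
    (hF : ∀ p ∈ Finset.Ico (A 0) (A 0 + P) ×ˢ Finset.Ico (A 1) (A 1 + P),
      ∀ w ∈ Ico (δ * p.1) (δ * (p.1 + 1)) ×ℂ Ico (δ * p.2) (δ * (p.2 + 1)), F w ≤ c p) :
    ∫⁻ w in Ico (δ * A 0) (δ * (A 0 + P)) ×ℂ Ico (δ * A 1) (δ * (A 1 + P)), F w ≤
      ∑ p ∈ Finset.Ico (A 0) (A 0 + P) ×ˢ Finset.Ico (A 1) (A 1 + P), c p * ENNReal.ofReal (δ ^ 2) := by
  classical
  set G := Finset.Ico (A 0) (A 0 + P) ×ˢ Finset.Ico (A 1) (A 1 + P) with hG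
  set cell : ℤ × ℤ → Set ℂ := fun p => Ico (δ * p.1) (δ * (p.1 + 1)) ×ℂ Ico (δ * p.2) (δ * (p.2 + 1))
    with hcell
  have hcover : Ico (δ * A 0) (δ * (A 0 + P)) ×ℂ Ico (δ * A 1) (δ * (A 1 + P)) ⊆ ⋃ p ∈ G, cell p := by
    intro w hw
    obtain ⟨p, hp, hpw⟩ := exists_mem_cell hδ hw
    exact mem_iUnion₂.2 ⟨p, hp, hpw⟩
  have hunion : (⋃ p ∈ G, cell p) = ⋃ p : G, cell p := by
    ext w; simp only [mem_iUnion]; constructor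
    · rintro ⟨p, hp, hw⟩; exact ⟨⟨p, hp⟩, hw⟩
    · rintro ⟨⟨p, hp⟩, hw⟩; exact ⟨p, hp, hw⟩
  calc ∫⁻ w in Ico (δ * A 0) (δ * (A 0 + P)) ×ℂ Ico (δ * A 1) (δ * (A 1 + P)), F w
      ≤ ∫⁻ w in ⋃ p ∈ G, cell p, F w := lintegral_mono_set hcover
    _ ≤ ∑' p : G, ∫⁻ w in cell p, F w := by rw [hunion]; exact lintegral_iUnion_le _ _
    _ = ∑ p ∈ G, ∫⁻ w in cell p, F w := (Finset.tsum_subtype G fun p => ∫⁻ w in cell p, F w)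
    _ ≤ ∑ p ∈ G, c p * ENNReal.ofReal (δ ^ 2) := Finset.sum_le_sum fun p hp => by
        have hle : ∀ w ∈ cell p, F w ≤ c p := fun w hw => hF p hp w hw
        calc ∫⁻ w in cell p, F w ≤ ∫⁻ w in cell p, c p := setLIntegral_mono measurable_const hle
          _ = c p * volume (cell p) := setLIntegral_const _ _
          _ = c p * ENNReal.ofReal (δ ^ 2) := by rw [hcell]; simp only; rw [volume_cell hδ.le]

/-- The axis edges `{x, x + eᵢ}` (`i = 0, 1`) at distinct base points or directions are distinct.
[folklore] -/
theorem axisEdge_injective :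
    Function.Injective fun q : Site 2 × Fin 2 => s(q.1, q.1 + (Pi.single q.2 1 : Site 2)) := by
  rintro ⟨x, i⟩ ⟨y, j⟩ h
  simp only at h
  rcases Sym2.eq_iff.1 h with ⟨h1, h2⟩ | ⟨h1, h2⟩
  · subst h1
    have hij : (Pi.single i (1 : ℤ) : Site 2) = Pi.single j 1 := add_left_cancel h2
    have := congrFun hij i
    simp only [Pi.single_eq_same] at this
    by_cases hc : i = j
    · subst hc; rfl
    · rw [Pi.single_eq_of_ne hc] at this; exact absurd this one_ne_zero
  · exfalso
    rw [h1, add_assoc] at h2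
    have h3 : (Pi.single j (1 : ℤ) : Site 2) + Pi.single i 1 = 0 := by
      have := h2; nth_rw 2 [← add_zero y] at this; exact add_left_cancel this
    have := congrFun h3 i
    simp only [Pi.add_apply, Pi.single_eq_same, Pi.zero_apply] at this
    by_cases hc : i = j
    · subst hc; simp at this
    · rw [Pi.single_eq_of_ne hc] at this; omega

/-- **Energy accounting.** The squared increments of `h` across the horizontal and vertical edges
based at the points of a finset `X`, all edges of the network `G` (unit conductances), add up to
at most the energy of `h`. [cite: LyonsPeres2016, §2.4] -/
theorem ofReal_sum_sq_le_networkEnergy (G : SimpleGraph (Site 2)) (h : Site 2 → ℝ)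
    (X : Finset (Site 2)) (hX : ∀ x ∈ X, ∀ i : Fin 2, s(x, x + (Pi.single i 1 : Site 2)) ∈ G.edgeSet) :
    ENNReal.ofReal (∑ x ∈ X, ∑ i : Fin 2, (h (x + Pi.single i 1) - h x) ^ 2) ≤ networkEnergy G 1 h := by
  classical
  set f : Site 2 × Fin 2 → Sym2 (Site 2) := fun q => s(q.1, q.1 + (Pi.single q.2 1 : Site 2)) with hf
  set S : Finset (Sym2 (Site 2)) := (X ×ˢ (Finset.univ : Finset (Fin 2))).image f with hS
  have hSE : ∀ e ∈ S, e ∈ G.edgeSet := by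
    intro e he
    obtain ⟨⟨x, i⟩, hq, rfl⟩ := Finset.mem_image.1 he
    exact hX x (Finset.mem_product.1 hq).1 i
  have hsum : ∑ x ∈ X, ∑ i : Fin 2, (h (x + Pi.single i 1) - h x) ^ 2 =
      ∑ e ∈ S, ((1 : Sym2 (Site 2) → ℝ≥0) e : ℝ) * sqIncr h e := by
    rw [hS, Finset.sum_image fun q _ q' _ hq => axisEdge_injective hq, Finset.sum_product]
    refine Finset.sum_congr rfl fun x _ => Finset.sum_congr rfl fun i _ => ?_
    simp only [sqIncr_mk, Pi.one_apply, NNReal.coe_one, one_mul]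
    ring
  rw [hsum]
  exact ofReal_sum_le_networkEnergy h hSE

/-- The operator norm of a real-linear functional on `ℂ` is the euclidean norm of its values on
`1` and `i`: `‖L‖² = L(1)² + L(i)²`. [folklore] -/
theorem norm_sq_eq_of_functional (L : ℂ →L[ℝ] ℝ) : ‖L‖ ^ 2 = (L 1) ^ 2 + (L Complex.I) ^ 2 := by
  have hrepr : ∀ z : ℂ, L z = z.re * L 1 + z.im * L Complex.I := by
    intro z
    conv_lhs => rw [← Complex.re_add_im z]
    rw [map_add, show (z.re : ℂ) = z.re • (1 : ℂ) by simp, show (z.im : ℂ) * Complex.I = z.im • Complex.I by simp,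
      L.map_smul, L.map_smul, smul_eq_mul, smul_eq_mul]
  set N : ℝ := Real.sqrt ((L 1) ^ 2 + (L Complex.I) ^ 2) with hN
  have hN0 : 0 ≤ N := Real.sqrt_nonneg _
  have hNsq : N ^ 2 = (L 1) ^ 2 + (L Complex.I) ^ 2 := Real.sq_sqrt (by positivity)
  -- upper bound by Cauchy–Schwarz
  have hle : ‖L‖ ≤ N := by
    refine ContinuousLinearMap.opNorm_le_bound _ hN0 fun z => ?_
    rw [hrepr, Real.norm_eq_abs]
    have hz : ‖z‖ ^ 2 = z.re ^ 2 + z.im ^ 2 := by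
      rw [Complex.sq_norm, Complex.normSq_apply]; ring
    have hcs : (z.re * L 1 + z.im * L Complex.I) ^ 2 ≤ N ^ 2 * ‖z‖ ^ 2 := by
      rw [hNsq, hz]
      nlinarith [sq_nonneg (z.re * L Complex.I - z.im * L 1)]
    have := Real.sqrt_le_sqrt hcs
    rwa [Real.sqrt_sq_eq_abs, Real.sqrt_mul (sq_nonneg _), Real.sqrt_sq hN0, Real.sqrt_sq (norm_nonneg _)] at this
  -- lower bound by testing on `z = L 1 + (L i) i`
  have hge : N ≤ ‖L‖ := by
    by_cases hN1 : N = 0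
    · rw [hN1]; exact norm_nonneg _
    have hNpos : 0 < N := lt_of_le_of_ne hN0 (Ne.symm hN1)
    set z : ℂ := (L 1 : ℂ) + (L Complex.I : ℂ) * Complex.I with hz
    have hzre : z.re = L 1 := by simp [hz]
    have hzim : z.im = L Complex.I := by simp [hz]
    have hLz : L z = N ^ 2 := by rw [hrepr, hzre, hzim, hNsq]; ring
    have hznorm : ‖z‖ = N := by
      rw [hN, Complex.norm_eq_sqrt_sq_add_sq, hzre, hzim]
    have := L.le_opNorm z
    rw [hLz, hznorm, Real.norm_eq_abs, abs_of_nonneg (by positivity), sq] at this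
    exact le_of_mul_le_mul_right this hNpos
  rw [le_antisymm hle hge, hNsq]

/-- **Pointwise bound for the cellwise estimate.** If the two discrete partial derivatives
`aᵢ / δ` are within `η` of `g₀(1)`, `g₀(i)` for a functional `g₀`, and `‖g - g₀‖ ≤ η`, then for
`0 < θ ≤ 1`: `‖g‖² ≤ (1 + θ)(a₀² + a₁²)/δ² + 8 (1 + θ⁻¹) η²`. [folklore] -/
theorem norm_sq_le_of_close (g g₀ : ℂ →L[ℝ] ℝ) {δ η θ a₀ a₁ : ℝ} (hθ : 0 < θ)
    (h0 : |a₀ / δ - g₀ 1| ≤ η) (h1 : |a₁ / δ - g₀ Complex.I| ≤ η) (hg : ‖g - g₀‖ ≤ η) :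
    ‖g‖ ^ 2 ≤ (1 + θ) * ((a₀ ^ 2 + a₁ ^ 2) / δ ^ 2) + 8 * (1 + θ⁻¹) * η ^ 2 := by
  have e0 : |g 1 - g₀ 1| ≤ η := by
    have := (g - g₀).le_opNorm 1
    rw [sub_apply, Real.norm_eq_abs, norm_one, mul_one] at this
    exact this.trans hg
  have e1 : |g Complex.I - g₀ Complex.I| ≤ η := by
    have := (g - g₀).le_opNorm Complex.I
    rw [sub_apply, Real.norm_eq_abs, Complex.norm_I, mul_one] at this
    exact this.trans hg
  have b0 : |g 1| ≤ |a₀ / δ| + 2 * η := by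
    calc |g 1| = |(g 1 - g₀ 1) + (g₀ 1 - a₀ / δ) + a₀ / δ| := by ring_nf
      _ ≤ |g 1 - g₀ 1| + |g₀ 1 - a₀ / δ| + |a₀ / δ| := abs_add_three _ _ _
      _ ≤ η + η + |a₀ / δ| := by gcongr; rwa [abs_sub_comm]
      _ = |a₀ / δ| + 2 * η := by ring
  have b1 : |g Complex.I| ≤ |a₁ / δ| + 2 * η := by
    calc |g Complex.I| = |(g Complex.I - g₀ Complex.I) + (g₀ Complex.I - a₁ / δ) + a₁ / δ| := by ring_nf
      _ ≤ |g Complex.I - g₀ Complex.I| + |g₀ Complex.I - a₁ / δ| + |a₁ / δ| := abs_add_three _ _ _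
      _ ≤ η + η + |a₁ / δ| := by gcongr; rwa [abs_sub_comm]
      _ = |a₁ / δ| + 2 * η := by ring
  -- `(p + 2η)² ≤ (1+θ) p² + (1+θ⁻¹)(2η)²`
  have young : ∀ p : ℝ, 0 ≤ p → (p + 2 * η) ^ 2 ≤ (1 + θ) * p ^ 2 + (1 + θ⁻¹) * (2 * η) ^ 2 := by
    intro p hp
    have key : 2 * p * (2 * η) ≤ θ * p ^ 2 + θ⁻¹ * (2 * η) ^ 2 := by
      have := sq_nonneg (Real.sqrt θ * p - (Real.sqrt θ)⁻¹ * (2 * η))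
      have hsq : Real.sqrt θ ^ 2 = θ := Real.sq_sqrt hθ.le
      have hsq' : (Real.sqrt θ)⁻¹ ^ 2 = θ⁻¹ := by rw [inv_pow, hsq]
      have hss : Real.sqrt θ * (Real.sqrt θ)⁻¹ = 1 := mul_inv_cancel₀ (Real.sqrt_ne_zero'.2 hθ)
      have hexp : (Real.sqrt θ * p - (Real.sqrt θ)⁻¹ * (2 * η)) ^ 2 =
          Real.sqrt θ ^ 2 * p ^ 2 - 2 * p * (2 * η) * (Real.sqrt θ * (Real.sqrt θ)⁻¹) +
            (Real.sqrt θ)⁻¹ ^ 2 * (2 * η) ^ 2 := by ring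
      rw [hexp, hsq, hsq', hss, mul_one] at this
      linarith
    nlinarith
  have hsq0 : (g 1) ^ 2 ≤ (|a₀ / δ| + 2 * η) ^ 2 := by
    rw [← sq_abs (g 1)]; exact pow_le_pow_left₀ (abs_nonneg _) b0 2
  have hsq1 : (g Complex.I) ^ 2 ≤ (|a₁ / δ| + 2 * η) ^ 2 := by
    rw [← sq_abs (g Complex.I)]; exact pow_le_pow_left₀ (abs_nonneg _) b1 2
  have ha0 : |a₀ / δ| ^ 2 = a₀ ^ 2 / δ ^ 2 := by rw [sq_abs, div_pow]
  have ha1 : |a₁ / δ| ^ 2 = a₁ ^ 2 / δ ^ 2 := by rw [sq_abs, div_pow]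
  rw [norm_sq_eq_of_functional]
  calc (g 1) ^ 2 + (g Complex.I) ^ 2 ≤ (|a₀ / δ| + 2 * η) ^ 2 + (|a₁ / δ| + 2 * η) ^ 2 := add_le_add hsq0 hsq1
    _ ≤ ((1 + θ) * |a₀ / δ| ^ 2 + (1 + θ⁻¹) * (2 * η) ^ 2) + ((1 + θ) * |a₁ / δ| ^ 2 + (1 + θ⁻¹) * (2 * η) ^ 2) :=
        add_le_add (young _ (abs_nonneg _)) (young _ (abs_nonneg _))
    _ = (1 + θ) * ((a₀ ^ 2 + a₁ ^ 2) / δ ^ 2) + 8 * (1 + θ⁻¹) * η ^ 2 := by rw [ha0, ha1]; ring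

/-- Dyadic meshes: `2^{-b} = 2^{-a} · 2^{a-b}` for `b ≤ a`. [folklore] -/
theorem half_pow_eq {a b : ℕ} (h : b ≤ a) : (2 : ℝ)⁻¹ ^ b = (2 : ℝ)⁻¹ ^ a * 2 ^ (a - b) := by
  obtain ⟨c, rfl⟩ := Nat.exists_eq_add_of_le h
  rw [Nat.add_sub_cancel_left, pow_add, mul_assoc, ← mul_pow]
  norm_num

/-- The map `p ↦ ![p.1, p.2]` from `ℤ × ℤ` to `ℤ²` is injective. [folklore] -/
theorem vec2_injective : Function.Injective fun p : ℤ × ℤ => (![p.1, p.2] : Site 2) := by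
  rintro ⟨a, b⟩ ⟨c, d⟩ h
  have h0 := congrFun h 0
  have h1 := congrFun h 1
  simp only [Matrix.cons_val_zero, Matrix.cons_val_one] at h0 h1
  rw [h0, h1]

/-- The `P × P` grid has `P²` points. [folklore] -/
theorem card_grid (a : Site 2) (P : ℕ) :
    (Finset.Ico (a 0 * P) (a 0 * P + P) ×ˢ Finset.Ico (a 1 * P) (a 1 * P + P)).card = P * P := by
  rw [Finset.card_product, Int.card_Ico, Int.card_Ico]
  have h0 : (a 0 * P + P - a 0 * P : ℤ) = P := by ring
  have h1 : (a 1 * P + P - a 1 * P : ℤ) = P := by ring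
  rw [h0, h1, Int.toNat_natCast]

/-- The grids of distinct level squares are disjoint: a lattice point of the `P × P` grid with
corner `a P` determines `a`. [folklore] -/
theorem eq_of_mem_grid {P : ℕ} (hP : 0 < P) {a a' : Site 2} {p : ℤ × ℤ}
    (hp : p ∈ Finset.Ico (a 0 * P) (a 0 * P + P) ×ˢ Finset.Ico (a 1 * P) (a 1 * P + P))
    (hp' : p ∈ Finset.Ico (a' 0 * P) (a' 0 * P + P) ×ˢ Finset.Ico (a' 1 * P) (a' 1 * P + P)) : a = a' := by
  obtain ⟨h0, h1⟩ := Finset.mem_product.1 hp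
  obtain ⟨h0', h1'⟩ := Finset.mem_product.1 hp'
  rw [Finset.mem_Ico] at h0 h1 h0' h1'
  have hPz : (0 : ℤ) < P := by exact_mod_cast hP
  have key : ∀ b b' q : ℤ, b * P ≤ q → q < b * P + P → b' * P ≤ q → q < b' * P + P → b = b' := by
    intro b b' q hb hb2 hb' hb2'
    have e1 : b * P < (b' + 1) * P := by linarith
    have e2 : b' * P < (b + 1) * P := by linarith
    have := lt_of_mul_lt_mul_right e1 hPz.le
    have := lt_of_mul_lt_mul_right e2 hPz.le
    omega
  ext i; fin_cases i
  · exact key _ _ _ h0.1 h0.2 h0'.1 h0'.2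
  · exact key _ _ _ h1.1 h1.2 h1'.1 h1'.2

open Classical in
/-- **Cellwise bookkeeping for a finite family of grid squares, one mesh.** Let `δ > 0`, `P ≥ 1`,
and for each corner `a ∈ 𝒬` consider the half-open square of side `δ P` at `δ P a`, tiled by the
`P × P` grid of `δ`-cells. If on each cell the integrand is at most
`(1+θ)(a₀² + a₁²)/δ² + 8(1+θ⁻¹)η²` (`aᵢ` the increments of `h` across the two axis edges at the
cell's corner) and these axis edges are edges of the network `G`, then the integral over the union
of the squares is at most `(1+θ) 𝓔(h) + 8(1+θ⁻¹) η² (δP)² |𝒬|`. [folklore] -/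
theorem lintegral_squares_le_energy (hδ : 0 < δ) {P : ℕ} (hP : 0 < P) (𝒬 : Finset (Site 2))
    (G : SimpleGraph (Site 2)) (h : Site 2 → ℝ) {F : ℂ → ℝ≥0∞} {θ η : ℝ} (hθ : 0 < θ)
    (hcellb : ∀ a ∈ 𝒬, ∀ p ∈ Finset.Ico (a 0 * P) (a 0 * P + P) ×ˢ Finset.Ico (a 1 * P) (a 1 * P + P),
      ∀ w ∈ Ico (δ * p.1) (δ * (p.1 + 1)) ×ℂ Ico (δ * p.2) (δ * (p.2 + 1)),
        F w ≤ ENNReal.ofReal ((1 + θ) * (((h (![p.1, p.2] + Pi.single 0 1) - h ![p.1, p.2]) ^ 2 +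
          (h (![p.1, p.2] + Pi.single 1 1) - h ![p.1, p.2]) ^ 2) / δ ^ 2) + 8 * (1 + θ⁻¹) * η ^ 2))
    (hedges : ∀ a ∈ 𝒬, ∀ p ∈ Finset.Ico (a 0 * P) (a 0 * P + P) ×ˢ Finset.Ico (a 1 * P) (a 1 * P + P),
      ∀ i : Fin 2, s((![p.1, p.2] : Site 2), ![p.1, p.2] + Pi.single i 1) ∈ G.edgeSet) :
    ∫⁻ w in ⋃ a ∈ 𝒬, (Ico (δ * P * a 0) (δ * P * (a 0 + 1)) ×ℂ Ico (δ * P * a 1) (δ * P * (a 1 + 1))), F w ≤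
      ENNReal.ofReal (1 + θ) * networkEnergy G 1 h +
        ENNReal.ofReal (8 * (1 + θ⁻¹) * η ^ 2 * ((δ * P) ^ 2 * 𝒬.card)) := by
  set grid : Site 2 → Finset (ℤ × ℤ) := fun a =>
    Finset.Ico (a 0 * P) (a 0 * P + P) ×ˢ Finset.Ico (a 1 * P) (a 1 * P + P) with hgrid
  set Sq : Site 2 → Set ℂ := fun a =>
    Ico (δ * P * a 0) (δ * P * (a 0 + 1)) ×ℂ Ico (δ * P * a 1) (δ * P * (a 1 + 1)) with hSq
  set cst : ℤ × ℤ → ℝ := fun p =>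
    (1 + θ) * (((h (![p.1, p.2] + Pi.single 0 1) - h ![p.1, p.2]) ^ 2 +
      (h (![p.1, p.2] + Pi.single 1 1) - h ![p.1, p.2]) ^ 2) / δ ^ 2) + 8 * (1 + θ⁻¹) * η ^ 2 with hcst
  have hcst0 : ∀ p, 0 ≤ cst p := fun p => by simp only [hcst]; positivity
  -- integral over each square
  have hSqeq : ∀ a : Site 2, Sq a = Ico (δ * ((![a 0 * P, a 1 * P] : Site 2) 0))
      (δ * ((![a 0 * P, a 1 * P] : Site 2) 0 + P)) ×ℂ
      Ico (δ * ((![a 0 * P, a 1 * P] : Site 2) 1)) (δ * ((![a 0 * P, a 1 * P] : Site 2) 1 + P)) := by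
    intro a
    simp only [hSq, Matrix.cons_val_zero, Matrix.cons_val_one]
    push_cast
    congr 2 <;> ring
  have hSqle : ∀ a ∈ 𝒬, ∫⁻ w in Sq a, F w ≤ ∑ p ∈ grid a, ENNReal.ofReal (cst p) * ENNReal.ofReal (δ ^ 2) := by
    intro a ha
    rw [hSqeq a]
    exact lintegral_square_le_sum hδ (![a 0 * P, a 1 * P] : Site 2) P (F := F)
      (c := fun p => ENNReal.ofReal (cst p)) (fun p hp w hw => hcellb a ha p hp w hw)
  -- sum over the squares
  have hunion : (⋃ a ∈ 𝒬, Sq a) = ⋃ a : (𝒬 : Set (Site 2)), Sq a := by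
    ext w; simp only [mem_iUnion]; constructor
    · rintro ⟨a, ha, hw⟩; exact ⟨⟨a, ha⟩, hw⟩
    · rintro ⟨⟨a, ha⟩, hw⟩; exact ⟨a, ha, hw⟩
  have hK_le : ∫⁻ w in ⋃ a ∈ 𝒬, Sq a, F w ≤ ∑ a ∈ 𝒬, ∫⁻ w in Sq a, F w := by
    rw [hunion]
    refine (lintegral_iUnion_le _ _).trans (le_of_eq ?_)
    exact Finset.tsum_subtype 𝒬 fun a => ∫⁻ w in Sq a, F w
  -- the lattice points of all grids, and the energy
  set X : Finset (Site 2) := 𝒬.biUnion fun a => (grid a).image fun p => (![p.1, p.2] : Site 2) with hX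
  have hdisj : (𝒬 : Set (Site 2)).PairwiseDisjoint fun a => (grid a).image fun p => (![p.1, p.2] : Site 2) := by
    intro a _ a' _ hne
    rw [Function.onFun, Finset.disjoint_left]
    intro x hx hx'
    obtain ⟨p, hp, rfl⟩ := Finset.mem_image.1 hx
    obtain ⟨p', hp', hpp⟩ := Finset.mem_image.1 hx'
    have : p' = p := vec2_injective hpp
    subst this
    exact hne (eq_of_mem_grid hP hp hp')
  have hXsum : ∑ a ∈ 𝒬, ∑ p ∈ grid a,
      ((h (![p.1, p.2] + Pi.single 0 1) - h ![p.1, p.2]) ^ 2 +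
        (h (![p.1, p.2] + Pi.single 1 1) - h ![p.1, p.2]) ^ 2) =
      ∑ x ∈ X, ∑ i : Fin 2, (h (x + Pi.single i 1) - h x) ^ 2 := by
    rw [hX, Finset.sum_biUnion hdisj]
    refine Finset.sum_congr rfl fun a _ => ?_
    rw [Finset.sum_image fun p _ p' _ hpp => vec2_injective hpp]
    refine Finset.sum_congr rfl fun p _ => ?_
    rw [Fin.sum_univ_two]
  have hXedges : ∀ x ∈ X, ∀ i : Fin 2, s(x, x + (Pi.single i 1 : Site 2)) ∈ G.edgeSet := by
    intro x hx i
    obtain ⟨a, ha, hx⟩ := Finset.mem_biUnion.1 hx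
    obtain ⟨p, hp, rfl⟩ := Finset.mem_image.1 hx
    exact hedges a ha p hp i
  have henergy := ofReal_sum_sq_le_networkEnergy G h X hXedges
  have hterm : ∀ p : ℤ × ℤ, cst p * δ ^ 2 =
      (1 + θ) * ((h (![p.1, p.2] + Pi.single 0 1) - h ![p.1, p.2]) ^ 2 +
        (h (![p.1, p.2] + Pi.single 1 1) - h ![p.1, p.2]) ^ 2) + 8 * (1 + θ⁻¹) * η ^ 2 * δ ^ 2 := by
    intro p; simp only [hcst]; field_simp
  have hper : ∀ a : Site 2, ∑ p ∈ grid a, cst p * δ ^ 2 =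
      (1 + θ) * ∑ p ∈ grid a, ((h (![p.1, p.2] + Pi.single 0 1) - h ![p.1, p.2]) ^ 2 +
        (h (![p.1, p.2] + Pi.single 1 1) - h ![p.1, p.2]) ^ 2) +
        8 * (1 + θ⁻¹) * η ^ 2 * δ ^ 2 * ((P * P : ℕ) : ℝ) := by
    intro a
    rw [Finset.sum_congr rfl fun p _ => hterm p, Finset.sum_add_distrib, Finset.sum_const,
      ← Finset.mul_sum, show (grid a).card = P * P from card_grid a P, nsmul_eq_mul]
    ring
  have hreal : ∑ a ∈ 𝒬, ∑ p ∈ grid a, cst p * δ ^ 2 =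
      (1 + θ) * ∑ x ∈ X, ∑ i : Fin 2, (h (x + Pi.single i 1) - h x) ^ 2 +
        8 * (1 + θ⁻¹) * η ^ 2 * ((δ * P) ^ 2 * 𝒬.card) := by
    rw [← hXsum, Finset.mul_sum, Finset.sum_congr rfl fun a _ => hper a, Finset.sum_add_distrib,
      Finset.sum_const, nsmul_eq_mul]
    push_cast
    ring
  calc ∫⁻ w in ⋃ a ∈ 𝒬, Sq a, F w ≤ ∑ a ∈ 𝒬, ∫⁻ w in Sq a, F w := hK_le
    _ ≤ ∑ a ∈ 𝒬, ∑ p ∈ grid a, ENNReal.ofReal (cst p) * ENNReal.ofReal (δ ^ 2) :=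
        Finset.sum_le_sum fun a ha => hSqle a ha
    _ = ENNReal.ofReal (∑ a ∈ 𝒬, ∑ p ∈ grid a, cst p * δ ^ 2) := by
        rw [ENNReal.ofReal_sum_of_nonneg fun a _ => Finset.sum_nonneg fun p _ => by positivity]
        refine Finset.sum_congr rfl fun a _ => ?_
        rw [ENNReal.ofReal_sum_of_nonneg fun p _ => by positivity]
        refine Finset.sum_congr rfl fun p _ => ?_
        rw [ENNReal.ofReal_mul (hcst0 p)]
    _ = ENNReal.ofReal ((1 + θ) * ∑ x ∈ X, ∑ i : Fin 2, (h (x + Pi.single i 1) - h x) ^ 2 +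
          8 * (1 + θ⁻¹) * η ^ 2 * ((δ * P) ^ 2 * 𝒬.card)) := by rw [hreal]
    _ ≤ ENNReal.ofReal (1 + θ) * networkEnergy G 1 h +
          ENNReal.ofReal (8 * (1 + θ⁻¹) * η ^ 2 * ((δ * P) ^ 2 * 𝒬.card)) := by
        rw [ENNReal.ofReal_add (by positivity) (by positivity), ENNReal.ofReal_mul (by positivity)]
        gcongr

open Classical in
/-- **Lower semicontinuity of the Dirichlet energy along the discrete potentials, one level**
([GP19], §4.5 uses the identity of `Σ w_n(e)²` with areas of squares of the tiling; here the
interior statement: on a finite union of level-`m` dyadic squares deep inside `Ω`,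
`∫∫ ‖∇v‖² ≤ lim 𝓔(h_n)`). Meshes `δ_n = 2^{-k n}` with `k n → ∞`; every lattice point of each
compact `K' ⊆ Ω` eventually carries its two axis edges in `Ω_n`; the energies of `h n` are at
most `C n → I`; the discrete partial derivatives of `h n` converge locally uniformly on `Ω` to the
partial derivatives of `v`, whose derivative is continuous on `Ω`. Then for every finite set `𝒬`
of level-`m` corners `a` with `B̄(2^{-m} a, 10 · 2^{-m}) ⊆ Ω`, the integral of `‖fderiv ℝ v‖²`
over the union of the half-open squares `2^{-m}(a + [0,1)²)` is at most `I`.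
[cite: GeorgakopoulosPanagiotis2019, §4.5] -/
theorem lintegral_level_le (hΩo : IsOpen Ω) {k : ℕ → ℕ} (hk : Tendsto k atTop atTop)
    {h : ℕ → Site 2 → ℝ}
    (hedges : ∀ K' ⊆ Ω, IsCompact K' → ∀ᶠ n in atTop, ∀ x : Site 2, meshPoint ((2 : ℝ)⁻¹ ^ k n) x ∈ K' →
      ∀ i : Fin 2, s(x, x + (Pi.single i 1 : Site 2)) ∈ (domainGraph Ω ((2 : ℝ)⁻¹ ^ k n)).edgeSet)
    {C : ℕ → ℝ≥0∞} (hC : ∀ n, networkEnergy (domainGraph Ω ((2 : ℝ)⁻¹ ^ k n)) 1 (h n) ≤ C n)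
    {I : ℝ≥0∞} (hI : Tendsto C atTop (𝓝 I)) {v : ℂ → ℝ} (hvc : ContinuousOn (fderiv ℝ v) Ω)
    (hD : ∀ i : Fin 2, TendstoLocallyUniformlyOn
      (fun n w => (h n (nearestSite ((2 : ℝ)⁻¹ ^ k n) w + Pi.single i 1) -
        h n (nearestSite ((2 : ℝ)⁻¹ ^ k n) w)) / (2 : ℝ)⁻¹ ^ k n)
      (fun w => fderiv ℝ v w (if i = 0 then (1 : ℂ) else Complex.I)) atTop Ω)
    (m : ℕ) (𝒬 : Finset (Site 2))
    (h𝒬 : ∀ a ∈ 𝒬, closedBall (meshPoint ((2 : ℝ)⁻¹ ^ m) a) (10 * (2 : ℝ)⁻¹ ^ m) ⊆ Ω) :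
    ∫⁻ w in ⋃ a ∈ 𝒬, (Ico ((2 : ℝ)⁻¹ ^ m * a 0) ((2 : ℝ)⁻¹ ^ m * (a 0 + 1)) ×ℂ
        Ico ((2 : ℝ)⁻¹ ^ m * a 1) ((2 : ℝ)⁻¹ ^ m * (a 1 + 1))), ‖fderiv ℝ v w‖ₑ ^ 2 ≤ I := by
  set ℓ : ℝ := (2 : ℝ)⁻¹ ^ m with hℓ
  have hℓ0 : 0 < ℓ := by positivity
  set K : Set ℂ := ⋃ a ∈ 𝒬, (Ico (ℓ * a 0) (ℓ * (a 0 + 1)) ×ℂ Ico (ℓ * a 1) (ℓ * (a 1 + 1))) with hK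
  -- the compact neighbourhood `K'`
  set K' : Set ℂ := ⋃ a ∈ 𝒬, closedBall (meshPoint ℓ a) (3 * ℓ) with hK'
  have hK'c : IsCompact K' := 𝒬.isCompact_biUnion fun a _ => isCompact_closedBall _ _
  have hK'Ω : K' ⊆ Ω := by
    intro w hw
    obtain ⟨a, ha, hw⟩ := mem_iUnion₂.1 hw
    exact h𝒬 a ha (closedBall_subset_closedBall (by linarith) hw)
  have hnear : ∀ a ∈ 𝒬, ∀ w : ℂ, |w.re - ℓ * a 0| ≤ 3 * ℓ / 2 → |w.im - ℓ * a 1| ≤ 3 * ℓ / 2 → w ∈ K' := by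
    intro a ha w h0 h1
    refine mem_iUnion₂.2 ⟨a, ha, ?_⟩
    rw [mem_closedBall, Complex.dist_eq]
    refine (Complex.norm_le_abs_re_add_abs_im _).trans ?_
    simp only [Complex.sub_re, Complex.sub_im, meshPoint_re, meshPoint_im]
    linarith
  -- the main estimate with two slack parameters
  have main : ∀ θ : ℝ, 0 < θ → ∀ η : ℝ, 0 < η →
      ∫⁻ w in K, ‖fderiv ℝ v w‖ₑ ^ 2 ≤
        ENNReal.ofReal (1 + θ) * I + ENNReal.ofReal (8 * (1 + θ⁻¹) * η ^ 2 * (ℓ ^ 2 * 𝒬.card)) := by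
    intro θ hθ η hη
    obtain ⟨τ, hτ, hτuc⟩ := Metric.uniformContinuousOn_iff.1
      (hK'c.uniformContinuousOn_of_continuous (hvc.mono hK'Ω)) η hη
    have hunif : ∀ i : Fin 2, ∀ᶠ n in atTop, ∀ w ∈ K',
        |(h n (nearestSite ((2 : ℝ)⁻¹ ^ k n) w + Pi.single i 1) - h n (nearestSite ((2 : ℝ)⁻¹ ^ k n) w)) /
            (2 : ℝ)⁻¹ ^ k n - fderiv ℝ v w (if i = 0 then (1 : ℂ) else Complex.I)| ≤ η := by
      intro i
      have hu := (tendstoLocallyUniformlyOn_iff_forall_isCompact hΩo).1 (hD i) K' hK'Ω hK'c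
      refine ((Metric.tendstoUniformlyOn_iff.1 hu) η hη).mono fun n hn w hw => ?_
      have := hn w hw
      rw [Real.dist_eq, abs_sub_comm] at this
      exact this.le
    have hmesh : ∀ᶠ n in atTop, (2 : ℝ)⁻¹ ^ k n < τ / 2 ∧ m ≤ k n := by
      have ht : Tendsto (fun n => (2 : ℝ)⁻¹ ^ k n) atTop (𝓝 0) :=
        (tendsto_pow_atTop_nhds_zero_of_lt_one (by norm_num) (by norm_num)).comp hk
      filter_upwards [(tendsto_order.1 ht).2 _ (half_pos hτ), hk.eventually_ge_atTop m] with n h1 h2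
      exact ⟨h1, h2⟩
    have hev : ∀ᶠ n in atTop, ∫⁻ w in K, ‖fderiv ℝ v w‖ₑ ^ 2 ≤
        ENNReal.ofReal (1 + θ) * C n + ENNReal.ofReal (8 * (1 + θ⁻¹) * η ^ 2 * (ℓ ^ 2 * 𝒬.card)) := by
      filter_upwards [hunif 0, hunif 1, hmesh, hedges K' hK'Ω hK'c] with n hn0 hn1 hn2 hn3
      set δ : ℝ := (2 : ℝ)⁻¹ ^ k n with hδdef
      have hδ : 0 < δ := by positivity
      set P : ℕ := 2 ^ (k n - m) with hPdef
      have hP : 0 < P := by positivity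
      have hℓP : ℓ = δ * P := by
        rw [hℓ, hδdef, hPdef]; push_cast
        exact half_pow_eq hn2.2
      have hδτ : 2 * δ < τ := by linarith [hn2.1]
      have hℓδ : δ ≤ ℓ := by
        rw [hℓP]; have : (1 : ℝ) ≤ P := by exact_mod_cast hP
        nlinarith
      -- lattice points of the grids have nearby points in `K'`
      have hgridK' : ∀ a ∈ 𝒬, ∀ p ∈ Finset.Ico (a 0 * P) (a 0 * P + P) ×ˢ Finset.Ico (a 1 * P) (a 1 * P + P),
          ∀ w : ℂ, |w.re - δ * p.1| ≤ δ → |w.im - δ * p.2| ≤ δ → w ∈ K' := by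
        intro a ha p hp w h0 h1
        obtain ⟨hp0, hp1⟩ := Finset.mem_product.1 hp
        rw [Finset.mem_Ico] at hp0 hp1
        have c0 : ℓ * a 0 ≤ δ * p.1 ∧ δ * p.1 ≤ ℓ * a 0 + (ℓ - δ) := by
          have e0 : ℓ * a 0 = δ * ((a 0 * P : ℤ) : ℝ) := by push_cast; rw [hℓP]; ring
          rw [e0]
          constructor
          · exact mul_le_mul_of_nonneg_left (by exact_mod_cast hp0.1) hδ.le
          · have : (p.1 : ℝ) ≤ (a 0 * P : ℤ) + P - 1 := by
              have : p.1 ≤ a 0 * P + P - 1 := by omega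
              exact_mod_cast this
            rw [hℓP]; nlinarith
        have c1 : ℓ * a 1 ≤ δ * p.2 ∧ δ * p.2 ≤ ℓ * a 1 + (ℓ - δ) := by
          have e1 : ℓ * a 1 = δ * ((a 1 * P : ℤ) : ℝ) := by push_cast; rw [hℓP]; ring
          rw [e1]
          constructor
          · exact mul_le_mul_of_nonneg_left (by exact_mod_cast hp1.1) hδ.le
          · have : (p.2 : ℝ) ≤ (a 1 * P : ℤ) + P - 1 := by
              have : p.2 ≤ a 1 * P + P - 1 := by omega
              exact_mod_cast this
            rw [hℓP]; nlinarith
        refine hnear a ha w ?_ ?_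
        · rw [abs_le] at h0 ⊢; constructor <;> nlinarith [c0.1, c0.2]
        · rw [abs_le] at h1 ⊢; constructor <;> nlinarith [c1.1, c1.2]
      -- the cellwise bound
      have hcellb : ∀ a ∈ 𝒬, ∀ p ∈ Finset.Ico (a 0 * P) (a 0 * P + P) ×ˢ Finset.Ico (a 1 * P) (a 1 * P + P),
          ∀ w ∈ Ico (δ * p.1) (δ * (p.1 + 1)) ×ℂ Ico (δ * p.2) (δ * (p.2 + 1)),
            ‖fderiv ℝ v w‖ₑ ^ 2 ≤ ENNReal.ofReal ((1 + θ) * (((h n (![p.1, p.2] + Pi.single 0 1) - h n ![p.1, p.2]) ^ 2 +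
              (h n (![p.1, p.2] + Pi.single 1 1) - h n ![p.1, p.2]) ^ 2) / δ ^ 2) + 8 * (1 + θ⁻¹) * η ^ 2) := by
        intro a ha p hp w hw
        set x : Site 2 := ![p.1, p.2] with hx
        have hmx : meshPoint δ x = ⟨δ * p.1, δ * p.2⟩ := Complex.ext (by simp [hx]) (by simp [hx])
        have hxK' : meshPoint δ x ∈ K' :=
          hgridK' a ha p hp _ (by rw [hmx]; simp [hδ.le]) (by rw [hmx]; simp [hδ.le])
        obtain ⟨⟨hw0, hw0'⟩, ⟨hw1, hw1'⟩⟩ := hw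
        have hwK' : w ∈ K' := hgridK' a ha p hp w (by rw [abs_le]; constructor <;> linarith)
          (by rw [abs_le]; constructor <;> linarith)
        have hdist : dist w (meshPoint δ x) < τ := by
          rw [Complex.dist_eq, hmx]
          refine (Complex.norm_le_abs_re_add_abs_im _).trans_lt ?_
          have e0 : |w.re - δ * p.1| ≤ δ := by rw [abs_le]; constructor <;> linarith
          have e1 : |w.im - δ * p.2| ≤ δ := by rw [abs_le]; constructor <;> linarith
          simp only [Complex.sub_re, Complex.sub_im]
          linarith
        have hg : ‖fderiv ℝ v w - fderiv ℝ v (meshPoint δ x)‖ ≤ η := by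
          rw [← dist_eq_norm]; exact (hτuc w hwK' _ hxK' hdist).le
        have h0' := hn0 (meshPoint δ x) hxK'
        have h1' := hn1 (meshPoint δ x) hxK'
        rw [nearestSite_meshPoint hδ.ne'] at h0' h1'
        simp only [Fin.isValue, ↓reduceIte, show (1 : Fin 2) ≠ 0 from by decide] at h0' h1'
        have key := norm_sq_le_of_close (fderiv ℝ v w) (fderiv ℝ v (meshPoint δ x)) hθ h0' h1' hg
        calc ‖fderiv ℝ v w‖ₑ ^ 2 = ENNReal.ofReal (‖fderiv ℝ v w‖ ^ 2) := by
              rw [← ofReal_norm, ENNReal.ofReal_pow (norm_nonneg _)]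
          _ ≤ _ := ENNReal.ofReal_le_ofReal key
      have hedges' : ∀ a ∈ 𝒬, ∀ p ∈ Finset.Ico (a 0 * P) (a 0 * P + P) ×ˢ Finset.Ico (a 1 * P) (a 1 * P + P),
          ∀ i : Fin 2, s((![p.1, p.2] : Site 2), ![p.1, p.2] + Pi.single i 1) ∈ (domainGraph Ω δ).edgeSet := by
        intro a ha p hp i
        refine hn3 _ (hgridK' a ha p hp _ ?_ ?_) i
        · have : meshPoint δ ![p.1, p.2] = ⟨δ * p.1, δ * p.2⟩ := Complex.ext (by simp) (by simp)
          rw [this]; simp [hδ.le]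
        · have : meshPoint δ ![p.1, p.2] = ⟨δ * p.1, δ * p.2⟩ := Complex.ext (by simp) (by simp)
          rw [this]; simp [hδ.le]
      have core := lintegral_squares_le_energy hδ hP 𝒬 (domainGraph Ω δ) (h n) (F := fun w => ‖fderiv ℝ v w‖ₑ ^ 2)
        hθ hcellb hedges'
      have hKeq : K = ⋃ a ∈ 𝒬, (Ico (δ * P * a 0) (δ * P * (a 0 + 1)) ×ℂ Ico (δ * P * a 1) (δ * P * (a 1 + 1))) := by
        rw [hK, ← hℓP]
      rw [hKeq, show ℓ ^ 2 = (δ * P) ^ 2 by rw [hℓP]]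
      exact core.trans (by gcongr; exact hC n)
    have hlim : Tendsto (fun n => ENNReal.ofReal (1 + θ) * C n +
        ENNReal.ofReal (8 * (1 + θ⁻¹) * η ^ 2 * (ℓ ^ 2 * 𝒬.card))) atTop
        (𝓝 (ENNReal.ofReal (1 + θ) * I + ENNReal.ofReal (8 * (1 + θ⁻¹) * η ^ 2 * (ℓ ^ 2 * 𝒬.card)))) :=
      (ENNReal.Tendsto.const_mul hI (Or.inr ENNReal.ofReal_ne_top)).add tendsto_const_nhds
    exact ge_of_tendsto hlim hev
  -- let `η → 0`, then `θ → 0`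
  by_cases hItop : I = ⊤
  · rw [hItop]; exact le_top
  have step1 : ∀ θ : ℝ, 0 < θ → ∫⁻ w in K, ‖fderiv ℝ v w‖ₑ ^ 2 ≤ ENNReal.ofReal (1 + θ) * I := by
    intro θ hθ
    refine ENNReal.le_of_forall_pos_le_add fun ε hε _ => ?_
    -- choose `η` with `8(1+θ⁻¹) η² ℓ² |𝒬| ≤ ε`
    set M : ℝ := 8 * (1 + θ⁻¹) * (ℓ ^ 2 * 𝒬.card) with hM
    have hM0 : 0 ≤ M := by positivity
    set η : ℝ := Real.sqrt ((ε : ℝ) / (M + 1)) with hη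
    have hη0 : 0 < η := Real.sqrt_pos.2 (by positivity)
    have hηsq : η ^ 2 = (ε : ℝ) / (M + 1) := Real.sq_sqrt (by positivity)
    have hbound : 8 * (1 + θ⁻¹) * η ^ 2 * (ℓ ^ 2 * 𝒬.card) ≤ ε := by
      rw [show 8 * (1 + θ⁻¹) * η ^ 2 * (ℓ ^ 2 * 𝒬.card) = M * η ^ 2 by rw [hM]; ring, hηsq]
      rw [mul_div_assoc']
      rw [div_le_iff₀ (by positivity)]
      nlinarith [NNReal.coe_nonneg ε]
    calc ∫⁻ w in K, ‖fderiv ℝ v w‖ₑ ^ 2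
        ≤ ENNReal.ofReal (1 + θ) * I + ENNReal.ofReal (8 * (1 + θ⁻¹) * η ^ 2 * (ℓ ^ 2 * 𝒬.card)) := main θ hθ η hη0
      _ ≤ ENNReal.ofReal (1 + θ) * I + ε := by
          gcongr
          rw [← ENNReal.ofReal_coe_nnreal]
          exact ENNReal.ofReal_le_ofReal hbound
  refine ENNReal.le_of_forall_pos_le_add fun ε hε _ => ?_
  -- choose `θ` with `θ I ≤ ε`
  have hIr : I.toReal < I.toReal + 1 := by linarith
  set θ : ℝ := (ε : ℝ) / (I.toReal + 1) with hθ
  have hθ0 : 0 < θ := by positivity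
  calc ∫⁻ w in K, ‖fderiv ℝ v w‖ₑ ^ 2 ≤ ENNReal.ofReal (1 + θ) * I := step1 θ hθ0
    _ = I + ENNReal.ofReal θ * I := by
        rw [ENNReal.ofReal_add zero_le_one hθ0.le, ENNReal.ofReal_one, add_mul, one_mul]
    _ ≤ I + ε := by
        gcongr
        rw [← ENNReal.ofReal_toReal hItop, ← ENNReal.ofReal_mul hθ0.le, ← ENNReal.ofReal_coe_nnreal]
        refine ENNReal.ofReal_le_ofReal ?_
        rw [hθ, div_mul_eq_mul_div, div_le_iff₀ (by positivity)]
        nlinarith [NNReal.coe_nonneg ε, ENNReal.toReal_nonneg (a := I)]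

/-- Floor corner: `w` lies in the half-open square of side `ℓ` at the corner `⌊w/ℓ⌋`, whose mesh
point is within `2ℓ` of `w` (`ℓ¹` bound). [folklore] -/
theorem mem_square_floor {ℓ : ℝ} (hℓ : 0 < ℓ) (w : ℂ) :
    w ∈ Ico (ℓ * ((![⌊w.re / ℓ⌋, ⌊w.im / ℓ⌋] : Site 2) 0)) (ℓ * (((![⌊w.re / ℓ⌋, ⌊w.im / ℓ⌋] : Site 2) 0) + 1)) ×ℂ
      Ico (ℓ * ((![⌊w.re / ℓ⌋, ⌊w.im / ℓ⌋] : Site 2) 1)) (ℓ * (((![⌊w.re / ℓ⌋, ⌊w.im / ℓ⌋] : Site 2) 1) + 1)) ∧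
    dist (meshPoint ℓ ![⌊w.re / ℓ⌋, ⌊w.im / ℓ⌋]) w ≤ 2 * ℓ := by
  have k0 := Int.floor_le (w.re / ℓ)
  have k0' := Int.lt_floor_add_one (w.re / ℓ)
  have k1 := Int.floor_le (w.im / ℓ)
  have k1' := Int.lt_floor_add_one (w.im / ℓ)
  rw [le_div_iff₀ hℓ] at k0 k1
  rw [div_lt_iff₀ hℓ] at k0' k1'
  refine ⟨⟨⟨?_, ?_⟩, ⟨?_, ?_⟩⟩, ?_⟩
  · show ℓ * ((⌊w.re / ℓ⌋ : ℤ) : ℝ) ≤ w.re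
    linarith
  · show w.re < ℓ * (((⌊w.re / ℓ⌋ : ℤ) : ℝ) + 1)
    linarith
  · show ℓ * ((⌊w.im / ℓ⌋ : ℤ) : ℝ) ≤ w.im
    linarith
  · show w.im < ℓ * (((⌊w.im / ℓ⌋ : ℤ) : ℝ) + 1)
    linarith
  · rw [Complex.dist_eq]
    refine (Complex.norm_le_abs_re_add_abs_im _).trans ?_
    have hre : (meshPoint ℓ ![⌊w.re / ℓ⌋, ⌊w.im / ℓ⌋] - w).re = ℓ * (⌊w.re / ℓ⌋ : ℝ) - w.re := by
      simp [meshPoint_re]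
    have him : (meshPoint ℓ ![⌊w.re / ℓ⌋, ⌊w.im / ℓ⌋] - w).im = ℓ * (⌊w.im / ℓ⌋ : ℝ) - w.im := by
      simp [meshPoint_im]
    rw [hre, him]
    have e0 : |ℓ * (⌊w.re / ℓ⌋ : ℝ) - w.re| ≤ ℓ := by rw [abs_le]; constructor <;> linarith
    have e1 : |ℓ * (⌊w.im / ℓ⌋ : ℝ) - w.im| ≤ ℓ := by rw [abs_le]; constructor <;> linarith
    linarith

open Classical in
/-- **`∫∫_Ω ‖∇v‖² ≤ lim 𝓔(h_n)`** (Fatou-type lower semicontinuity of the Dirichlet energy along the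
discrete potentials; [GP19], §4.5). Under the hypotheses of `lintegral_level_le` and for bounded
open `Ω`, the whole integral of `‖fderiv ℝ v‖²` over `Ω` is at most `I`: `Ω` is exhausted by the
increasing finite unions of deep level-`m` dyadic squares, and `∫⁻` over an increasing union is the
supremum (`setLIntegral_iUnion_of_directed`). [cite: GeorgakopoulosPanagiotis2019, §4.5] -/
theorem lintegral_norm_fderiv_sq_le (hΩo : IsOpen Ω) (hΩb : Bornology.IsBounded Ω) {k : ℕ → ℕ}
    (hk : Tendsto k atTop atTop) {h : ℕ → Site 2 → ℝ}
    (hedges : ∀ K' ⊆ Ω, IsCompact K' → ∀ᶠ n in atTop, ∀ x : Site 2, meshPoint ((2 : ℝ)⁻¹ ^ k n) x ∈ K' →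
      ∀ i : Fin 2, s(x, x + (Pi.single i 1 : Site 2)) ∈ (domainGraph Ω ((2 : ℝ)⁻¹ ^ k n)).edgeSet)
    {C : ℕ → ℝ≥0∞} (hC : ∀ n, networkEnergy (domainGraph Ω ((2 : ℝ)⁻¹ ^ k n)) 1 (h n) ≤ C n)
    {I : ℝ≥0∞} (hI : Tendsto C atTop (𝓝 I)) {v : ℂ → ℝ} (hvc : ContinuousOn (fderiv ℝ v) Ω)
    (hD : ∀ i : Fin 2, TendstoLocallyUniformlyOn
      (fun n w => (h n (nearestSite ((2 : ℝ)⁻¹ ^ k n) w + Pi.single i 1) -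
        h n (nearestSite ((2 : ℝ)⁻¹ ^ k n) w)) / (2 : ℝ)⁻¹ ^ k n)
      (fun w => fderiv ℝ v w (if i = 0 then (1 : ℂ) else Complex.I)) atTop Ω) :
    ∫⁻ w in Ω, ‖fderiv ℝ v w‖ₑ ^ 2 ≤ I := by
  -- level-`m` data
  set ℓ : ℕ → ℝ := fun m => (2 : ℝ)⁻¹ ^ m with hℓ
  have hℓ0 : ∀ m, 0 < ℓ m := fun m => by positivity
  have hfin : ∀ m, {a : Site 2 | closedBall (meshPoint (ℓ m) a) (10 * ℓ m) ⊆ Ω}.Finite := fun m =>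
    (meshVertices_finite hΩb (hℓ0 m)).subset fun a ha => ha (mem_closedBall_self (by positivity))
  set 𝒬 : ℕ → Finset (Site 2) := fun m => (hfin m).toFinset with h𝒬
  have hmem𝒬 : ∀ m a, a ∈ 𝒬 m ↔ closedBall (meshPoint (ℓ m) a) (10 * ℓ m) ⊆ Ω := fun m a => by
    rw [h𝒬]; exact (hfin m).mem_toFinset
  set Sq : ℕ → Site 2 → Set ℂ := fun m a =>
    Ico (ℓ m * a 0) (ℓ m * (a 0 + 1)) ×ℂ Ico (ℓ m * a 1) (ℓ m * (a 1 + 1)) with hSq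
  set K : ℕ → Set ℂ := fun m => ⋃ a ∈ 𝒬 m, Sq m a with hK
  -- points of a square are within `2ℓ` of the corner mesh point
  have hSqdist : ∀ m a w, w ∈ Sq m a → dist w (meshPoint (ℓ m) a) ≤ 2 * ℓ m := by
    intro m a w hw
    obtain ⟨⟨h0, h0'⟩, ⟨h1, h1'⟩⟩ := hw
    rw [Complex.dist_eq]
    refine (Complex.norm_le_abs_re_add_abs_im _).trans ?_
    simp only [Complex.sub_re, Complex.sub_im, meshPoint_re, meshPoint_im]
    have e0 : |w.re - ℓ m * a 0| ≤ ℓ m := by rw [abs_le]; constructor <;> nlinarith [hℓ0 m]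
    have e1 : |w.im - ℓ m * a 1| ≤ ℓ m := by rw [abs_le]; constructor <;> nlinarith [hℓ0 m]
    linarith
  have hℓsucc : ∀ m, ℓ (m + 1) = ℓ m / 2 := fun m => by simp only [hℓ, pow_succ]; ring
  -- monotonicity of the exhaustion
  have hmono : Monotone K := by
    refine monotone_nat_of_le_succ fun m w hw => ?_
    obtain ⟨a, ha, hw⟩ := mem_iUnion₂.1 hw
    rw [hmem𝒬] at ha
    obtain ⟨hw', hd'⟩ := mem_square_floor (hℓ0 (m + 1)) w
    set a' : Site 2 := ![⌊w.re / ℓ (m + 1)⌋, ⌊w.im / ℓ (m + 1)⌋] with ha'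
    refine mem_iUnion₂.2 ⟨a', ?_, hw'⟩
    rw [hmem𝒬]
    intro u hu
    refine ha (mem_closedBall.2 ?_)
    rw [mem_closedBall] at hu
    have := hSqdist m a w hw
    calc dist u (meshPoint (ℓ m) a) ≤ dist u (meshPoint (ℓ (m + 1)) a') + dist (meshPoint (ℓ (m + 1)) a') w +
          dist w (meshPoint (ℓ m) a) := dist_triangle4 _ _ _ _
      _ ≤ 10 * ℓ (m + 1) + 2 * ℓ (m + 1) + 2 * ℓ m := by gcongr
      _ ≤ 10 * ℓ m := by rw [hℓsucc]; linarith [hℓ0 m]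
  -- the squares exhaust `Ω`
  have hcover : Ω ⊆ ⋃ m, K m := by
    intro w hw
    obtain ⟨r, hr, hrΩ⟩ := Metric.isOpen_iff.1 hΩo w hw
    have ht : Tendsto ℓ atTop (𝓝 0) := tendsto_pow_atTop_nhds_zero_of_lt_one (by norm_num) (by norm_num)
    obtain ⟨m, hm⟩ := (eventually_atTop.1 ((tendsto_order.1 ht).2 _ (show 0 < r / 12 by positivity)))
    have hm' := hm m le_rfl
    obtain ⟨hw', hd'⟩ := mem_square_floor (hℓ0 m) w
    refine mem_iUnion.2 ⟨m, mem_iUnion₂.2 ⟨_, ?_, hw'⟩⟩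
    rw [hmem𝒬]
    intro u hu
    refine hrΩ (mem_ball.2 ?_)
    rw [mem_closedBall] at hu
    calc dist u w ≤ dist u (meshPoint (ℓ m) ![⌊w.re / ℓ m⌋, ⌊w.im / ℓ m⌋]) +
          dist (meshPoint (ℓ m) ![⌊w.re / ℓ m⌋, ⌊w.im / ℓ m⌋]) w := dist_triangle _ _ _
      _ ≤ 10 * ℓ m + 2 * ℓ m := add_le_add hu hd'
      _ < r := by linarith
  -- conclusion
  calc ∫⁻ w in Ω, ‖fderiv ℝ v w‖ₑ ^ 2 ≤ ∫⁻ w in ⋃ m, K m, ‖fderiv ℝ v w‖ₑ ^ 2 := lintegral_mono_set hcover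
    _ = ⨆ m, ∫⁻ w in K m, ‖fderiv ℝ v w‖ₑ ^ 2 := setLIntegral_iUnion_of_directed _ hmono.directed_le
    _ ≤ I := iSup_le fun m => lintegral_level_le hΩo hk hedges hC hI hvc hD m (𝒬 m)
        (fun a ha => (hmem𝒬 m a).1 ha)

end Fatou

/-! ### §10. The continuum step: `d_Ω(T,B)⁻¹ ≤ ∫∫_Ω ‖∇v‖²` for `v` with the right boundary values ([GP19], §4.5 / Ahlfors §4-3) -/

section Continuum

open _root_.MeasureTheory

open Literature.Analysis.Complex Literature.Analysis.Complex.ExtremalLength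

/-- **Fundamental theorem of calculus, inequality form** for a real function continuous on
`[α, β]` and differentiable on `(α, β)`: `ψ β - ψ α ≤ ∫_{(α,β)} ‖ψ'‖` (no integrability needed: if
the integral is infinite there is nothing to prove; cf. `ExtremalLength.enorm_sub_le_lintegral_deriv`).
[folklore] -/
theorem ofReal_sub_le_lintegral_deriv {ψ : ℝ → ℝ} {α β : ℝ} (hαβ : α ≤ β)
    (hc : ContinuousOn ψ (Icc α β)) (hd : DifferentiableOn ℝ ψ (Ioo α β)) :
    ENNReal.ofReal (ψ β - ψ α) ≤ ∫⁻ t in Ioo α β, ‖deriv ψ t‖ₑ := by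
  by_cases htop : ∫⁻ t in Ioo α β, ‖deriv ψ t‖ₑ = ∞
  · rw [htop]; exact le_top
  have hint : IntegrableOn (deriv ψ) (Ioo α β) :=
    ⟨(measurable_deriv ψ).aestronglyMeasurable, lt_top_iff_ne_top.2 htop⟩
  have hint' : IntervalIntegrable (deriv ψ) volume α β :=
    (intervalIntegrable_iff_integrableOn_Ioo_of_le hαβ).2 hint
  have hftc := intervalIntegral.integral_eq_sub_of_hasDerivAt_of_le hαβ hc
    (fun t ht => (hd.differentiableAt (Ioo_mem_nhds ht.1 ht.2)).hasDerivAt) hint'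
  have hle : ψ β - ψ α ≤ (∫⁻ t in Ioo α β, ‖deriv ψ t‖ₑ).toReal := by
    rw [← hftc, intervalIntegral.integral_of_le hαβ, integral_Ioc_eq_integral_Ioo,
      ← integral_norm_eq_lintegral_enorm hint.aestronglyMeasurable]
    exact (le_abs_self _).trans (by
      rw [← Real.norm_eq_abs]; exact norm_integral_le_integral_norm _)
  calc ENNReal.ofReal (ψ β - ψ α) ≤ ENNReal.ofReal ((∫⁻ t in Ioo α β, ‖deriv ψ t‖ₑ).toReal) :=
        ENNReal.ofReal_le_ofReal hle
    _ ≤ ∫⁻ t in Ioo α β, ‖deriv ψ t‖ₑ := ENNReal.ofReal_toReal_le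

/-- **The logarithmic bump about a point has small area**: for `0 < η < 1`,
`∬ 1{η² < |z - c| < η} / (|z - c| log (1/η))² = 2π / log (1/η)`. (The capacity of a point is zero;
Ahlfors (1973), §4-7.) [folklore] -/
theorem lintegral_bump_sq (c : ℂ) {η : ℝ} (hη : 0 < η) (hη1 : η < 1) :
    ∫⁻ z, ({z : ℂ | η ^ 2 < ‖z - c‖ ∧ ‖z - c‖ < η}.indicator
        (fun z => ENNReal.ofReal ((‖z - c‖ * Real.log η⁻¹)⁻¹)) z) ^ 2 =
      ENNReal.ofReal (2 * Real.pi / Real.log η⁻¹) := by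
  have hL : 0 < Real.log η⁻¹ := Real.log_pos ((one_lt_inv₀ hη).2 hη1)
  have hη2 : η ^ 2 < η := by nlinarith
  -- translate to the origin
  have htrans : ∫⁻ z, ({z : ℂ | η ^ 2 < ‖z - c‖ ∧ ‖z - c‖ < η}.indicator
        (fun z => ENNReal.ofReal ((‖z - c‖ * Real.log η⁻¹)⁻¹)) z) ^ 2 =
      ∫⁻ z, ({z : ℂ | η ^ 2 < ‖z‖ ∧ ‖z‖ < η}.indicator
        (fun z => ENNReal.ofReal ((‖z‖ * Real.log η⁻¹)⁻¹)) z) ^ 2 := by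
    have := lintegral_sub_right_eq_self (μ := volume)
      (fun z : ℂ => ({z : ℂ | η ^ 2 < ‖z‖ ∧ ‖z‖ < η}.indicator
        (fun z => ENNReal.ofReal ((‖z‖ * Real.log η⁻¹)⁻¹)) z) ^ 2) c
    rw [← this]
    rfl
  rw [htrans]
  -- square of the indicator
  have hsq : ∀ z : ℂ, ({z : ℂ | η ^ 2 < ‖z‖ ∧ ‖z‖ < η}.indicator
      (fun z => ENNReal.ofReal ((‖z‖ * Real.log η⁻¹)⁻¹)) z) ^ 2 =
      {z : ℂ | η ^ 2 < ‖z‖ ∧ ‖z‖ < η}.indicator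
        (fun z => ENNReal.ofReal ((Real.log η⁻¹) ^ 2)⁻¹ * ENNReal.ofReal (‖z‖ ^ 2)⁻¹) z := by
    intro z
    by_cases hz : z ∈ {z : ℂ | η ^ 2 < ‖z‖ ∧ ‖z‖ < η}
    · rw [indicator_of_mem hz, indicator_of_mem hz, ← ENNReal.ofReal_pow (by positivity),
        ← ENNReal.ofReal_mul (by positivity)]
      congr 1
      have : 0 < ‖z‖ := lt_trans (by positivity) hz.1
      field_simp
    · rw [indicator_of_notMem hz, indicator_of_notMem hz, zero_pow two_ne_zero]
  have hmeas : MeasurableSet {z : ℂ | η ^ 2 < ‖z‖ ∧ ‖z‖ < η} :=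
    (isOpen_Ioo.preimage continuous_norm).measurableSet
  simp_rw [hsq]
  rw [lintegral_indicator hmeas, lintegral_const_mul' _ _ ENNReal.ofReal_ne_top,
    AnnulusCrossing.lintegral_annulus_inv_sq (by positivity) hη2.le]
  rw [← ENNReal.ofReal_mul (by positivity), ← ENNReal.ofReal_mul (by positivity)]
  congr 1
  have : Real.log (η / η ^ 2) = Real.log η⁻¹ := by
    congr 1; field_simp
  rw [this]
  field_simp

/-- **A path crossing the logarithmic bump has bump-length at least `1`**: if `γ` is continuous on
`[0,1]`, differentiable on `(0,1)`, and one endpoint is within `η²` of `c` while the other is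
farther than `η`, then `∫₀¹ b(γ) |γ'| ≥ 1` for the bump `b = 1{η² < |z-c| < η} / (|z-c| log(1/η))`
(fundamental theorem of calculus for `log |γ - c|` on a crossing subinterval, as in
`AnnulusCrossing.ofReal_log_le_mul_logAngLen`). [folklore] -/
theorem one_le_lintegral_bump_of_crossing (c : ℂ) {η : ℝ} (hη : 0 < η) (hη1 : η < 1) {γ : ℝ → ℂ}
    (hc : ContinuousOn γ (Icc 0 1)) (hd : DifferentiableOn ℝ γ (Ioo 0 1))
    (hends : (‖γ 0 - c‖ < η ^ 2 ∧ η < ‖γ 1 - c‖) ∨ (‖γ 1 - c‖ < η ^ 2 ∧ η < ‖γ 0 - c‖)) :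
    1 ≤ ∫⁻ u in Ioo (0 : ℝ) 1, {z : ℂ | η ^ 2 < ‖z - c‖ ∧ ‖z - c‖ < η}.indicator
        (fun z => ENNReal.ofReal ((‖z - c‖ * Real.log η⁻¹)⁻¹)) (γ u) * ‖deriv γ u‖ₑ := by
  set L : ℝ := Real.log η⁻¹ with hLdef
  have hL : 0 < L := Real.log_pos ((one_lt_inv₀ hη).2 hη1)
  have hη2 : η ^ 2 < η := by nlinarith
  set φ : ℝ → ℝ := fun u => ‖γ u - c‖ with hφ
  have hφc : ContinuousOn φ (Icc 0 1) := (hc.sub continuousOn_const).norm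
  -- a crossing subinterval
  obtain ⟨α, β, hα, hαβ, hβ, hin, hendsφ⟩ : ∃ α β, 0 ≤ α ∧ α < β ∧ β ≤ 1 ∧
      (∀ u ∈ Ioo α β, η ^ 2 < φ u ∧ φ u < η) ∧ (φ α = η ^ 2 ∧ φ β = η ∨ φ α = η ∧ φ β = η ^ 2) := by
    rcases hends with ⟨h0, h1⟩ | ⟨h1, h0⟩
    · exact AnnulusCrossing.exists_Ioo_crossing hφc (left_mem_Icc.2 zero_le_one) (right_mem_Icc.2 zero_le_one) h0 h1 hη2
    · exact AnnulusCrossing.exists_Ioo_crossing hφc (right_mem_Icc.2 zero_le_one) (left_mem_Icc.2 zero_le_one) h1 h0 hη2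
  -- the subinterval is inside `(0, 1)`
  have hα0 : 0 < α := by
    rcases eq_or_lt_of_le hα with h | h
    · exfalso
      rcases hends with ⟨h0, -⟩ | ⟨-, h0⟩ <;> rcases hendsφ with ⟨hφα, -⟩ | ⟨hφα, -⟩ <;>
        · rw [← h] at hφα; simp only [hφ] at hφα; nlinarith
    · exact h
  have hβ1 : β < 1 := by
    rcases eq_or_lt_of_le hβ with h | h
    · exfalso
      rcases hends with ⟨-, h1⟩ | ⟨h1, -⟩ <;> rcases hendsφ with ⟨-, hφβ⟩ | ⟨-, hφβ⟩ <;>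
        · rw [h] at hφβ; simp only [hφ] at hφβ; nlinarith
    · exact h
  have hsub : Ioo α β ⊆ Ioo 0 1 := Ioo_subset_Ioo hα0.le hβ1.le
  -- `γ ≠ c` on `[α, β]`
  have hpos : ∀ u ∈ Icc α β, 0 < φ u := by
    intro u hu
    rcases eq_or_lt_of_le hu.1 with h | h
    · rw [← h]; rcases hendsφ with ⟨e, -⟩ | ⟨e, -⟩ <;> rw [e] <;> positivity
    rcases eq_or_lt_of_le hu.2 with h' | h'
    · rw [h']; rcases hendsφ with ⟨-, e⟩ | ⟨-, e⟩ <;> rw [e] <;> positivity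
    exact lt_trans (by positivity) (hin u ⟨h, h'⟩).1
  -- the function `ψ = ± log |γ - c|`
  set sgn : ℝ := if φ α = η ^ 2 then 1 else -1 with hsgn
  set ψ : ℝ → ℝ := fun u => sgn * Real.log (φ u) with hψ
  have hψc : ContinuousOn ψ (Icc α β) := by
    refine continuousOn_const.mul ((hφc.mono (Icc_subset_Icc hα hβ)).log fun u hu => (hpos u hu).ne')
  have hγd : ∀ u ∈ Ioo α β, HasDerivAt γ (deriv γ u) u := fun u hu =>
    (hd.differentiableAt (Ioo_mem_nhds (hsub hu).1 (hsub hu).2)).hasDerivAt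
  have hψd : ∀ u ∈ Ioo α β, ∃ d : ℝ, HasDerivAt ψ d u ∧ |d| ≤ ‖deriv γ u‖ / φ u := by
    intro u hu
    have hne : γ u - c ≠ 0 := by
      have := hpos u (Ioo_subset_Icc_self hu); simp only [hφ] at this; exact norm_pos_iff.1 this
    obtain ⟨d, hdd, hdb⟩ := AnnulusCrossing.exists_hasDerivAt_log_norm ((hγd u hu).sub_const c) hne
    refine ⟨sgn * d, hdd.const_mul sgn, ?_⟩
    have hs1 : |sgn| = 1 := by rw [hsgn]; split_ifs <;> simp
    rw [abs_mul, hs1, one_mul]; exact hdb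
  have hψdiff : DifferentiableOn ℝ ψ (Ioo α β) := fun u hu =>
    (hψd u hu).choose_spec.1.differentiableAt.differentiableWithinAt
  -- `ψ β - ψ α = L`
  have hψval : ψ β - ψ α = L := by
    simp only [hψ]
    rcases hendsφ with ⟨e1, e2⟩ | ⟨e1, e2⟩
    · rw [hsgn, if_pos e1, e1, e2, one_mul, one_mul, Real.log_pow, hLdef, Real.log_inv]; push_cast; ring
    · have hne : φ α ≠ η ^ 2 := by rw [e1]; exact hη2.ne'
      rw [hsgn, if_neg hne, e1, e2, Real.log_pow, hLdef, Real.log_inv]; push_cast; ring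
  -- FTC inequality and pointwise comparison
  have hftc := ofReal_sub_le_lintegral_deriv hαβ.le hψc hψdiff
  rw [hψval] at hftc
  have hpt : ∀ u ∈ Ioo α β, ‖deriv ψ u‖ₑ ≤
      ENNReal.ofReal L * ({z : ℂ | η ^ 2 < ‖z - c‖ ∧ ‖z - c‖ < η}.indicator
        (fun z => ENNReal.ofReal ((‖z - c‖ * Real.log η⁻¹)⁻¹)) (γ u) * ‖deriv γ u‖ₑ) := by
    intro u hu
    obtain ⟨d, hdd, hdb⟩ := hψd u hu
    have hφu : 0 < φ u := hpos u (Ioo_subset_Icc_self hu)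
    rw [hdd.deriv, indicator_of_mem (show γ u ∈ {z : ℂ | η ^ 2 < ‖z - c‖ ∧ ‖z - c‖ < η} from hin u hu),
      Real.enorm_eq_ofReal_abs, ← ofReal_norm (deriv γ u), ← ENNReal.ofReal_mul (by positivity),
      ← ENNReal.ofReal_mul (by positivity)]
    refine ENNReal.ofReal_le_ofReal (hdb.trans (le_of_eq ?_))
    rw [← hLdef]
    simp only [hφ]
    field_simp
  have hL0 : ENNReal.ofReal L ≠ 0 := (ENNReal.ofReal_pos.2 hL).ne'
  have hint : ENNReal.ofReal L ≤ ENNReal.ofReal L * ∫⁻ u in Ioo α β,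
      {z : ℂ | η ^ 2 < ‖z - c‖ ∧ ‖z - c‖ < η}.indicator
        (fun z => ENNReal.ofReal ((‖z - c‖ * Real.log η⁻¹)⁻¹)) (γ u) * ‖deriv γ u‖ₑ := by
    calc ENNReal.ofReal L ≤ ∫⁻ u in Ioo α β, ‖deriv ψ u‖ₑ := hftc
      _ ≤ ∫⁻ u in Ioo α β, ENNReal.ofReal L * ({z : ℂ | η ^ 2 < ‖z - c‖ ∧ ‖z - c‖ < η}.indicator
          (fun z => ENNReal.ofReal ((‖z - c‖ * Real.log η⁻¹)⁻¹)) (γ u) * ‖deriv γ u‖ₑ) :=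
          setLIntegral_mono' measurableSet_Ioo hpt
      _ = _ := lintegral_const_mul' _ _ ENNReal.ofReal_ne_top
  have h1 : (1 : ℝ≥0∞) ≤ ∫⁻ u in Ioo α β, {z : ℂ | η ^ 2 < ‖z - c‖ ∧ ‖z - c‖ < η}.indicator
      (fun z => ENNReal.ofReal ((‖z - c‖ * Real.log η⁻¹)⁻¹)) (γ u) * ‖deriv γ u‖ₑ := by
    calc (1 : ℝ≥0∞) = (ENNReal.ofReal L)⁻¹ * ENNReal.ofReal L := (ENNReal.inv_mul_cancel hL0 ENNReal.ofReal_ne_top).symm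
      _ ≤ (ENNReal.ofReal L)⁻¹ * (ENNReal.ofReal L * ∫⁻ u in Ioo α β,
          {z : ℂ | η ^ 2 < ‖z - c‖ ∧ ‖z - c‖ < η}.indicator
            (fun z => ENNReal.ofReal ((‖z - c‖ * Real.log η⁻¹)⁻¹)) (γ u) * ‖deriv γ u‖ₑ) := by gcongr
      _ = _ := by rw [← mul_assoc, ENNReal.inv_mul_cancel hL0 ENNReal.ofReal_ne_top, one_mul]
  exact h1.trans (lintegral_mono_set hsub)

/-- **The gradient part of the length bounds the drop of `v` along the path**: if `v` is
differentiable on the open set `Ω` and the path runs in `Ω` on `(0,1)`, then for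
`0 < u₁ ≤ u₂ < 1`, `v(γ u₁) - v(γ u₂) ≤ ∫₀¹ 1_Ω ‖∇v‖(γ) |γ'|` (chain rule and the fundamental
theorem of calculus). [folklore] -/
theorem ofReal_sub_le_lintegral_indicator {Ω : Set ℂ} {v : ℂ → ℝ}
    (hv : ∀ w ∈ Ω, DifferentiableAt ℝ v w) {γ : ℝ → ℂ} (hd : DifferentiableOn ℝ γ (Ioo 0 1))
    (hmaps : MapsTo γ (Ioo 0 1) Ω) {u₁ u₂ : ℝ} (h0 : 0 < u₁) (h12 : u₁ ≤ u₂) (h1 : u₂ < 1) :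
    ENNReal.ofReal (v (γ u₁) - v (γ u₂)) ≤
      ∫⁻ u in Ioo (0 : ℝ) 1, Ω.indicator (fun w => ‖fderiv ℝ v w‖ₑ) (γ u) * ‖deriv γ u‖ₑ := by
  set ψ : ℝ → ℝ := fun u => -v (γ u) with hψ
  have hsub : Ioo u₁ u₂ ⊆ Ioo 0 1 := Ioo_subset_Ioo h0.le h1.le
  have hsub' : Icc u₁ u₂ ⊆ Ioo 0 1 := fun u hu => ⟨h0.trans_le hu.1, hu.2.trans_lt h1⟩
  have hderiv : ∀ u ∈ Ioo (0 : ℝ) 1, HasDerivAt ψ (-(fderiv ℝ v (γ u) (deriv γ u))) u := by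
    intro u hu
    have hγ : HasDerivAt γ (deriv γ u) u := (hd.differentiableAt (Ioo_mem_nhds hu.1 hu.2)).hasDerivAt
    have hvγ : HasDerivAt (fun u => v (γ u)) (fderiv ℝ v (γ u) (deriv γ u)) u :=
      (hv _ (hmaps hu)).hasFDerivAt.comp_hasDerivAt u hγ
    exact hvγ.neg
  have hψc : ContinuousOn ψ (Icc u₁ u₂) := fun u hu =>
    (hderiv u (hsub' hu)).continuousAt.continuousWithinAt
  have hψd : DifferentiableOn ℝ ψ (Ioo u₁ u₂) := fun u hu =>
    (hderiv u (hsub hu)).differentiableAt.differentiableWithinAt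
  have hftc := ofReal_sub_le_lintegral_deriv h12 hψc hψd
  have hval : ψ u₂ - ψ u₁ = v (γ u₁) - v (γ u₂) := by simp only [hψ]; ring
  rw [hval] at hftc
  refine hftc.trans ((setLIntegral_mono' measurableSet_Ioo fun u hu => ?_).trans (lintegral_mono_set hsub))
  rw [(hderiv u (hsub hu)).deriv, indicator_of_mem (hmaps (hsub hu)), enorm_neg]
  calc ‖(fderiv ℝ v (γ u)) (deriv γ u)‖ₑ = ENNReal.ofReal ‖(fderiv ℝ v (γ u)) (deriv γ u)‖ := (ofReal_norm _).symm
    _ ≤ ENNReal.ofReal (‖fderiv ℝ v (γ u)‖ * ‖deriv γ u‖) :=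
        ENNReal.ofReal_le_ofReal ((fderiv ℝ v (γ u)).le_opNorm _)
    _ = ‖fderiv ℝ v (γ u)‖ₑ * ‖deriv γ u‖ₑ := by
        rw [ENNReal.ofReal_mul (norm_nonneg _), ofReal_norm, ofReal_norm]

/-- A length lower bound holding up to every `ε`: if `ofReal (1 - 2ε) ≤ x` for all `ε > 0` then
`1 ≤ x`. [folklore] -/
theorem one_le_of_forall_ofReal_le {x : ℝ≥0∞} (h : ∀ ε : ℝ, 0 < ε → ENNReal.ofReal (1 - 2 * ε) ≤ x) : 1 ≤ x := by
  by_contra hlt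
  rw [not_le] at hlt
  have hx : x ≠ ⊤ := hlt.ne_top
  set t : ℝ := x.toReal with ht
  have hxt : x = ENNReal.ofReal t := (ENNReal.ofReal_toReal hx).symm
  have ht0 : 0 ≤ t := ENNReal.toReal_nonneg
  have hxr : t < 1 := by
    have := (ENNReal.toReal_lt_toReal hx ENNReal.one_ne_top).2 hlt
    simpa using this
  have key := h ((1 - t) / 4) (by linarith)
  rw [hxt] at key
  have := (ENNReal.ofReal_le_ofReal_iff ht0).1 key
  linarith

/-- Sum over `Fin 4` of functions with pairwise disjoint supports, squared: `(Σ fₘ)² = Σ fₘ²`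
pointwise when at most one `fₘ z` is non-zero. [folklore] -/
theorem sq_sum_eq_sum_sq_of_disjoint {f : Fin 4 → ℂ → ℝ≥0∞} {z : ℂ}
    (h : ∀ m m', m ≠ m' → f m z = 0 ∨ f m' z = 0) :
    (∑ m, f m z) ^ 2 = ∑ m, f m z ^ 2 := by
  by_cases hall : ∀ m, f m z = 0
  · simp [hall]
  push Not at hall
  obtain ⟨m₀, hm₀⟩ := hall
  have hothers : ∀ m, m ≠ m₀ → f m z = 0 := fun m hm => (h m m₀ hm).resolve_right hm₀
  have hs : ∑ m, f m z = f m₀ z := by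
    rw [Finset.sum_eq_single m₀ (fun m _ hm => hothers m hm) (by simp)]
  have hs2 : ∑ m, f m z ^ 2 = f m₀ z ^ 2 := by
    rw [Finset.sum_eq_single m₀ (fun m _ hm => by rw [hothers m hm, zero_pow two_ne_zero]) (by simp)]
  rw [hs, hs2]

/-- `(a + b)² ≤ (1 + θ) a² + (1 + θ⁻¹) b²` in `ℝ≥0∞`. [folklore] -/
theorem ennreal_add_sq_le (a b : ℝ≥0∞) {θ : ℝ} (hθ : 0 < θ) :
    (a + b) ^ 2 ≤ ENNReal.ofReal (1 + θ) * a ^ 2 + ENNReal.ofReal (1 + θ⁻¹) * b ^ 2 := by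
  rcases eq_or_ne a ⊤ with rfl | ha
  · simp [ENNReal.ofReal_eq_zero, not_le.2 (by linarith : (0 : ℝ) < 1 + θ)]
  rcases eq_or_ne b ⊤ with rfl | hb
  · simp [ENNReal.ofReal_eq_zero, not_le.2 (by positivity : (0 : ℝ) < 1 + θ⁻¹)]
  lift a to ℝ≥0 using ha
  lift b to ℝ≥0 using hb
  have key : ((a : ℝ) + b) ^ 2 ≤ (1 + θ) * (a : ℝ) ^ 2 + (1 + θ⁻¹) * (b : ℝ) ^ 2 := by
    have h1 : 2 * (a : ℝ) * b ≤ θ * (a : ℝ) ^ 2 + θ⁻¹ * (b : ℝ) ^ 2 := by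
      have := sq_nonneg (Real.sqrt θ * a - (Real.sqrt θ)⁻¹ * b)
      have hsq : Real.sqrt θ ^ 2 = θ := Real.sq_sqrt hθ.le
      have hsq' : (Real.sqrt θ)⁻¹ ^ 2 = θ⁻¹ := by rw [inv_pow, hsq]
      have hss : Real.sqrt θ * (Real.sqrt θ)⁻¹ = 1 := mul_inv_cancel₀ (Real.sqrt_ne_zero'.2 hθ)
      have hexp : (Real.sqrt θ * a - (Real.sqrt θ)⁻¹ * b) ^ 2 =
          Real.sqrt θ ^ 2 * (a : ℝ) ^ 2 - 2 * a * b * (Real.sqrt θ * (Real.sqrt θ)⁻¹) +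
            (Real.sqrt θ)⁻¹ ^ 2 * (b : ℝ) ^ 2 := by ring
      rw [hexp, hsq, hsq', hss, mul_one] at this
      linarith
    nlinarith
  have lhs : ((a : ℝ≥0∞) + b) ^ 2 = ENNReal.ofReal (((a : ℝ) + b) ^ 2) := by
    rw [ENNReal.ofReal_pow (by positivity), ENNReal.ofReal_add (by positivity) (by positivity),
      ENNReal.ofReal_coe_nnreal, ENNReal.ofReal_coe_nnreal]
  have rhs : ENNReal.ofReal ((1 + θ) * (a : ℝ) ^ 2 + (1 + θ⁻¹) * (b : ℝ) ^ 2) =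
      ENNReal.ofReal (1 + θ) * (a : ℝ≥0∞) ^ 2 + ENNReal.ofReal (1 + θ⁻¹) * (b : ℝ≥0∞) ^ 2 := by
    rw [ENNReal.ofReal_add (by positivity : (0 : ℝ) ≤ (1 + θ) * (a : ℝ) ^ 2)
        (by positivity : (0 : ℝ) ≤ (1 + θ⁻¹) * (b : ℝ) ^ 2),
      ENNReal.ofReal_mul (by positivity : (0:ℝ) ≤ 1 + θ),
      ENNReal.ofReal_mul (by positivity : (0:ℝ) ≤ 1 + θ⁻¹), ENNReal.ofReal_pow (by positivity : (0:ℝ) ≤ a),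
      ENNReal.ofReal_pow (by positivity : (0:ℝ) ≤ b), ENNReal.ofReal_coe_nnreal, ENNReal.ofReal_coe_nnreal]
  rw [lhs, ← rhs]
  exact ENNReal.ofReal_le_ofReal key

/-- The logarithmic bump is a measurable metric. [folklore] -/
theorem measurable_bump (c : ℂ) (η : ℝ) :
    Measurable fun z : ℂ => {z : ℂ | η ^ 2 < ‖z - c‖ ∧ ‖z - c‖ < η}.indicator
      (fun z => ENNReal.ofReal ((‖z - c‖ * Real.log η⁻¹)⁻¹)) z := by
  refine Measurable.indicator ?_ ((isOpen_Ioo.preimage (continuous_norm.comp (continuous_sub_right c))).measurableSet)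
  exact ((continuous_norm.comp (continuous_sub_right c)).mul continuous_const).measurable.inv.ennreal_ofReal

/-- The metric dominates each of its summands, hence its length dominates theirs. [folklore] -/
theorem lintegral_le_length_of_le {ρ σ : ℂ → ℝ≥0∞} (h : ∀ z, σ z ≤ ρ z) (γ : ℝ → ℂ) :
    ∫⁻ u in Ioo (0 : ℝ) 1, σ (γ u) * ‖deriv γ u‖ₑ ≤ length ρ γ :=
  lintegral_mono fun _ => mul_le_mul' (h _) le_rfl

/-- **The extremal-length step, quantitative form** ([GP19], §4.5 with Ahlfors (1973), §4-3:
any allowable metric bounds the extremal length from below). Let `R` be a conformal rectangle,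
`v` differentiable on `Ω = R.carrier` with `∫∫_Ω ‖∇v‖² ≤ I < ∞`, `v → 1` at the interior points
of `T = R.arc 0` and `v → 0` at those of `B = R.arc 2`. For `0 < θ` and small `η > 0`, the
metric `ρ = 1_Ω ‖∇v‖ + Σ_corners 1{η² < |z - c| < η}/(|z - c| log(1/η))` gives every path of
`Γ(T, B)` length `≥ 1` (gradient along paths from interior points, the logarithmic bump at a
corner endpoint), so `d_Ω(T,B)⁻¹ ≤ A(Ω, ρ) ≤ (1+θ) I + (1+θ⁻¹) · 4 · 2π / log(1/η)`.
[cite: GeorgakopoulosPanagiotis2019, §4.5] -/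
theorem inv_extremalDistance_le_aux (R : RandomPlanarGeometry.ConformalRectangle) {v : ℂ → ℝ} {I : ℝ≥0∞}
    (hItop : I ≠ ⊤) (hvd : ∀ w ∈ R.carrier, DifferentiableAt ℝ v w)
    (hI : ∫⁻ w in R.carrier, ‖fderiv ℝ v w‖ₑ ^ 2 ≤ I)
    (hT : ∀ t ∈ Ioo (R.mark 0) (R.nextMark 0), ∀ ε : ℝ, 0 < ε → ∃ r > 0, ∀ w ∈ R.carrier,
      dist w (R.boundary t) < r → 1 - ε ≤ v w)
    (hB : ∀ t ∈ Ioo (R.mark 2) (R.nextMark 2), ∀ ε : ℝ, 0 < ε → ∃ r > 0, ∀ w ∈ R.carrier,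
      dist w (R.boundary t) < r → v w ≤ ε)
    {dp : ℝ} (hdp' : ∀ m m' : Fin 4, m ≠ m' → dp ≤ dist (R.pt m) (R.pt m'))
    {dA : ℝ} (hdA' : ∀ a ∈ R.arc 0, ∀ b ∈ R.arc 2, dA < dist a b)
    {θ : ℝ} (hθ : 0 < θ) {η : ℝ} (hη : 0 < η) (hη1 : η < 1 / 2) (hηp : 4 * η ≤ dp) (hηA : 2 * η ≤ dA) :
    (extremalDistance R.carrier (R.arc 0) (R.arc 2))⁻¹ ≤
      ENNReal.ofReal (1 + θ) * I + ENNReal.ofReal (1 + θ⁻¹) * (4 * ENNReal.ofReal (2 * Real.pi / Real.log η⁻¹)) := by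
  set Ω := R.carrier with hΩ
  have hΩo : IsOpen Ω := R.isOpen
  have hη1' : η < 1 := by linarith
  -- the metric
  set bump : Fin 4 → ℂ → ℝ≥0∞ := fun m z => {z : ℂ | η ^ 2 < ‖z - R.pt m‖ ∧ ‖z - R.pt m‖ < η}.indicator
    (fun z => ENNReal.ofReal ((‖z - R.pt m‖ * Real.log η⁻¹)⁻¹)) z with hbump
  set grad : ℂ → ℝ≥0∞ := fun z => Ω.indicator (fun w => ‖fderiv ℝ v w‖ₑ) z with hgrad
  set ρ : ℂ → ℝ≥0∞ := fun z => grad z + ∑ m, bump m z with hρ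
  have hbm : ∀ m, Measurable (bump m) := fun m => measurable_bump (R.pt m) η
  have hgm : Measurable grad := ((measurable_fderiv ℝ v).enorm).indicator hΩo.measurableSet
  have hρm : Measurable ρ := hgm.add (Finset.measurable_sum _ fun m _ => hbm m)
  have hρ_grad : ∀ z, grad z ≤ ρ z := fun z => le_self_add
  have hρ_bump : ∀ m z, bump m z ≤ ρ z := fun m z =>
    (Finset.single_le_sum (f := fun m => bump m z) (fun _ _ => bot_le) (Finset.mem_univ m)).trans le_add_self
  -- corners versus arcs
  have hc0 : R.pt 0 ∈ R.arc 0 := R.pt_mem_arc_self 0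
  have hc1 : R.pt 1 ∈ R.arc 0 := by have := R.pt_succ_mem_arc 0; simpa using this
  have hc2 : R.pt 2 ∈ R.arc 2 := R.pt_mem_arc_self 2
  have hc3 : R.pt 3 ∈ R.arc 2 := by have := R.pt_succ_mem_arc 2; simpa using this
  -- every joining path has `ρ`-length `≥ 1`
  have hlen : ∀ γ ∈ joiningPaths Ω (R.arc 0) (R.arc 2), (1 : ℝ≥0∞) ≤ length ρ γ := by
    intro γ hγ
    rw [mem_joiningPaths] at hγ
    -- corner cases first
    have corner : ∀ m : Fin 4, ((‖γ 0 - R.pt m‖ < η ^ 2 ∧ η < ‖γ 1 - R.pt m‖) ∨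
        (‖γ 1 - R.pt m‖ < η ^ 2 ∧ η < ‖γ 0 - R.pt m‖)) → (1 : ℝ≥0∞) ≤ length ρ γ := fun m hends =>
      (one_le_lintegral_bump_of_crossing (R.pt m) hη hη1' hγ.continuousOn hγ.differentiableOn hends).trans
        (lintegral_le_length_of_le (hρ_bump m) γ)
    have hfar0 : ∀ c ∈ R.arc 0, η < ‖γ 1 - c‖ := fun c hc => by
      have := hdA' c hc (γ 1) hγ.target; rw [dist_comm, dist_eq_norm] at this; linarith
    have hfar1 : ∀ c ∈ R.arc 2, η < ‖γ 0 - c‖ := fun c hc => by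
      have := hdA' (γ 0) hγ.source c hc; rw [dist_eq_norm] at this; linarith
    obtain ⟨t₀, ht₀, hγ0⟩ := hγ.source
    rcases Set.eq_endpoints_or_mem_Ioo_of_mem_Icc ht₀ with rfl | rfl | ht₀'
    · exact corner 0 (Or.inl ⟨by rw [← hγ0]; simp [RandomPlanarGeometry.MarkedDomain.pt]; positivity, hfar0 _ hc0⟩)
    · refine corner 1 (Or.inl ⟨?_, hfar0 _ hc1⟩)
      rw [← hγ0, R.boundary_nextMark]; simp; positivity
    obtain ⟨t₁, ht₁, hγ1⟩ := hγ.target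
    rcases Set.eq_endpoints_or_mem_Ioo_of_mem_Icc ht₁ with rfl | rfl | ht₁'
    · exact corner 2 (Or.inr ⟨by rw [← hγ1]; simp [RandomPlanarGeometry.MarkedDomain.pt]; positivity, hfar1 _ hc2⟩)
    · refine corner 3 (Or.inr ⟨?_, hfar1 _ hc3⟩)
      rw [← hγ1, R.boundary_nextMark]; simp; positivity
    -- interior endpoints: gradient along the path
    refine one_le_of_forall_ofReal_le fun ε hε => ?_
    obtain ⟨r₀, hr₀, hr₀v⟩ := hT t₀ ht₀' ε hε
    obtain ⟨r₁, hr₁, hr₁v⟩ := hB t₁ ht₁' ε hε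
    obtain ⟨δ₀, hδ₀, hδ₀c⟩ := Metric.continuousWithinAt_iff.1 (hγ.continuousOn.continuousWithinAt
      (left_mem_Icc.2 zero_le_one)) r₀ hr₀
    obtain ⟨δ₁, hδ₁, hδ₁c⟩ := Metric.continuousWithinAt_iff.1 (hγ.continuousOn.continuousWithinAt
      (right_mem_Icc.2 zero_le_one)) r₁ hr₁
    set u₁ : ℝ := min (δ₀ / 2) (1 / 4) with hu₁
    set u₂ : ℝ := max (1 - δ₁ / 2) (3 / 4) with hu₂
    have hu₁0 : 0 < u₁ := by positivity
    have hu₁1 : u₁ ≤ 1 / 4 := min_le_right _ _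
    have hu₂0 : 3 / 4 ≤ u₂ := le_max_right _ _
    have hu₂1 : u₂ < 1 := max_lt (by linarith) (by norm_num)
    have hv1 : 1 - ε ≤ v (γ u₁) := by
      refine hr₀v _ (hγ.mapsTo ⟨hu₁0, by linarith⟩) ?_
      rw [hγ0]
      exact hδ₀c ⟨hu₁0.le, by linarith⟩ (by rw [dist_zero_right, Real.norm_eq_abs, abs_of_pos hu₁0]; linarith [min_le_left (δ₀/2) (1/4)])
    have hv2 : v (γ u₂) ≤ ε := by
      refine hr₁v _ (hγ.mapsTo ⟨by linarith, hu₂1⟩) ?_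
      rw [hγ1]
      refine hδ₁c ⟨by linarith, hu₂1.le⟩ ?_
      rw [Real.dist_eq, abs_of_nonpos (by linarith)]
      linarith [le_max_left (1 - δ₁ / 2) (3 / 4)]
    calc ENNReal.ofReal (1 - 2 * ε) ≤ ENNReal.ofReal (v (γ u₁) - v (γ u₂)) := ENNReal.ofReal_le_ofReal (by linarith)
      _ ≤ ∫⁻ u in Ioo (0 : ℝ) 1, grad (γ u) * ‖deriv γ u‖ₑ :=
          ofReal_sub_le_lintegral_indicator hvd hγ.differentiableOn hγ.mapsTo hu₁0 (by linarith) hu₂1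
      _ ≤ length ρ γ := lintegral_le_length_of_le hρ_grad γ
  -- the area bound
  set Aub : ℝ≥0∞ := ENNReal.ofReal (1 + θ) * I +
    ENNReal.ofReal (1 + θ⁻¹) * (4 * ENNReal.ofReal (2 * Real.pi / Real.log η⁻¹)) with hAub
  have hdisj : ∀ z : ℂ, ∀ m m' : Fin 4, m ≠ m' → bump m z = 0 ∨ bump m' z = 0 := by
    intro z m m' hmm
    by_contra hcon
    push Not at hcon
    have h1 : z ∈ {z : ℂ | η ^ 2 < ‖z - R.pt m‖ ∧ ‖z - R.pt m‖ < η} := by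
      by_contra hz; exact hcon.1 (indicator_of_notMem hz _)
    have h2 : z ∈ {z : ℂ | η ^ 2 < ‖z - R.pt m'‖ ∧ ‖z - R.pt m'‖ < η} := by
      by_contra hz; exact hcon.2 (indicator_of_notMem hz _)
    have := hdp' m m' hmm
    have htri : dist (R.pt m) (R.pt m') ≤ ‖z - R.pt m‖ + ‖z - R.pt m'‖ := by
      rw [dist_eq_norm, ← norm_neg (z - R.pt m)]
      exact (norm_add_le _ _).trans' (by rw [show R.pt m - R.pt m' = -(z - R.pt m) + (z - R.pt m') by ring])
    linarith [h1.2, h2.2]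
  have harea : area Ω ρ ≤ Aub := by
    have hpt : ∀ z, ρ z ^ 2 ≤ ENNReal.ofReal (1 + θ) * grad z ^ 2 + ENNReal.ofReal (1 + θ⁻¹) * ∑ m, bump m z ^ 2 := by
      intro z
      rw [← sq_sum_eq_sum_sq_of_disjoint (hdisj z)]
      exact ennreal_add_sq_le _ _ hθ
    calc area Ω ρ = ∫⁻ z in Ω, ρ z ^ 2 := rfl
      _ ≤ ∫⁻ z in Ω, (ENNReal.ofReal (1 + θ) * grad z ^ 2 + ENNReal.ofReal (1 + θ⁻¹) * ∑ m, bump m z ^ 2) :=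
          lintegral_mono hpt
      _ = ENNReal.ofReal (1 + θ) * (∫⁻ z in Ω, grad z ^ 2) + ENNReal.ofReal (1 + θ⁻¹) * ∑ m, ∫⁻ z in Ω, bump m z ^ 2 := by
          rw [lintegral_add_left ((hgm.pow_const 2).const_mul _), lintegral_const_mul _ (hgm.pow_const 2),
            lintegral_const_mul _ (Finset.measurable_sum _ fun m _ => (hbm m).pow_const 2),
            lintegral_finsetSum _ fun m _ => (hbm m).pow_const 2]
      _ ≤ ENNReal.ofReal (1 + θ) * I + ENNReal.ofReal (1 + θ⁻¹) * ∑ m : Fin 4, ENNReal.ofReal (2 * Real.pi / Real.log η⁻¹) := by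
          have hX : ∫⁻ z in Ω, grad z ^ 2 ≤ I := by
            calc ∫⁻ z in Ω, grad z ^ 2 = ∫⁻ z in Ω, ‖fderiv ℝ v z‖ₑ ^ 2 := by
                  refine setLIntegral_congr_fun hΩo.measurableSet fun z hz => ?_
                  show Ω.indicator (fun w => ‖fderiv ℝ v w‖ₑ) z ^ 2 = _
                  rw [indicator_of_mem hz]
              _ ≤ I := hI
          have hY : ∀ m : Fin 4, ∫⁻ z in Ω, bump m z ^ 2 ≤ ENNReal.ofReal (2 * Real.pi / Real.log η⁻¹) := fun m =>
            calc ∫⁻ z in Ω, bump m z ^ 2 ≤ ∫⁻ z, bump m z ^ 2 := setLIntegral_le_lintegral _ _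
              _ = _ := lintegral_bump_sq (R.pt m) hη hη1'
          exact add_le_add (mul_le_mul' le_rfl hX) (mul_le_mul' le_rfl (Finset.sum_le_sum fun m _ => hY m))
      _ = Aub := by
          rw [hAub]
          simp only [Finset.sum_const, Finset.card_univ, Fintype.card_fin, nsmul_eq_mul, Nat.cast_ofNat]
  have htop : area Ω ρ ≠ ⊤ := by
    refine (harea.trans_lt ?_).ne
    rw [hAub]
    exact ENNReal.add_lt_top.2 ⟨ENNReal.mul_lt_top ENNReal.ofReal_lt_top (lt_top_iff_ne_top.2 hItop),
      ENNReal.mul_lt_top ENNReal.ofReal_lt_top (ENNReal.mul_lt_top (by simp) ENNReal.ofReal_lt_top)⟩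
  -- the area is positive: a ball inside `Ω` and the first annulus
  have h0 : area Ω ρ ≠ 0 := by
    -- a point of `Ω` in the annulus about `pt 0`
    obtain ⟨w₁, hw₁, hw₁d⟩ := R.exists_mem_carrier_dist_lt 0 hc0 (ε := η ^ 2) (by positivity)
    obtain ⟨w₂, hw₂, hw₂d⟩ := R.exists_mem_carrier_dist_lt 2 hc2 (ε := η) hη
    have hf : ContinuousOn (fun z => ‖z - R.pt 0‖) Ω := (continuous_norm.comp (continuous_sub_right _)).continuousOn
    have hw₂far : η < ‖w₂ - R.pt 0‖ := by
      have := hdp' 2 0 (by decide)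
      have htri : dist (R.pt 2) (R.pt 0) ≤ dist (R.pt 2) w₂ + dist w₂ (R.pt 0) := dist_triangle _ _ _
      rw [dist_comm (R.pt 2) w₂] at htri
      rw [← dist_eq_norm]; linarith
    have hy : (η ^ 2 + η) / 2 ∈ Icc ‖w₁ - R.pt 0‖ ‖w₂ - R.pt 0‖ := by
      rw [← dist_eq_norm] 
      constructor <;> nlinarith [hw₁d.le, hw₂far.le]
    obtain ⟨z₀, hz₀Ω, hz₀⟩ := (R.isConnected.isPreconnected.intermediate_value hw₁ hw₂ hf) hy
    have hz₀A : η ^ 2 < ‖z₀ - R.pt 0‖ ∧ ‖z₀ - R.pt 0‖ < η := by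
      simp only at hz₀; rw [hz₀]; constructor <;> nlinarith
    -- a small ball inside `Ω` and the annulus
    have hopen : IsOpen (Ω ∩ {z : ℂ | η ^ 2 < ‖z - R.pt 0‖ ∧ ‖z - R.pt 0‖ < η}) :=
      hΩo.inter (isOpen_Ioo.preimage (continuous_norm.comp (continuous_sub_right _)))
    obtain ⟨r', hr', hball⟩ := Metric.isOpen_iff.1 hopen z₀ ⟨hz₀Ω, hz₀A⟩
    set κ : ℝ≥0∞ := ENNReal.ofReal ((η * Real.log η⁻¹)⁻¹) with hκ
    have hL : 0 < Real.log η⁻¹ := Real.log_pos ((one_lt_inv₀ hη).2 hη1')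
    have hκ0 : κ ≠ 0 := by rw [hκ]; exact (ENNReal.ofReal_pos.2 (by positivity)).ne'
    have hρκ : ∀ z ∈ ball z₀ r', κ ≤ ρ z := by
      intro z hz
      have hzA := (hball hz).2
      refine le_trans ?_ (hρ_bump 0 z)
      simp only [hbump, indicator_of_mem hzA]
      refine ENNReal.ofReal_le_ofReal ?_
      have hzpos : 0 < ‖z - R.pt 0‖ * Real.log η⁻¹ := mul_pos (lt_trans (by positivity) hzA.1) hL
      exact inv_anti₀ hzpos (mul_le_mul_of_nonneg_right hzA.2.le hL.le)
    have hposint : 0 < ∫⁻ z in Ω, ρ z ^ 2 := by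
      calc (0 : ℝ≥0∞) < κ ^ 2 * volume (ball z₀ r') :=
            ENNReal.mul_pos (pow_ne_zero 2 hκ0) (Metric.measure_ball_pos volume z₀ hr').ne'
        _ = ∫⁻ z in ball z₀ r', κ ^ 2 := (setLIntegral_const _ _).symm
        _ ≤ ∫⁻ z in ball z₀ r', ρ z ^ 2 := setLIntegral_mono' measurableSet_ball fun z hz => pow_le_pow_left' (hρκ z hz) 2
        _ ≤ ∫⁻ z in Ω, ρ z ^ 2 := lintegral_mono_set fun z hz => (hball hz).1
    exact hposint.ne'
  -- the extremal length bound
  have hEL := sq_div_le_extremalLength hρm h0 htop (Γ := joiningPaths Ω (R.arc 0) (R.arc 2)) (ℓ := 1) hlen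
  rw [one_pow, ENNReal.div_eq_inv_mul, mul_one] at hEL
  exact (ENNReal.inv_le_iff_inv_le.1 hEL).trans harea

/-- **`d_Ω(T, B)⁻¹ ≤ ∫∫_Ω ‖∇v‖²` for a differentiable `v` with boundary values `1` on `T°` and `0`
on `B°`** (the elementary half of Ahlfors (1973), Thm 4-5, via the test metric `‖∇v‖` corrected
by logarithmic bumps at the four corners; [GP19], §4.5 and §2.2). This is the continuum input of
`limsup R^eff_n ≤ d_Ω(T, B)`. [cite: GeorgakopoulosPanagiotis2019, §4.5] -/
theorem inv_extremalDistance_le (R : RandomPlanarGeometry.ConformalRectangle) {v : ℂ → ℝ} {I : ℝ≥0∞}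
    (hvd : ∀ w ∈ R.carrier, DifferentiableAt ℝ v w)
    (hI : ∫⁻ w in R.carrier, ‖fderiv ℝ v w‖ₑ ^ 2 ≤ I)
    (hT : ∀ t ∈ Ioo (R.mark 0) (R.nextMark 0), ∀ ε : ℝ, 0 < ε → ∃ r > 0, ∀ w ∈ R.carrier,
      dist w (R.boundary t) < r → 1 - ε ≤ v w)
    (hB : ∀ t ∈ Ioo (R.mark 2) (R.nextMark 2), ∀ ε : ℝ, 0 < ε → ∃ r > 0, ∀ w ∈ R.carrier,
      dist w (R.boundary t) < r → v w ≤ ε) :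
    (extremalDistance R.carrier (R.arc 0) (R.arc 2))⁻¹ ≤ I := by
  by_cases hItop : I = ⊤
  · rw [hItop]; exact le_top
  obtain ⟨dp, hdp, hdp'⟩ := R.exists_pos_le_dist_pt
  obtain ⟨dA, hdA, hdA'⟩ := R.exists_pos_forall_lt_dist_arc
  have step1 : ∀ θ : ℝ, 0 < θ →
      (extremalDistance R.carrier (R.arc 0) (R.arc 2))⁻¹ ≤ ENNReal.ofReal (1 + θ) * I := by
    intro θ hθ
    refine ENNReal.le_of_forall_pos_le_add fun ε hε _ => ?_
    -- choose `η` with `(1 + θ⁻¹) · 4 · 2π / log(1/η) ≤ ε`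
    set M : ℝ := (1 + θ⁻¹) * 4 * (2 * Real.pi) / ε with hM
    have hM0 : 0 < M := by rw [hM]; positivity
    set η : ℝ := min (min (1 / 4) (min (dp / 4) (dA / 2))) (Real.exp (-M)) with hη
    have hη0 : 0 < η := by positivity
    have hη1 : η < 1 / 2 := by
      have : η ≤ 1 / 4 := (min_le_left _ _).trans (min_le_left _ _)
      linarith
    have hηp : 4 * η ≤ dp := by
      have : η ≤ dp / 4 := (min_le_left _ _).trans ((min_le_right _ _).trans (min_le_left _ _))
      linarith
    have hηA : 2 * η ≤ dA := by
      have : η ≤ dA / 2 := (min_le_left _ _).trans ((min_le_right _ _).trans (min_le_right _ _))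
      linarith
    have hlog : M ≤ Real.log η⁻¹ := by
      rw [Real.le_log_iff_exp_le (by positivity)]
      have hηe : η ≤ Real.exp (-M) := min_le_right _ _
      calc Real.exp M = (Real.exp (-M))⁻¹ := by rw [Real.exp_neg, inv_inv]
        _ ≤ η⁻¹ := inv_anti₀ hη0 hηe
    have hbump : ENNReal.ofReal (1 + θ⁻¹) * (4 * ENNReal.ofReal (2 * Real.pi / Real.log η⁻¹)) ≤ ε := by
      have hL : 0 < Real.log η⁻¹ := hM0.trans_le hlog
      rw [show (4 : ℝ≥0∞) = ENNReal.ofReal 4 by norm_num, ← ENNReal.ofReal_mul (by norm_num),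
        ← ENNReal.ofReal_mul (by positivity), ← ENNReal.ofReal_coe_nnreal]
      refine ENNReal.ofReal_le_ofReal ?_
      have hεpos : (0 : ℝ) < ε := hε
      calc (1 + θ⁻¹) * (4 * (2 * Real.pi / Real.log η⁻¹)) = ((1 + θ⁻¹) * 4 * (2 * Real.pi)) / Real.log η⁻¹ := by ring
        _ ≤ ((1 + θ⁻¹) * 4 * (2 * Real.pi)) / M := by gcongr
        _ = ε := by rw [hM]; field_simp
    calc (extremalDistance R.carrier (R.arc 0) (R.arc 2))⁻¹
        ≤ ENNReal.ofReal (1 + θ) * I + ENNReal.ofReal (1 + θ⁻¹) * (4 * ENNReal.ofReal (2 * Real.pi / Real.log η⁻¹)) :=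
          inv_extremalDistance_le_aux R hItop hvd hI hT hB hdp' hdA' hθ hη0 hη1 hηp hηA
      _ ≤ ENNReal.ofReal (1 + θ) * I + ε := by gcongr
  refine ENNReal.le_of_forall_pos_le_add fun ε hε _ => ?_
  set θ : ℝ := (ε : ℝ) / (I.toReal + 1) with hθ
  have hθ0 : 0 < θ := by positivity
  calc (extremalDistance R.carrier (R.arc 0) (R.arc 2))⁻¹ ≤ ENNReal.ofReal (1 + θ) * I := step1 θ hθ0
    _ = I + ENNReal.ofReal θ * I := by
        rw [ENNReal.ofReal_add zero_le_one hθ0.le, ENNReal.ofReal_one, add_mul, one_mul]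
    _ ≤ I + ε := by
        gcongr
        rw [← ENNReal.ofReal_toReal hItop, ← ENNReal.ofReal_mul hθ0.le, ← ENNReal.ofReal_coe_nnreal]
        refine ENNReal.ofReal_le_ofReal ?_
        rw [hθ, div_mul_eq_mul_div, div_le_iff₀ (by positivity)]
        nlinarith [NNReal.coe_nonneg ε, ENNReal.toReal_nonneg (a := I)]

end Continuum

/-! ### §11. Assembly: `limsup R^eff_n ≤ d_Ω(T, B)` ([GP19], Cor 4.15, upper half) -/

section Assembly

open _root_.MeasureTheory Literature.Analysis.Complex

variable {Ω : Set ℂ}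

/-- For a fixed point `w ∈ Ω` and meshes `δ' n → 0`, the lattice point nearest to `w` is
eventually an interior vertex of `Ω_n` (all four lattice edges at it are edges of `Ω_n`).
[cite: GeorgakopoulosPanagiotis2019, §4.1] -/
theorem eventually_adj_nearestSite (hΩo : IsOpen Ω) (hΩc : IsConnected Ω) (hne : Ωᶜ.Nonempty)
    (h0 : (0 : ℂ) ∈ Ω) {δ' : ℕ → ℝ} (hδ : ∀ n, 0 < δ' n) (hδ0 : Tendsto δ' atTop (𝓝 0)) {w : ℂ} (hw : w ∈ Ω) :
    ∀ᶠ n in atTop, ∀ kk : Fin 4, (domainGraph Ω (δ' n)).Adj (nearestSite (δ' n) w) (nearestSite (δ' n) w + cornerUnit kk) := by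
  obtain ⟨s, hs, hsΩ⟩ := Metric.isOpen_iff.1 hΩo w hw
  have hKΩ : closedBall w (s / 2) ⊆ Ω := (closedBall_subset_ball (by linarith)).trans hsΩ
  obtain ⟨δ₁, hδ₁, hdom⟩ := exists_forall_mem_domain hΩo hΩc hne h0 (isCompact_closedBall w (s / 2)) hKΩ
  filter_upwards [(tendsto_order.1 hδ0).2 _ (lt_min hδ₁ (show 0 < s / 8 by positivity))] with n hn kk
  have hδn := hδ n
  have hn1 : δ' n < δ₁ := hn.trans_le (min_le_left _ _)
  have hn2 : δ' n < s / 8 := hn.trans_le (min_le_right _ _)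
  set x := nearestSite (δ' n) w with hx
  have hxw : dist (meshPoint (δ' n) x) w ≤ δ' n := dist_meshPoint_nearestSite_le hδn w
  have hxk : dist (meshPoint (δ' n) (x + cornerUnit kk)) (meshPoint (δ' n) x) = |δ' n| := by
    rw [_root_.dist_comm, Percolation.dist_meshPoint_of_adj (cSrc_mem_edgeSet (x, kk))]
  rw [abs_of_pos hδn] at hxk
  have hxK : meshPoint (δ' n) x ∈ closedBall w (s / 2) := mem_closedBall.2 (by linarith)
  have hxD : x ∈ domain Ω (δ' n) := hdom _ hδn hn1 x hxK
  refine (domainGraph_adj_iff_of_mem hxD).2 (innerGraph_adj_iff.2 ⟨cSrc_mem_edgeSet (x, kk), ?_⟩)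
  refine ((convex_closedBall w (s / 2)).segment_subset hxK ?_).trans hKΩ
  rw [mem_closedBall]
  linarith [dist_triangle (meshPoint (δ' n) (x + cornerUnit kk)) (meshPoint (δ' n) x) w]

/-- **Axis edges at the lattice points of a compact subset are eventually edges of `Ω_n`.**
[cite: GeorgakopoulosPanagiotis2019, §4.1] -/
theorem eventually_axisEdges_mem (hΩo : IsOpen Ω) (hΩc : IsConnected Ω) (hne : Ωᶜ.Nonempty)
    (h0 : (0 : ℂ) ∈ Ω) {δ' : ℕ → ℝ} (hδ : ∀ n, 0 < δ' n) (hδ0 : Tendsto δ' atTop (𝓝 0))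
    {K' : Set ℂ} (hK'Ω : K' ⊆ Ω) (hK'c : IsCompact K') :
    ∀ᶠ n in atTop, ∀ x : Site 2, meshPoint (δ' n) x ∈ K' →
      ∀ i : Fin 2, s(x, x + (Pi.single i 1 : Site 2)) ∈ (domainGraph Ω (δ' n)).edgeSet := by
  obtain ⟨ρ', hρ', hρ'Ω⟩ := hK'c.exists_cthickening_subset_open hΩo hK'Ω
  obtain ⟨δ₁, hδ₁, hdom⟩ := exists_forall_mem_domain hΩo hΩc hne h0 (hK'c.cthickening (r := ρ')) hρ'Ω
  filter_upwards [(tendsto_order.1 hδ0).2 _ (lt_min hδ₁ hρ')] with n hn x hx i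
  have hδn := hδ n
  have hn1 : δ' n < δ₁ := hn.trans_le (min_le_left _ _)
  have hn2 : δ' n < ρ' := hn.trans_le (min_le_right _ _)
  have hxD : x ∈ domain Ω (δ' n) := hdom _ hδn hn1 x (Metric.self_subset_cthickening _ hx)
  rw [SimpleGraph.mem_edgeSet, single_eq_cornerUnit_cast]
  refine (domainGraph_adj_iff_of_mem hxD).2 (innerGraph_adj_iff.2 ⟨cSrc_mem_edgeSet (x, _), ?_⟩)
  intro p hp
  refine hρ'Ω (Metric.mem_cthickening_of_dist_le p (meshPoint (δ' n) x) ρ' K' hx ?_)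
  have hsub : segment ℝ (meshPoint (δ' n) x) (meshPoint (δ' n) (x + cornerUnit (Fin.castLE (by norm_num) i))) ⊆
      closedBall (meshPoint (δ' n) x) |δ' n| :=
    (convex_closedBall _ _).segment_subset (mem_closedBall_self (abs_nonneg _))
      (by rw [mem_closedBall, _root_.dist_comm, Percolation.dist_meshPoint_of_adj (cSrc_mem_edgeSet (x, _))])
  have := hsub hp
  rw [mem_closedBall, abs_of_pos hδn] at this
  linarith

open Classical in
/-- **Local `C¹`-structure of a subsequential limit of discrete potentials**: near every point
of `Ω` the limit `v` is differentiable, with derivative the locally uniform limit of the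
discrete difference quotients. [cite: GeorgakopoulosPanagiotis2019, §4.1 (via Thm 4.3)] -/
theorem exists_local_hasFDerivAt (hΩo : IsOpen Ω) (hΩc : IsConnected Ω) (hne : Ωᶜ.Nonempty)
    (h0 : (0 : ℂ) ∈ Ω) {T B : Set ℂ} {δ' : ℕ → ℝ} (hδ : ∀ n, 0 < δ' n)
    (hδ0 : Tendsto δ' atTop (𝓝 0)) {H : ℕ → Site 2 → ℝ} (h01 : ∀ n x, H n x ∈ Icc (0 : ℝ) 1)
    (hharm : ∀ n x, x ∉ arcVertices Ω (δ' n) T → x ∉ arcVertices Ω (δ' n) B →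
      ∑ y ∈ ((zdGraph 2).neighborFinset x).filter (fun y => (domainGraph Ω (δ' n)).Adj x y),
        (H n y - H n x) = 0)
    {v : ℂ → ℝ}
    (hvloc : ∀ z ∈ Ω, ∃ r > 0,
      (∃ L ≥ (0 : ℝ), ∀ w ∈ ball z r, ∀ w' ∈ ball z r, |v w - v w'| ≤ L * dist w w') ∧
      TendstoUniformlyOn (fun n w => H n (nearestSite (δ' n) w)) v atTop (ball z r))
    {z : ℂ} (hz : z ∈ Ω) :
    ∃ s > 0, ∃ g₀ g₁ : ℂ → ℝ, ContinuousOn g₀ (ball z s) ∧ ContinuousOn g₁ (ball z s) ∧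
      TendstoUniformlyOn
        (fun n w => (H n (nearestSite (δ' n) w + Pi.single 0 1) - H n (nearestSite (δ' n) w)) / δ' n)
        g₀ atTop (ball z s) ∧
      TendstoUniformlyOn
        (fun n w => (H n (nearestSite (δ' n) w + Pi.single 1 1) - H n (nearestSite (δ' n) w)) / δ' n)
        g₁ atTop (ball z s) ∧
      ∀ w ∈ ball z s, HasFDerivAt v (g₀ w • Complex.reCLM + g₁ w • Complex.imCLM) w := by
  classical
  obtain ⟨r, hr, ⟨L, hL0, hLip⟩, hconv⟩ := hvloc z hz
  obtain ⟨r₁, hr₁, hzr₁⟩ := Metric.nhds_basis_closedBall.mem_iff.1 (hΩo.mem_nhds hz)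
  obtain ⟨r₂, hr₂, hr₂₁, hr₂r⟩ : ∃ r₂ > 0, r₂ ≤ r₁ ∧ r₂ ≤ r := ⟨min r₁ r, lt_min hr₁ hr, min_le_left _ _,
    min_le_right _ _⟩
  have hzr₂ : closedBall z r₂ ⊆ Ω := (closedBall_subset_closedBall hr₂₁).trans hzr₁
  have hbr : ball z (r₂ / 16) ⊆ ball z r := ball_subset_ball (by linarith)
  have hK := topGradConst_pos
  obtain ⟨δ₁, hδ₁, H1⟩ := exists_forall_abs_sub_le hΩo hΩc hne h0 (T := T) (B := B) hr₂ hzr₂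
  obtain ⟨δ₂, hδ₂, H2⟩ := exists_forall_abs_second_diff_le hΩo hΩc hne h0 (T := T) (B := B) hr₂ hzr₂
  have hconv' : TendstoUniformlyOn (fun n w => H n (nearestSite (δ' n) w)) v atTop (ball z (r₂ / 16)) :=
    hconv.mono hbr
  have hvc : ContinuousOn v (ball z (r₂ / 16)) := by
    refine Metric.continuousOn_iff.2 fun b hb ε hε => ⟨ε / (L + 1), by positivity, fun a ha hab => ?_⟩
    calc dist (v a) (v b) = |v a - v b| := Real.dist_eq _ _
      _ ≤ L * dist a b := hLip a (hbr ha) b (hbr hb)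
      _ ≤ L * (ε / (L + 1)) := mul_le_mul_of_nonneg_left hab.le hL0
      _ < ε := by rw [mul_div_assoc', div_lt_iff₀ (by positivity)]; nlinarith
  have h1 : ∀ᶠ n in atTop, ∀ x : Site 2, meshPoint (δ' n) x ∈ ball z (r₂ / 16) → ∀ k : Fin 4,
      |H n (x + cornerUnit k) - H n x| ≤ (32 * topGradConst / r₂) * δ' n := by
    filter_upwards [(tendsto_order.1 hδ0).2 _ hδ₁] with n hn x hx k
    calc _ ≤ 32 * topGradConst * δ' n / r₂ :=
          H1 _ (hδ n) hn (H n) (h01 n) (hharm n) x (ball_subset_ball (by linarith) hx) k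
      _ = 32 * topGradConst / r₂ * δ' n := by ring
  have h2 : ∀ᶠ n in atTop, ∀ x : Site 2, meshPoint (δ' n) x ∈ ball z (r₂ / 16) → ∀ j k : Fin 4,
      |(H n (x + cornerUnit k + cornerUnit j) - H n (x + cornerUnit k)) - (H n (x + cornerUnit j) - H n x)| ≤
        (4096 * topGradConst ^ 2 / r₂ ^ 2) * δ' n ^ 2 := by
    filter_upwards [(tendsto_order.1 hδ0).2 _ hδ₂] with n hn x hx j k
    calc _ ≤ 4096 * topGradConst ^ 2 * δ' n ^ 2 / r₂ ^ 2 := H2 _ (hδ n) hn (H n) (h01 n) (hharm n) x hx j k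
      _ = 4096 * topGradConst ^ 2 / r₂ ^ 2 * δ' n ^ 2 := by ring
  have hrr : 0 < r₂ / 16 := by positivity
  have hL₁ : (0 : ℝ) ≤ 32 * topGradConst / r₂ := by positivity
  have hL₂ : (0 : ℝ) ≤ 4096 * topGradConst ^ 2 / r₂ ^ 2 := by positivity
  obtain ⟨g₀, hg₀c, hg₀u, hq₀⟩ := exists_partialDeriv_limit hrr hL₁ hL₂ hδ hδ0 hconv' hvc h1 h2 0
  obtain ⟨g₁, hg₁c, hg₁u, hq₁⟩ := exists_partialDeriv_limit hrr hL₁ hL₂ hδ hδ0 hconv' hvc h1 h2 1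
  simp only [Fin.isValue, ↓reduceIte] at hq₀
  simp only [Fin.isValue, one_ne_zero, ↓reduceIte] at hq₁
  have hsub : ball z (r₂ / 16 / 8) ⊆ ball z (r₂ / 16 / 4) := ball_subset_ball (by linarith)
  exact ⟨r₂ / 16 / 8, by positivity, g₀, g₁, hg₀c.mono hsub, hg₁c.mono hsub, hg₀u.mono hsub,
    hg₁u.mono hsub, fun w hw => hasFDerivAt_of_quotient_bounds hrr hL₂ hg₀c hg₁c hq₀ hq₁ hw⟩

/-- **Subsequential energy bound** ([GP19], proof of Thm 4.1/Cor 4.15, the half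
`lim inf 𝒞_n ≥ d_Ω(T,B)⁻¹`): if along a subsequence of the dyadic meshes the effective
conductances `𝒞_n = 𝒞(T_n ↔ B_n; Ω_n)` converge to `I`, then `d_Ω(T, B)⁻¹ ≤ I`. Proof: the
potentials `h_n` have a locally-`C¹` subsequential limit `v` (interior estimates + Arzelà–Ascoli),
`∫_Ω |∇v|² ≤ I` (Fatou), `v → 1` at `T°` and `v → 0` at `B°` (no-circuit bridge + weak Beurling),
and the metric `|∇v|` (corrected near the four corners) tests the extremal length.
[cite: GeorgakopoulosPanagiotis2019, Thm 4.1, Thm 4.6, Cor 4.15] -/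
theorem inv_extremalDistance_le_of_subseq (R : RandomPlanarGeometry.ConformalRectangle)
    (h0 : (0 : ℂ) ∈ R.carrier) (hsep : ∀ n : ℕ, OppositeArcsSeparated R ((2 : ℝ)⁻¹ ^ n))
    {k : ℕ → ℕ} (hk : StrictMono k) {I : ℝ≥0∞}
    (hI : Tendsto (fun n => effectiveConductance (domainGraph R.carrier ((2 : ℝ)⁻¹ ^ k n)) 1
      (arcVertices R.carrier ((2 : ℝ)⁻¹ ^ k n) (R.arc 0))
      (arcVertices R.carrier ((2 : ℝ)⁻¹ ^ k n) (R.arc 2))) atTop (𝓝 I)) :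
    (extremalDistance R.carrier (R.arc 0) (R.arc 2))⁻¹ ≤ I := by
  classical
  have hΩo : IsOpen R.carrier := R.isOpen
  have hΩc : IsConnected R.carrier := R.isConnected
  have hne : R.carrierᶜ.Nonempty := ⟨R.boundary 0, fun h =>
    (R.disjoint_carrier_frontier.ne_of_mem h (R.boundary_mem_frontier 0)) rfl⟩
  have hδ : ∀ n, (0 : ℝ) < (2 : ℝ)⁻¹ ^ k n := fun n => by positivity
  have hδ0 : Tendsto (fun n => ((2 : ℝ)⁻¹) ^ k n) atTop (𝓝 0) :=
    (tendsto_pow_atTop_nhds_zero_of_lt_one (by norm_num) (by norm_num)).comp hk.tendsto_atTop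
  -- the potentials `h_n`
  choose h hT hB h01 hE hharm using fun n => exists_potential R (hδ n) (hsep (k n))
  -- equi-Lipschitz bound in the bulk (Thm 4.3)
  have hL : ∀ z ∈ R.carrier, ∃ r > 0, ∃ L ≥ (0 : ℝ), ∀ᶠ n in atTop, ∀ x y : Site 2,
      meshPoint ((2 : ℝ)⁻¹ ^ k n) x ∈ ball z r → meshPoint ((2 : ℝ)⁻¹ ^ k n) y ∈ ball z r →
        |h n x - h n y| ≤
          L * dist (meshPoint ((2 : ℝ)⁻¹ ^ k n) x) (meshPoint ((2 : ℝ)⁻¹ ^ k n) y) := by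
    intro z hz
    obtain ⟨r₀, hr₀, hzr₀⟩ := Metric.nhds_basis_closedBall.mem_iff.1 (hΩo.mem_nhds hz)
    obtain ⟨δ₀, hδ₀, H⟩ :=
      exists_forall_abs_sub_le_mul_dist hΩo hΩc hne h0 (T := R.arc 0) (B := R.arc 2) hr₀ hzr₀
    have hK := topGradConst_pos
    refine ⟨r₀ / 16, by positivity, 64 * topGradConst / r₀, by positivity, ?_⟩
    filter_upwards [(tendsto_order.1 hδ0).2 _ hδ₀] with n hn x y hx hy
    exact H _ (hδ n) hn (h n) (h01 n) (hharm n) x y hx hy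
  -- diagonal extraction
  obtain ⟨φ, hφ, ⟨I', hI'⟩, v, -, hvloc⟩ := exists_subseq_tendstoLocallyUniformly hΩo hδ hδ0 h01 hL
    (fun n => effectiveConductance (domainGraph R.carrier ((2 : ℝ)⁻¹ ^ k n)) 1
      (arcVertices R.carrier ((2 : ℝ)⁻¹ ^ k n) (R.arc 0))
      (arcVertices R.carrier ((2 : ℝ)⁻¹ ^ k n) (R.arc 2)))
  obtain rfl : I = I' := tendsto_nhds_unique (hI.comp hφ.tendsto_atTop) hI'
  have hδ' : ∀ n, (0 : ℝ) < (2 : ℝ)⁻¹ ^ k (φ n) := fun n => hδ (φ n)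
  have hδ'0 : Tendsto (fun n => ((2 : ℝ)⁻¹) ^ k (φ n)) atTop (𝓝 0) := hδ0.comp hφ.tendsto_atTop
  -- local `C¹` structure of `v`
  have hloc : ∀ z ∈ R.carrier, ∃ s > 0, ∃ g₀ g₁ : ℂ → ℝ, ContinuousOn g₀ (ball z s) ∧
      ContinuousOn g₁ (ball z s) ∧
      TendstoUniformlyOn
        (fun n w => (h (φ n) (nearestSite ((2 : ℝ)⁻¹ ^ k (φ n)) w + Pi.single 0 1) -
          h (φ n) (nearestSite ((2 : ℝ)⁻¹ ^ k (φ n)) w)) / (2 : ℝ)⁻¹ ^ k (φ n)) g₀ atTop (ball z s) ∧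
      TendstoUniformlyOn
        (fun n w => (h (φ n) (nearestSite ((2 : ℝ)⁻¹ ^ k (φ n)) w + Pi.single 1 1) -
          h (φ n) (nearestSite ((2 : ℝ)⁻¹ ^ k (φ n)) w)) / (2 : ℝ)⁻¹ ^ k (φ n)) g₁ atTop (ball z s) ∧
      ∀ w ∈ ball z s, HasFDerivAt v (g₀ w • Complex.reCLM + g₁ w • Complex.imCLM) w :=
    fun z hz => exists_local_hasFDerivAt hΩo hΩc hne h0 (T := R.arc 0) (B := R.arc 2)
      (δ' := fun n => (2 : ℝ)⁻¹ ^ k (φ n)) hδ' hδ'0 (H := fun n => h (φ n)) (fun n => h01 (φ n))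
      (fun n => hharm (φ n)) hvloc hz
  choose s hs g₀ g₁ hg₀c hg₁c hg₀u hg₁u hF using hloc
  have hfd : ∀ z (hz : z ∈ R.carrier), ∀ w ∈ ball z (s z hz),
      fderiv ℝ v w = g₀ z hz w • Complex.reCLM + g₁ z hz w • Complex.imCLM :=
    fun z hz w hw => (hF z hz w hw).fderiv
  have hvd : ∀ w ∈ R.carrier, DifferentiableAt ℝ v w := fun w hw =>
    (hF w hw w (mem_ball_self (hs w hw))).differentiableAt
  have hvc : ContinuousOn (fderiv ℝ v) R.carrier := by
    intro z hz
    have hcont : ContinuousOn (fun w => g₀ z hz w • Complex.reCLM + g₁ z hz w • Complex.imCLM)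
        (ball z (s z hz)) :=
      ((hg₀c z hz).smul continuousOn_const).add ((hg₁c z hz).smul continuousOn_const)
    exact ((hcont.congr fun w hw => hfd z hz w hw).continuousAt
      (ball_mem_nhds z (hs z hz))).continuousWithinAt
  have hDi : ∀ i : Fin 2, ∀ z (hz : z ∈ R.carrier), TendstoUniformlyOn
      (fun n w => (h (φ n) (nearestSite ((2 : ℝ)⁻¹ ^ k (φ n)) w + Pi.single i 1) -
        h (φ n) (nearestSite ((2 : ℝ)⁻¹ ^ k (φ n)) w)) / (2 : ℝ)⁻¹ ^ k (φ n))
      (fun w => fderiv ℝ v w (if i = 0 then (1 : ℂ) else Complex.I)) atTop (ball z (s z hz)) := by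
    refine Fin.forall_fin_two.2 ⟨fun z hz => ?_, fun z hz => ?_⟩
    · refine (hg₀u z hz).congr_right fun w hw => ?_
      simp only [Fin.isValue, ↓reduceIte]
      rw [hfd z hz w hw]
      simp
    · refine (hg₁u z hz).congr_right fun w hw => ?_
      simp only [Fin.isValue, one_ne_zero, ↓reduceIte]
      rw [hfd z hz w hw]
      simp
  have hD : ∀ i : Fin 2, TendstoLocallyUniformlyOn
      (fun n w => (h (φ n) (nearestSite ((2 : ℝ)⁻¹ ^ k (φ n)) w + Pi.single i 1) -
        h (φ n) (nearestSite ((2 : ℝ)⁻¹ ^ k (φ n)) w)) / (2 : ℝ)⁻¹ ^ k (φ n))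
      (fun w => fderiv ℝ v w (if i = 0 then (1 : ℂ) else Complex.I)) atTop R.carrier :=
    fun i u hu z hz => ⟨ball z (s z hz), mem_nhdsWithin_of_mem_nhds (ball_mem_nhds z (hs z hz)),
      hDi i z hz u hu⟩
  -- all lattice edges of compact subsets are eventually present
  have hedges : ∀ K' ⊆ R.carrier, IsCompact K' → ∀ᶠ n in atTop, ∀ x : Site 2,
      meshPoint ((2 : ℝ)⁻¹ ^ k (φ n)) x ∈ K' → ∀ i : Fin 2,
        s(x, x + (Pi.single i 1 : Site 2)) ∈ (domainGraph R.carrier ((2 : ℝ)⁻¹ ^ k (φ n))).edgeSet :=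
    fun K' hK' hK'c => eventually_axisEdges_mem hΩo hΩc hne h0 hδ' hδ'0 hK' hK'c
  have hC : ∀ n, networkEnergy (domainGraph R.carrier ((2 : ℝ)⁻¹ ^ k (φ n))) 1 (h (φ n)) ≤
      effectiveConductance (domainGraph R.carrier ((2 : ℝ)⁻¹ ^ k (φ n))) 1
        (arcVertices R.carrier ((2 : ℝ)⁻¹ ^ k (φ n)) (R.arc 0))
        (arcVertices R.carrier ((2 : ℝ)⁻¹ ^ k (φ n)) (R.arc 2)) := fun n => (hE (φ n)).le
  -- Fatou
  have hint : ∫⁻ w in R.carrier, ‖fderiv ℝ v w‖ₑ ^ 2 ≤ I :=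
    lintegral_norm_fderiv_sq_le hΩo R.isBounded (k := fun n => k (φ n))
      ((hk.comp hφ).tendsto_atTop) (h := fun n => h (φ n)) hedges hC hI' hvc hD
  -- boundary values
  have hpt : ∀ w ∈ R.carrier,
      Tendsto (fun n => h (φ n) (nearestSite ((2 : ℝ)⁻¹ ^ k (φ n)) w)) atTop (𝓝 (v w)) := by
    intro w hw
    obtain ⟨r, hr, -, hconv⟩ := hvloc w hw
    exact hconv.tendsto_at (mem_ball_self hr)
  have hnear : ∀ w : ℂ, ∀ r > (0 : ℝ), ∀ᶠ n in atTop,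
      dist (meshPoint ((2 : ℝ)⁻¹ ^ k (φ n)) (nearestSite ((2 : ℝ)⁻¹ ^ k (φ n)) w)) w < r := by
    intro w r hr
    filter_upwards [(tendsto_order.1 hδ'0).2 _ hr] with n hn
    exact (dist_meshPoint_nearestSite_le (hδ' n) w).trans_lt hn
  have hTb : ∀ t ∈ Ioo (R.mark 0) (R.nextMark 0), ∀ ε : ℝ, 0 < ε → ∃ r > 0, ∀ w ∈ R.carrier,
      dist w (R.boundary t) < r → 1 - ε ≤ v w := by
    intro t ht ε hε
    obtain ⟨r, hr, δ₀, hδ₀, Hb⟩ := exists_forall_one_sub_le R h0 0 ht (R.arc 2) hε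
    refine ⟨r / 2, by positivity, fun w hw hwd => ge_of_tendsto (hpt w hw) ?_⟩
    filter_upwards [(tendsto_order.1 hδ'0).2 _ hδ₀, eventually_adj_nearestSite hΩo hΩc hne h0 hδ' hδ'0 hw,
      hnear w (r / 2) (by positivity)] with n hn hadj hd
    refine Hb _ (hδ' n) hn (h (φ n)) (hT (φ n)) (h01 (φ n)) (hharm (φ n)) _ ?_ hadj
    rw [mem_ball]
    linarith [dist_triangle (meshPoint ((2 : ℝ)⁻¹ ^ k (φ n)) (nearestSite ((2 : ℝ)⁻¹ ^ k (φ n)) w))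
      w (R.boundary t)]
  have hBb : ∀ t ∈ Ioo (R.mark 2) (R.nextMark 2), ∀ ε : ℝ, 0 < ε → ∃ r > 0, ∀ w ∈ R.carrier,
      dist w (R.boundary t) < r → v w ≤ ε := by
    intro t ht ε hε
    obtain ⟨r, hr, δ₀, hδ₀, Hb⟩ := exists_forall_one_sub_le R h0 2 ht (R.arc 0) hε
    refine ⟨r / 2, by positivity, fun w hw hwd => le_of_tendsto (hpt w hw) ?_⟩
    filter_upwards [(tendsto_order.1 hδ'0).2 _ hδ₀, eventually_adj_nearestSite hΩo hΩc hne h0 hδ' hδ'0 hw,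
      hnear w (r / 2) (by positivity)] with n hn hadj hd
    have key := Hb _ (hδ' n) hn (fun x => 1 - h (φ n) x) (fun x hx => by simp [hB (φ n) hx])
      (fun x => by
        have := h01 (φ n) x
        simp only [mem_Icc] at this ⊢
        constructor <;> linarith)
      (fun x hx2 hx0 => by
        have hsum := hharm (φ n) x hx0 hx2
        have : ∑ y ∈ ((zdGraph 2).neighborFinset x).filter
            (fun y => (domainGraph R.carrier ((2 : ℝ)⁻¹ ^ k (φ n))).Adj x y),
            ((1 - h (φ n) y) - (1 - h (φ n) x)) =
            -∑ y ∈ ((zdGraph 2).neighborFinset x).filter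
              (fun y => (domainGraph R.carrier ((2 : ℝ)⁻¹ ^ k (φ n))).Adj x y),
              (h (φ n) y - h (φ n) x) := by
          rw [← Finset.sum_neg_distrib]
          exact Finset.sum_congr rfl fun y _ => by ring
        rw [this, hsum, neg_zero])
      _ ?_ hadj
    · linarith
    · rw [mem_ball]
      linarith [dist_triangle (meshPoint ((2 : ℝ)⁻¹ ^ k (φ n)) (nearestSite ((2 : ℝ)⁻¹ ^ k (φ n)) w))
        w (R.boundary t)]
  exact inv_extremalDistance_le R hvd hint hTb hBb

/-- **[GP19] Corollary 4.15, upper half: `lim sup_n R^eff(T_n ↔ B_n; Ω_n) ≤ d_Ω(T, B)`** along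
the dyadic meshes `δ = 2⁻ⁿ`, for a conformal rectangle `(Ω; T, B)` with `0 ∈ Ω` and opposite
arcs separated at every mesh. [cite: GeorgakopoulosPanagiotis2019, Cor 4.15 (with Thm 4.1, 4.6)] -/
theorem limsup_effectiveResistance_le_extremalDistance (R : RandomPlanarGeometry.ConformalRectangle)
    (h0 : (0 : ℂ) ∈ R.carrier) (hsep : ∀ n : ℕ, OppositeArcsSeparated R ((2 : ℝ)⁻¹ ^ n)) :
    limsup (fun n : ℕ => effectiveResistance (domainGraph R.carrier ((2 : ℝ)⁻¹ ^ n)) 1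
      (arcVertices R.carrier ((2 : ℝ)⁻¹ ^ n) (R.arc 0))
      (arcVertices R.carrier ((2 : ℝ)⁻¹ ^ n) (R.arc 2))) atTop ≤
      extremalDistance R.carrier (R.arc 0) (R.arc 2) := by
  refine le_of_forall_gt_imp_ge_of_dense fun b hb => Filter.limsup_le_of_le (by isBoundedDefault) ?_
  by_contra hcon
  obtain ⟨ψ, hψ, hψb⟩ := Filter.extraction_of_frequently_atTop (Filter.not_eventually.1 hcon)
  have hCb : ∀ n, effectiveConductance (domainGraph R.carrier ((2 : ℝ)⁻¹ ^ ψ n)) 1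
      (arcVertices R.carrier ((2 : ℝ)⁻¹ ^ ψ n) (R.arc 0))
      (arcVertices R.carrier ((2 : ℝ)⁻¹ ^ ψ n) (R.arc 2)) ≤ b⁻¹ := fun n =>
    (ENNReal.lt_inv_iff_lt_inv.1 (lt_of_not_ge (hψb n))).le
  obtain ⟨I, φ₂, hφ₂, hIt⟩ := SeqCompactSpace.tendsto_subseq fun n =>
    effectiveConductance (domainGraph R.carrier ((2 : ℝ)⁻¹ ^ ψ n)) 1
      (arcVertices R.carrier ((2 : ℝ)⁻¹ ^ ψ n) (R.arc 0))
      (arcVertices R.carrier ((2 : ℝ)⁻¹ ^ ψ n) (R.arc 2))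
  have hIb : I ≤ b⁻¹ := le_of_tendsto' hIt fun n => hCb (φ₂ n)
  have key := inv_extremalDistance_le_of_subseq R h0 hsep (hψ.comp hφ₂) (I := I) hIt
  exact absurd (ENNReal.inv_le_inv.1 (key.trans hIb)) (not_le.2 hb)

end Assembly

end SquareTiling

end Literature.Probability.LatticeModels
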